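import Mathlib.MeasureTheory.OuterMeasure.Basic
import Mathlib.Analysis.Complex.ExponentialBounds
import Literature.Computability.Cryptography.EncryptionSchemes
import Literature.Computability.Cryptography.YaoAmplification
import Literature.Computability.Complexity.EncodingFrames
import Literature.Computability.Complexity.CircuitLowerBounds
import Literature.Computability.Cryptography.EncryptionSchemesProofs
import HarnessLib

/-!
# Private-key encryption ⇒ one-way functions (Impagliazzo–Luby 1989, Thm. 1): the mathematics

This file (Parts I–VI below, each with its own section docstring) carries the mathematics of the
discharge of the named fact `Literature.Computability.Cryptography.OWFExist_of_secureSKEExist`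
(`Schemes.lean`, crypto-foundations.S13): the counting core (I), the candidate one-way function `F`
(II), the distinguisher at one security parameter (III), the simulation identity (IV), the
advantage bound (V) and the asymptotics giving `SKEOWF.Params.isOneWay_F` (VI) modulo the machine
facts, which are `SchemesOWFProgram.lean` (Parts VII–IX); the assembly is `SchemesProofs.lean`.
-/


/-!
# Private-key encryption ⇒ one-way functions, I: the counting core

First file of the discharge of `Literature.Computability.Cryptography.OWFExist_of_secureSKEExist`
(Impagliazzo–Luby 1989, Thm. 1: secure private-key encryption implies one-way functions), which
is carried out in the sibling files `SchemesOWF*.lean` and assembled in `SchemesProofs.lean`.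

The architecture is Goldreich's (FoC II, §5.5 Exercise 2 with FoC I, §3.8 Exercise 11): the
ciphertext vector of a fixed plaintext vector under the scheme is a polynomial-time constructible
distribution; the two plaintext vectors `M₀ n`, `M₁ n` give two such distributions that are
computationally indistinguishable (security) and *almost disjoint*; for almost disjoint
constructible pairs a plain inverter of the sampling function already yields a distinguisher
(Goldreich's "disjoint case", a variant of the proof of Prop. 3.3.8), so Impagliazzo–Luby's
distributional one-way functions are not needed. This file proves the **almost-disjointness**,
which here comes from *perfect correctness* by counting (no entropy argument):

* `SKEScheme.ctVecPMF_toOuterMeasure_forall₂` — under `Ē_k(m₁, …, m_T)` (independent coins per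
  component) a product event has product probability;
* `pmf_prod_map_apply_le_of_nodup` — for a distribution `P` and pairwise distinct points
  `y₁, …, y_L`, `∏ P(yᵢ) ≤ 2^{-(L-1)}` (at most one point has mass `> 1/2`);
* `SKEScheme.toOuterMeasure_forall₂_dec_le`, `SKEScheme.toOuterMeasure_exists_dec_le` — hence, if
  the own plaintext vector repeats one message `m₀` on `L` components on which the other plaintext
  vector lists `L` distinct messages, the probability that some key `k'` of a set `K` decrypts
  *every* component of `Ē_k(M_b)` to the corresponding component of `M_{1-b}` is at most
  `|K| · 2^{-(L-1)}` (union bound over `K`; for each `k'` the `L` special components are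
  independent encryptions of `m₀`, and `D_{k'}` of them would have to hit `L` distinct targets);
* `SKEScheme.keyFinset`, `SKEScheme.card_keyFinset_le` — the keys `G(1ⁿ; s)`, `s ∈ {0,1}^σ`, are at
  most `2^σ`; `SKEScheme.exists_likely_keyLen` — some key length has probability `≥ 1/(K+1)` when
  keys have length `≤ K` (pigeonhole);
* `SKEScheme.tsum_ctVecPMF_mul` — for a key and messages of fixed lengths (hence a fixed number `ρ`
  of encryption coins per component) `Ē_k` is the push-forward of `U_{Tρ}` along the chunked
  encryption `SKEScheme.encVec`, stated as an expectation identity;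
* `acceptPMF_encVecPMF_apply` — the acceptance probability of a distinguisher in the
  multiple-message game, unfolded along key and ciphertext vector;
* small `tsum` lemmas for expectations under `PMF.bind` / `PMF.map` / uniform coins.

## References

* R. Impagliazzo, M. Luby, *One-way functions are essential for complexity based cryptography*,
  FOCS 1989, Thm. 1 (private-key encryption ⇒ one-way functions).
* O. Goldreich, *Foundations of Cryptography II*, CUP 2004, §5.5 Exercise 2 (encryption schemes
  imply one-way functions; guideline); *Foundations of Cryptography I*, CUP 2001, §3.8 Exercise 11
  (constructible, indistinguishable, statistically far ensembles imply one-way functions; the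
  "disjoint case"), Def. 5.2.9 (`Ē`).
-/

namespace Literature.Computability.Cryptography

open Filter Asymptotics _root_.Computability Complexity Finset
open scoped ENNReal

/-! ### Expectations under `bind`, `map` and uniform coins (`tsum` bookkeeping) -/

/-- `E_{p.bind f}[g] = E_p[a ↦ E_{f a}[g]]`. [folklore] -/
theorem pmf_tsum_bind_mul {α β : Type*} (p : PMF α) (f : α → PMF β) (g : β → ℝ≥0∞) :
    ∑' b, p.bind f b * g b = ∑' a, p a * ∑' b, f a b * g b := by
  simp only [PMF.bind_apply, ENNReal.tsum_mul_right.symm, ENNReal.tsum_mul_left.symm, mul_assoc]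
  exact ENNReal.tsum_comm

/-- `E_{pure a}[g] = g a`. [folklore] -/
theorem pmf_tsum_pure_mul {α : Type*} (a : α) (g : α → ℝ≥0∞) : ∑' b, PMF.pure a b * g b = g a := by
  classical
  have h : ∀ b, PMF.pure a b * g b = if b = a then g a else 0 := fun b => by
    rw [PMF.pure_apply]; split_ifs with hb <;> simp [hb]
  simp_rw [h]
  exact tsum_ite_eq a (fun _ => g a)

/-- `E_{p.map h}[g] = E_p[g ∘ h]`. [folklore] -/
theorem pmf_tsum_map_mul {α β : Type*} (p : PMF α) (h : α → β) (g : β → ℝ≥0∞) :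
    ∑' b, p.map h b * g b = ∑' a, p a * g (h a) := by
  rw [PMF.map, pmf_tsum_bind_mul]
  refine tsum_congr fun a => ?_
  rw [Function.comp_apply, pmf_tsum_pure_mul]

/-- Expectation under uniform coins `{0,1}^m`: a normalised finite sum. [Arora–Barak 2009, §7.1] [folklore] -/
theorem tsum_uniformVector_mul (m : ℕ) (g : List.Vector Bool m → ℝ≥0∞) :
    ∑' r, PMF.uniformOfFintype (List.Vector Bool m) r * g r = (∑ r, g r) / 2 ^ m := by
  rw [tsum_fintype, ENNReal.div_eq_inv_mul, Finset.mul_sum]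
  refine Finset.sum_congr rfl fun r _ => ?_
  rw [PMF.uniformOfFintype_apply, card_vector, Fintype.card_bool]
  push_cast
  rfl

/-- A `PMF` gives every event outer measure at most `1` (twin of `pmf_toOuterMeasure_apply_le_one`,
`CommitmentsSignatures.lean`, not imported here). [folklore] -/
theorem pmf_toOuterMeasure_le_one {α : Type*} (p : PMF α) (s : Set α) : p.toOuterMeasure s ≤ 1 :=
  calc p.toOuterMeasure s ≤ p.toOuterMeasure Set.univ := p.toOuterMeasure.mono (Set.subset_univ _)
    _ = 1 := (PMF.toOuterMeasure_apply_eq_one_iff _ _).2 (Set.subset_univ _)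

/-- Two distinct points carry total mass at most `1`. [folklore] -/
theorem pmf_apply_add_apply_le_one {α : Type*} (p : PMF α) {a b : α} (h : a ≠ b) : p a + p b ≤ 1 := by
  classical
  calc p a + p b = ∑ x ∈ ({a, b} : Finset α), p x := by rw [Finset.sum_pair h]
    _ ≤ ∑' x, p x := ENNReal.sum_le_tsum _
    _ = 1 := p.tsum_coe

/-- **At most one heavy point.** For a distribution `P` and pairwise distinct `y₁, …, y_L`,
`∏ᵢ P(yᵢ) ≤ 2^{-(L-1)}`: either every `P(yᵢ) ≤ 1/2`, or one `P(yᵢ₀) > 1/2` and then all the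
others are `< 1/2`. [folklore] -/
theorem pmf_prod_map_apply_le_of_nodup {β : Type*} (P : PMF β) {ys : List β} (h : ys.Nodup) :
    (ys.map P).prod ≤ 2⁻¹ ^ (ys.length - 1) := by
  have h2 : (2⁻¹ : ℝ≥0∞) ≤ 1 := by norm_num
  by_cases hex : ∃ y ∈ ys, 2⁻¹ < P y
  · obtain ⟨y₀, hy₀, hgt⟩ := hex
    obtain ⟨l₁, l₂, rfl⟩ := List.append_of_mem hy₀
    have hnot : y₀ ∉ l₁ ++ l₂ := by
      have := List.nodup_middle.1 h
      exact (List.nodup_cons.1 this).1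
    have hsmall : ∀ y ∈ l₁ ++ l₂, P y ≤ 2⁻¹ := by
      intro y hy
      have hne : y ≠ y₀ := fun e => hnot (e ▸ hy)
      have hsum := pmf_apply_add_apply_le_one P hne
      rw [← not_lt]
      intro hlt
      have h2 : (2⁻¹ : ℝ≥0∞) + 2⁻¹ < P y + P y₀ := ENNReal.add_lt_add hlt hgt
      rw [ENNReal.inv_two_add_inv_two] at h2
      exact absurd (h2.trans_le hsum) (lt_irrefl _)
    have hl₁ : (l₁.map P).prod ≤ 2⁻¹ ^ l₁.length := by
      simpa using List.prod_le_pow_card (l₁.map P) 2⁻¹ (by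
        intro x hx; obtain ⟨y, hy, rfl⟩ := List.mem_map.1 hx; exact hsmall y (by simp [hy]))
    have hl₂ : (l₂.map P).prod ≤ 2⁻¹ ^ l₂.length := by
      simpa using List.prod_le_pow_card (l₂.map P) 2⁻¹ (by
        intro x hx; obtain ⟨y, hy, rfl⟩ := List.mem_map.1 hx; exact hsmall y (by simp [hy]))
    have hP : P y₀ ≤ 1 := P.coe_le_one y₀
    calc ((l₁ ++ y₀ :: l₂).map P).prod = (l₁.map P).prod * (P y₀ * (l₂.map P).prod) := by simp
      _ ≤ 2⁻¹ ^ l₁.length * (1 * 2⁻¹ ^ l₂.length) := mul_le_mul' hl₁ (mul_le_mul' hP hl₂)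
      _ = 2⁻¹ ^ ((l₁ ++ y₀ :: l₂).length - 1) := by
        rw [one_mul, ← pow_add]; congr 1; simp only [List.length_append, List.length_cons]; omega
  · push Not at hex
    calc (ys.map P).prod ≤ 2⁻¹ ^ ys.length := by
          simpa using List.prod_le_pow_card (ys.map P) 2⁻¹ (by
            intro x hx; obtain ⟨y, hy, rfl⟩ := List.mem_map.1 hx; exact hex y hy)
      _ ≤ 2⁻¹ ^ (ys.length - 1) := pow_le_pow_right_of_le_one' h2 (Nat.sub_le _ _)

/-- Splitting a coin vector of length `c = a + b` into its first `a` and last `b` coins. [folklore] -/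
def vecCut (a b c : ℕ) (h : c = a + b) : List.Vector Bool c ≃ List.Vector Bool a × List.Vector Bool b where
  toFun v := (⟨v.toList.take a, by simp [h]⟩, ⟨v.toList.drop a, by simp [h]⟩)
  invFun p := ⟨p.1.toList ++ p.2.toList, by simp [h]⟩
  left_inv v := List.Vector.eq _ _ (List.take_append_drop a v.toList)
  right_inv p := by
    obtain ⟨x, y⟩ := p
    have hx : x.toList.length = a := x.toList_length
    exact Prod.ext (List.Vector.eq _ _ (List.take_left' hx)) (List.Vector.eq _ _ (List.drop_left' hx))

namespace SKEScheme

variable (S : SKEScheme)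

/-! ### Product events under `Ē_k` -/

/-- **Independence of the components of `Ē_k(m₁, …, m_T)`.** The probability that every component
of the ciphertext vector lies in its own set is the product of the component probabilities (fresh
coins per component). [Goldreich 2004, Def. 5.2.9 (`Ē_e(x̄)`: "independent coins")] [cite: Goldreich2004, Def. 5.2.9] -/
theorem ctVecPMF_toOuterMeasure_forall₂ (k : List Bool) :
    ∀ (ms : List (List Bool)) (As : List (Set (List Bool))), ms.length = As.length →
      (S.ctVecPMF k ms).toOuterMeasure {cs | List.Forall₂ (fun c A => c ∈ A) cs As} =
        (List.zipWith (fun m A => (S.ctPMF k m).toOuterMeasure A) ms As).prod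
  | [], [], _ => by simp [ctVecPMF, PMF.toOuterMeasure_pure_apply]
  | [], _ :: _, h => by simp at h
  | _ :: _, [], h => by simp at h
  | m :: ms, A :: As, h => by
    have ih := ctVecPMF_toOuterMeasure_forall₂ k ms As (by simpa using h)
    rw [ctVecPMF, PMF.toOuterMeasure_bind_apply, List.zipWith_cons_cons, List.prod_cons, ← ih,
      PMF.toOuterMeasure_apply, ← ENNReal.tsum_mul_right]
    refine tsum_congr fun c => ?_
    rw [PMF.toOuterMeasure_map_apply]
    by_cases hc : c ∈ A
    · rw [Set.indicator_of_mem hc]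
      congr 2
      ext cs
      simp [hc]
    · rw [Set.indicator_of_notMem hc, zero_mul]
      have : (fun cs : List (List Bool) => c :: cs) ⁻¹'
          {cs | List.Forall₂ (fun c (A : Set (List Bool)) => c ∈ A) cs (A :: As)} = ∅ := by
        ext cs; simp [hc]
      rw [this, MeasureTheory.measure_empty, mul_zero]

/-- `zipWith` against a constant list. [folklore] -/
private theorem zipWith_replicate_left {α β γ : Type*} (f : α → β → γ) (a : α) :
    ∀ ys : List β, List.zipWith f (List.replicate ys.length a) ys = ys.map (f a)
  | [] => rfl
  | y :: ys => by simp [List.replicate_succ, zipWith_replicate_left f a ys]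

/-- All factors of a list of event probabilities are `≤ 1`, so the product is `≤ 1`. [folklore] -/
private theorem prod_zipWith_toOuterMeasure_le_one (k : List Bool) :
    ∀ (ms : List (List Bool)) (As : List (Set (List Bool))),
      (List.zipWith (fun m A => (S.ctPMF k m).toOuterMeasure A) ms As).prod ≤ 1
  | [], _ => by simp
  | _ :: _, [] => by simp
  | m :: ms, A :: As => by
    rw [List.zipWith_cons_cons, List.prod_cons]
    calc _ ≤ (1 : ℝ≥0∞) * 1 := mul_le_mul' (pmf_toOuterMeasure_le_one _ _)
          (prod_zipWith_toOuterMeasure_le_one k ms As)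
      _ = 1 := one_mul _

/-- **A foreign key cannot explain the ciphertext vector** (one key). Let the own plaintext vector
be `ms = l₁ ++ m₀^L ++ l₃` and the foreign one `ms' = l₁' ++ ys ++ l₃'` with aligned blocks and
`ys` a list of `L` pairwise distinct messages. For every pair of keys `k, k'`, the probability over
`c̄ ← Ē_k(ms)` that `D_{k'}(cᵢ) = msᵢ'` for *every* component is at most `2^{-(L-1)}`: the `L`
middle components are independent encryptions of `m₀`, and the distribution of `D_{k'}(E_k(m₀))`
gives mass `> 1/2` to at most one of the `L` distinct targets. [Goldreich 2001, §3.8 Exercise 11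
(guideline: "almost disjoint" ensembles); Goldreich 2004, §5.5 Exercise 2] [cite: Goldreich2004, §5.5 Exercise 2 (guideline)] -/
theorem toOuterMeasure_forall₂_dec_le (k k' : List Bool) {l₁ l₃ l₁' l₃' : List (List Bool)}
    {m₀ : List Bool} {ys : List (List Bool)} (h₁ : l₁.length = l₁'.length) (hys : ys.Nodup) :
    (S.ctVecPMF k (l₁ ++ List.replicate ys.length m₀ ++ l₃)).toOuterMeasure
        {cs | List.Forall₂ (fun c m' => S.dec k' c = some m') cs (l₁' ++ ys ++ l₃')} ≤
      2⁻¹ ^ (ys.length - 1) := by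
  classical
  -- if the tails are misaligned the event forces a length mismatch; reduce to aligned tails first
  by_cases h₃ : l₃.length = l₃'.length
  swap
  · refine le_trans (PMF.toOuterMeasure_mono _ ?_) (by simp : (S.ctVecPMF k _).toOuterMeasure ∅ ≤ _)
    rintro cs ⟨hcs, hsupp⟩
    have hlen := (List.Forall₂.length_eq hcs)
    have hlen' : cs.length = (l₁ ++ List.replicate ys.length m₀ ++ l₃).length := by
      -- support of `Ē_k(ms)` consists of vectors of the same length as `ms`
      have key : ∀ (ms : List (List Bool)) (cs : List (List Bool)), cs ∈ (S.ctVecPMF k ms).support →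
          cs.length = ms.length := by
        intro ms
        induction ms with
        | nil => intro cs h; simp [ctVecPMF] at h; simp [h]
        | cons m ms ih =>
          intro cs h
          simp only [ctVecPMF, PMF.support_bind, PMF.support_map, Set.mem_iUnion, Set.mem_image] at h
          obtain ⟨c, -, cs', hcs', rfl⟩ := h
          simp [ih cs' hcs']
      exact key _ _ hsupp
    simp at hlen hlen'
    exfalso
    omega
  set F : List Bool → Set (List Bool) → ℝ≥0∞ := fun m A => (S.ctPMF k m).toOuterMeasure A with hF
  set g : List Bool → Set (List Bool) := fun m' => {c | S.dec k' c = some m'} with hg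
  have hevent : {cs : List (List Bool) | List.Forall₂ (fun c m' => S.dec k' c = some m') cs (l₁' ++ ys ++ l₃')} =
      {cs | List.Forall₂ (fun c A => c ∈ A) cs ((l₁' ++ ys ++ l₃').map g)} := by
    ext cs
    simp only [Set.mem_setOf_eq, List.forall₂_map_right_iff, hg]
  rw [hevent, S.ctVecPMF_toOuterMeasure_forall₂ k _ _ (by simp [h₁, h₃]), List.map_append,
    List.map_append, List.zipWith_append (by simp [h₁]), List.zipWith_append (by simp [h₁]), List.prod_append,
    List.prod_append]
  have hmid : (List.zipWith (fun m A => (S.ctPMF k m).toOuterMeasure A) (List.replicate ys.length m₀)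
      (ys.map g)).prod ≤ 2⁻¹ ^ (ys.length - 1) := by
    have e1 : List.zipWith (fun m A => (S.ctPMF k m).toOuterMeasure A) (List.replicate ys.length m₀)
        (ys.map g) = (ys.map some).map ((S.ctPMF k m₀).map (S.dec k')) := by
      rw [show ys.length = (ys.map g).length by simp, zipWith_replicate_left]
      simp only [List.map_map]
      refine List.map_congr_left fun y _ => ?_
      simp only [Function.comp_apply, hg]
      rw [← PMF.toOuterMeasure_apply_singleton, PMF.toOuterMeasure_map_apply]
      rfl
    rw [e1]
    have hnd : (ys.map some).Nodup := hys.map (Option.some_injective _)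
    simpa using pmf_prod_map_apply_le_of_nodup ((S.ctPMF k m₀).map (S.dec k')) hnd
  calc _ ≤ (1 : ℝ≥0∞) * 2⁻¹ ^ (ys.length - 1) * 1 :=
        mul_le_mul' (mul_le_mul' (S.prod_zipWith_toOuterMeasure_le_one k _ _) hmid)
          (S.prod_zipWith_toOuterMeasure_le_one k _ _)
    _ = 2⁻¹ ^ (ys.length - 1) := by rw [one_mul, mul_one]

/-- **A set of foreign keys cannot explain the ciphertext vector** (union bound over `K`): in the
situation of `toOuterMeasure_forall₂_dec_le`, the probability that *some* `k' ∈ K` decrypts every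
component of `Ē_k(ms)` to the corresponding component of `ms'` is at most `|K| · 2^{-(L-1)}`.
[Goldreich 2001, §3.8 Exercise 11; Goldreich 2004, §5.5 Exercise 2] [cite: Goldreich2004, §5.5 Exercise 2 (guideline)] -/
theorem toOuterMeasure_exists_dec_le (k : List Bool) (K : Finset (List Bool))
    {l₁ l₃ l₁' l₃' : List (List Bool)} {m₀ : List Bool} {ys : List (List Bool)}
    (h₁ : l₁.length = l₁'.length) (hys : ys.Nodup) :
    (S.ctVecPMF k (l₁ ++ List.replicate ys.length m₀ ++ l₃)).toOuterMeasure
        {cs | ∃ k' ∈ K, List.Forall₂ (fun c m' => S.dec k' c = some m') cs (l₁' ++ ys ++ l₃')} ≤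
      K.card * 2⁻¹ ^ (ys.length - 1) := by
  have hU : {cs : List (List Bool) | ∃ k' ∈ K, List.Forall₂ (fun c m' => S.dec k' c = some m') cs (l₁' ++ ys ++ l₃')}
      = ⋃ k' ∈ K, {cs | List.Forall₂ (fun c m' => S.dec k' c = some m') cs (l₁' ++ ys ++ l₃')} := by
    ext cs; simp
  rw [hU]
  calc _ ≤ ∑ k' ∈ K, (S.ctVecPMF k (l₁ ++ List.replicate ys.length m₀ ++ l₃)).toOuterMeasure
          {cs | List.Forall₂ (fun c m' => S.dec k' c = some m') cs (l₁' ++ ys ++ l₃')} :=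
        MeasureTheory.measure_biUnion_finset_le _ _
    _ ≤ ∑ _k' ∈ K, (2⁻¹ : ℝ≥0∞) ^ (ys.length - 1) :=
        Finset.sum_le_sum fun k' _ => S.toOuterMeasure_forall₂_dec_le k k' h₁ hys
    _ = K.card * 2⁻¹ ^ (ys.length - 1) := by rw [Finset.sum_const, nsmul_eq_mul]

/-! ### The key space -/

/-- `unaryEncodeNat n = 1ⁿ` has length `n`. [folklore] -/
theorem length_unaryEncodeNat (n : ℕ) : (unaryEncodeNat n).length = n := by
  induction n with
  | zero => rfl
  | succ n ih => simp [unaryEncodeNat, ih]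

/-- The finite set of keys `G(1ⁿ; s)`, `s ∈ {0,1}^σ`, `σ = coinLen_G(n)` (the support of `keyPMF n`
as a `Finset`). [Goldreich 2004, Def. 5.1.1] [cite: Goldreich2004, Def. 5.1.1] -/
noncomputable def keyFinset (n : ℕ) : Finset (List Bool) :=
  Finset.univ.image fun s : List.Vector Bool (S.keyGen.coinLen (unaryEncodeNat n).length) =>
    S.keyGen.run n s.toList

/-- The key distribution as an explicit push-forward of uniform coins (with the coin count named).
[Goldreich 2004, Def. 5.1.1; Arora–Barak 2009, §7.1] [cite: Goldreich2004, Def. 5.1.1] -/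
theorem keyPMF_eq_map {n σ : ℕ} (hσ : S.keyGen.coinLen (unaryEncodeNat n).length = σ) :
    S.keyPMF n = (PMF.uniformOfFintype (List.Vector Bool σ)).map fun s => S.keyGen.run n s.toList := by
  subst hσ; rfl

/-- The ciphertext distribution for a fixed key as an explicit push-forward of uniform coins.
[Goldreich 2004, Def. 5.1.1; Arora–Barak 2009, §7.1] [cite: Goldreich2004, Def. 5.1.1] -/
theorem ctPMF_eq_map {k m : List Bool} {ρ : ℕ} (hρ : S.enc.coinLen (boolPair k m).length = ρ) :
    S.ctPMF k m = (PMF.uniformOfFintype (List.Vector Bool ρ)).map fun r => S.enc.run (k, m) r.toList := by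
  subst hρ; rfl

/-- Every key in the support of `G(1ⁿ)` is some `G(1ⁿ; s)`. [Goldreich 2004, Def. 5.1.1] [cite: Goldreich2004, Def. 5.1.1] -/
theorem mem_keyFinset_of_mem_support {n : ℕ} {k : List Bool} (hk : k ∈ (S.keyPMF n).support) :
    k ∈ S.keyFinset n := by
  rw [S.keyPMF_eq_map rfl, PMF.support_map, PMF.support_uniformOfFintype, Set.top_eq_univ, Set.image_univ] at hk
  obtain ⟨s, rfl⟩ := hk
  exact Finset.mem_image.2 ⟨s, Finset.mem_univ _, rfl⟩

/-- Conversely every `G(1ⁿ; s)` is in the support. [Goldreich 2004, Def. 5.1.1] [cite: Goldreich2004, Def. 5.1.1] -/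
theorem mem_support_of_mem_keyFinset {n : ℕ} {k : List Bool} (hk : k ∈ S.keyFinset n) :
    k ∈ (S.keyPMF n).support := by
  rw [S.keyPMF_eq_map rfl, PMF.support_map, PMF.support_uniformOfFintype, Set.top_eq_univ, Set.image_univ]
  obtain ⟨s, -, rfl⟩ := Finset.mem_image.1 hk
  exact ⟨s, rfl⟩

/-- **At most `2^σ` keys**: `|{G(1ⁿ; s) : s ∈ {0,1}^σ}| ≤ 2^σ`. [Goldreich 2004, §5.5 Exercise 2
(guideline: "`K_n` may contain at most `n` bits of information")] [cite: Goldreich2004, §5.5 Exercise 2 (guideline)] -/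
theorem card_keyFinset_le {n σ : ℕ} (hσ : S.keyGen.coinLen (unaryEncodeNat n).length = σ) :
    (S.keyFinset n).card ≤ 2 ^ σ := by
  subst hσ
  unfold keyFinset
  refine Finset.card_image_le.trans ?_
  rw [Finset.card_univ, card_vector, Fintype.card_bool]

/-- **A most likely key length.** If all keys `G(1ⁿ; s)` have length `≤ Kmax`, some length `λ ≤ Kmax`
is attained by at least a `1/(Kmax+1)` fraction of the seeds (pigeonhole). [folklore] -/
theorem exists_likely_keyLen {n σ Kmax : ℕ}
    (hlen : ∀ s : List.Vector Bool σ, (S.keyGen.run n s.toList).length ≤ Kmax) :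
    ∃ lam ≤ Kmax, 2 ^ σ ≤ (Kmax + 1) *
      (Finset.univ.filter fun s : List.Vector Bool σ => (S.keyGen.run n s.toList).length = lam).card := by
  classical
  set cnt : ℕ → ℕ := fun l => (Finset.univ.filter fun s : List.Vector Bool σ =>
    (S.keyGen.run n s.toList).length = l).card with hcnt
  obtain ⟨lam, hlam, hmax⟩ := Finset.exists_max_image (Finset.range (Kmax + 1)) cnt (by simp)
  refine ⟨lam, Nat.lt_succ_iff.1 (Finset.mem_range.1 hlam), ?_⟩
  have hsum : ∑ l ∈ Finset.range (Kmax + 1), cnt l = 2 ^ σ := by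
    show ∑ l ∈ Finset.range (Kmax + 1), (Finset.univ.filter fun s : List.Vector Bool σ =>
      (S.keyGen.run n s.toList).length = l).card = 2 ^ σ
    rw [← Finset.card_eq_sum_card_fiberwise (fun s _ => Finset.mem_range.2 (Nat.lt_succ_of_le (hlen s))),
      Finset.card_univ, card_vector, Fintype.card_bool]
  calc 2 ^ σ = ∑ l ∈ Finset.range (Kmax + 1), cnt l := hsum.symm
    _ ≤ ∑ _l ∈ Finset.range (Kmax + 1), cnt lam := Finset.sum_le_sum fun l hl => hmax l hl
    _ = (Kmax + 1) * cnt lam := by rw [Finset.sum_const, Finset.card_range, smul_eq_mul]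

/-! ### `Ē_k` as a push-forward of flat uniform coins (fixed lengths) -/

/-- Chunked encryption of a message list with one flat coin string, `ρ` coins per component:
`encVec k ρ (m₁, …, m_T) r = (E_k(m₁; r[0,ρ)), E_k(m₂; r[ρ,2ρ)), …)`. [Goldreich 2004, Def. 5.2.9] [cite: Goldreich2004, Def. 5.2.9] -/
def encVec (k : List Bool) (ρ : ℕ) : List (List Bool) → List Bool → List (List Bool)
  | [], _ => []
  | m :: ms, r => S.enc.run (k, m) (r.take ρ) :: encVec k ρ ms (r.drop ρ)

/-- `encVec` on no messages. [folklore] -/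
@[simp] theorem encVec_nil (k : List Bool) (ρ : ℕ) (r : List Bool) : S.encVec k ρ [] r = [] := rfl

/-- `encVec` on one more message. [folklore] -/
@[simp] theorem encVec_cons (k : List Bool) (ρ : ℕ) (m : List Bool) (ms : List (List Bool)) (r : List Bool) :
    S.encVec k ρ (m :: ms) r = S.enc.run (k, m) (r.take ρ) :: S.encVec k ρ ms (r.drop ρ) := rfl

/-- `encVec` has one ciphertext per message. [folklore] -/
@[simp] theorem length_encVec (k : List Bool) (ρ : ℕ) : ∀ (ms : List (List Bool)) (r : List Bool),
    (S.encVec k ρ ms r).length = ms.length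
  | [], _ => rfl
  | _ :: ms, r => by simp [length_encVec k ρ ms]

/-- **`Ē_k` is the push-forward of `U_{Tρ}` along `encVec`** when every component uses `ρ` coins
(fixed key and message lengths), stated as an expectation identity: `E_{c̄ ← Ē_k(ms)}[g(c̄)] =
2^{-Tρ} Σ_{r ∈ {0,1}^{Tρ}} g(encVec k ρ ms r)`. [Goldreich 2004, Def. 5.2.9; Arora–Barak 2009, §7.1] [cite: Goldreich2004, Def. 5.2.9] -/
theorem tsum_ctVecPMF_mul (k : List Bool) (ρ : ℕ) :
    ∀ (ms : List (List Bool)), (∀ m ∈ ms, S.enc.coinLen (boolPair k m).length = ρ) →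
      ∀ g : List (List Bool) → ℝ≥0∞,
        ∑' cs, S.ctVecPMF k ms cs * g cs =
          (∑ r : List.Vector Bool (ms.length * ρ), g (S.encVec k ρ ms r.toList)) / 2 ^ (ms.length * ρ)
  | [], _, g => by
    rw [ctVecPMF, pmf_tsum_pure_mul]
    simp
  | m :: ms, hρ, g => by
    have ih := tsum_ctVecPMF_mul k ρ ms (fun m' hm' => hρ m' (by simp [hm']))
    rw [ctVecPMF, pmf_tsum_bind_mul, S.ctPMF_eq_map (hρ m (by simp)), pmf_tsum_map_mul]
    simp only [pmf_tsum_map_mul, ih, tsum_uniformVector_mul]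
    have hlen : (ms.length + 1) * ρ = ρ + ms.length * ρ := by ring
    rw [List.length_cons, Fintype.sum_equiv (vecCut ρ (ms.length * ρ) _ hlen)
      (fun v => g (S.encVec k ρ (m :: ms) v.toList))
      (fun p => g (S.enc.run (k, m) p.1.toList :: S.encVec k ρ ms p.2.toList)) (fun v => rfl),
      Fintype.sum_prod_type]
    simp only [ENNReal.div_eq_inv_mul, Finset.mul_sum]
    refine Finset.sum_congr rfl fun r _ => Finset.sum_congr rfl fun r₁ _ => ?_
    rw [hlen, pow_add, ENNReal.mul_inv (Or.inl (by positivity)) (Or.inl (by simp)), mul_assoc]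

end SKEScheme

/-! ### The acceptance probability in the multiple-message game -/

/-- **Unfolding the multiple-message experiment.** The probability that `D` accepts
`(1ⁿ, listBool.encode (Ē_k(ms)))`, `k ← G(1ⁿ)`, is the key-average of the `Ē_k`-average of
`Pr_r[D(1ⁿ, ⟨c̄⟩; r) = 1]`. [Goldreich 2004, Def. 5.2.9] [cite: Goldreich2004, Def. 5.2.9] -/
theorem acceptPMF_encVecPMF_apply (S : SKEScheme) (D : RandAlg (List Bool) Bool) (n : ℕ)
    (ms : List (List Bool)) (b : Bool) :
    acceptPMF D n (S.encVecPMF n ms) b =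
      ∑' k, S.keyPMF n k * ∑' cs, S.ctVecPMF k ms cs *
        D.outputPMF id (boolPair (unaryEncodeNat n) ((encodingList Bool).listBool.encode cs)) b := by
  rw [acceptPMF, SKEScheme.encVecPMF, PMF.bind_bind, PMF.bind_apply]
  refine tsum_congr fun k => ?_
  rw [PMF.bind_map, PMF.bind_apply]
  rfl

end Literature.Computability.Cryptography


/-!
# Private-key encryption ⇒ one-way functions, II: the candidate one-way function

Second file of the discharge of `OWFExist_of_secureSKEExist` (Impagliazzo–Luby 1989, Thm. 1); see
`SchemesOWF.lean`, Part I for the architecture. Here the candidate one-way function is *defined* (as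
a plain string function; its polynomial-time program is `SchemesOWFProgram.lean`, Part VII) and its
combinatorics is proved.

## The construction (Goldreich 2004, §5.5 Exercise 2, adapted to the tree's machine model)

Print: `f(key coins, plaintexts, encryption coins) = (plaintexts, ciphertexts)`. In the tree's
model of probabilistic machines (`RandAlg`, `Randomized.lean`) the coin budgets of the scheme —
`σ(n) = coinLen_G(n)` key-generation coins, `ρ = coinLen_E(|⟨k, m⟩|)` encryption coins, the latter
depending on the (random) key length — are *arbitrary* polynomially bounded functions, so no
polynomial-time `f` can cut its input into these pieces. The remedy is to let the **input length
carry the budgets** and to take a **direct product over all block lengths**: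

* `Params.blockFn` (the block function `f_j` on inputs `u` of length `j`): decode
  `j = B(n)^6 + σ̂ + B(n)·λ̂ + B(n)²·ρ̂` (`n = nOf j`, digits `< B(n)`, `Params.B` a base polynomial
  dominating all budgets), read `u = b · s · r₀ ⋯ r_{T-1} · junk` with `|s| = σ̂`, `|rₜ| = ρ̂`,
  compute `k = G(1ⁿ; s)`; if `|k| ≠ λ̂` output `⊥ = ε`, else output the encoded ciphertext vector
  `⟨Ē_k(M_b(n); r̄)⟩` of the fixed plaintext vector `Params.msgs b n` (`T(n) = 2L(n)` messages of
  length `L(n)`: `M₀ = (m₀)^L ++ (m₀, …, m_{L-1})`, `M₁ = (m₀, …, m_{L-1}) ++ (m₀)^L`,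
  `mᵢ = 1^{i+1} 0^{L-1-i}` — the shape consumed by `SKEScheme.toOuterMeasure_exists_dec_le`);
* the *good* length `Params.jStar n σ λ ρ` carries the true budgets (`nOf_jStar`, `blockFn` on
  good lengths: `blockFn_eq_of_good`);
* `Params.F sf` (the candidate): on `w` of length `N`, with `M = Mof N` (`M³ ≤ N`), cut `M` copies
  of a block of each length `j = 1, …, M` consecutively out of `w` (`lens`, `chop`, `blocks`), apply
  `blockFn` to each, and output `pad(⟨1^M, frames outputs⟩)` padded to the fixed length
  `Λ(N) + 1` (`padTo`, `Λof sf`, `sf` a length bound for `blockFn`), so that an inverter's coin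
  count depends on `N` only;
* `F_eq_F_iff`-type facts: `F w' = F w` forces equal block counts and equal block *outputs*
  (`blockFn_blocks_eq_of_F_eq`); the spliced form `Params.Fsplice` (one block output replaced),
  `F_eq_Fsplice`, and its independence from the replaced block's input bits (`Fsplice_surgery`);
  offsets of blocks (`take_sum_lens`, `blocks_getElem`).

## References

* R. Impagliazzo, M. Luby, *One-way functions are essential for complexity based cryptography*,
  FOCS 1989, Thm. 1.
* O. Goldreich, *Foundations of Cryptography II*, CUP 2004, §5.5 Exercise 2; *Foundations of
  Cryptography I*, CUP 2001, §2.2.3 (one-way functions defined on all input lengths, padding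
  `10*`, eq. (2.3)), §2.3.1 (direct products), §3.8 Exercise 11.
-/

namespace Literature.Computability.Cryptography

open _root_.Computability Complexity Polynomial

namespace SKEOWF

noncomputable section

/-! ### Small generalities -/

/-- `0^n`. [folklore] -/
abbrev zeros (n : ℕ) : List Bool := List.replicate n false

/-- The `i`-th test message of length `L`: `1^{i+1} 0^{L-1-i}` (for `i < L`), written as a cut of
`1^{i+1} 0^L` to length `L` (the form the program computes). [Goldreich 2004, §5.5 Exercise 2
(plaintexts of the constructible ensembles)] [folklore] -/
def msg (L i : ℕ) : List Bool := (ones (i + 1) ++ zeros L).take L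

/-- Test messages have length `L`. [folklore] -/
@[simp] theorem length_msg (L i : ℕ) : (msg L i).length = L := by
  simp [msg, List.length_take]

/-- Explicit form of `msg L i` for `i < L`. [folklore] -/
theorem msg_eq {L i : ℕ} (h : i < L) : msg L i = ones (i + 1) ++ zeros (L - (i + 1)) := by
  rw [msg, List.take_append, List.take_of_length_le (by simp; omega), List.take_replicate]
  congr 2
  simp

/-- The number of `1`s in `msg L i` is `i + 1` (for `i < L`). [folklore] -/
theorem count_msg {L i : ℕ} (h : i < L) : (msg L i).count true = i + 1 := by
  rw [msg_eq h, List.count_append, List.count_replicate_self, List.count_replicate]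
  simp

/-- Distinct indices give distinct test messages. [folklore] -/
theorem msg_injOn {L i i' : ℕ} (hi : i < L) (hi' : i' < L) (h : msg L i = msg L i') : i = i' := by
  have := congrArg (List.count true) h
  rw [count_msg hi, count_msg hi'] at this
  omega

/-- The test messages `m₀, …, m_{L-1}` are pairwise distinct. [folklore] -/
theorem nodup_map_msg (L : ℕ) : ((List.range L).map (msg L)).Nodup := by
  refine List.Nodup.map_on ?_ (List.nodup_range)
  intro i hi i' hi' h
  exact msg_injOn (List.mem_range.1 hi) (List.mem_range.1 hi') h

/-- A pair code is nonempty (twin of `QCircuit.boolPair_ne_nil`, `QuantumCircuit.lean`, not imported here). [folklore] -/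
theorem boolPair_ne_nil (a c : List Bool) : boolPair a c ≠ [] := by
  intro h; have := congrArg List.length h; simp at this

/-- `padTo Λ y = y 1 0^{Λ - |y|}`: the `10*`-padding to the common length `Λ + 1`.
[Goldreich 2001, §2.2.3.2, eq. (2.3)] [cite: Goldreich2001, §2.2.3.2 eq. (2.3)] -/
def padTo (Λ : ℕ) (y : List Bool) : List Bool := y ++ true :: zeros (Λ - y.length)

/-- Length of a padded string. [folklore] -/
theorem length_padTo {Λ : ℕ} {y : List Bool} (h : y.length ≤ Λ) : (padTo Λ y).length = Λ + 1 := by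
  simp [padTo]; omega

/-- Removing the padding (`Yao.unpad`: drop the trailing `0`s and the final `1`) recovers the
string, whatever the target length. [folklore] -/
theorem unpad_padTo (Λ : ℕ) (y : List Bool) : Yao.unpad (padTo Λ y) = y := by
  simp only [Yao.unpad, padTo, List.reverse_append, List.reverse_cons, List.reverse_replicate,
    List.append_assoc, List.singleton_append]
  rw [List.dropWhile_append_of_pos ?_]
  · simp
  · intro b hb
    rw [List.mem_replicate] at hb
    simp [hb.2]

/-- The padding is injective, across target lengths. [folklore] -/
theorem padTo_inj {Λ Λ' : ℕ} {y y' : List Bool} (h : padTo Λ y = padTo Λ' y') : y = y' := by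
  have := congrArg Yao.unpad h
  rwa [unpad_padTo, unpad_padTo] at this

/-- `frames` is injective (`Yao.frames_injective`), as an `iff` for rewriting. [folklore] -/
theorem frames_eq_iff {l l' : List (List Bool)} : frames l = frames l' ↔ l = l' :=
  ⟨fun h => Yao.frames_injective h, fun h => h ▸ rfl⟩

/-- `encVec` reads only the first `T·ρ` coins. [folklore] -/
theorem _root_.Literature.Computability.Cryptography.SKEScheme.encVec_take (S : SKEScheme) (k : List Bool) (ρ : ℕ) :
    ∀ (ms : List (List Bool)) (r : List Bool), S.encVec k ρ ms (r.take (ms.length * ρ)) = S.encVec k ρ ms r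
  | [], _ => rfl
  | m :: ms, r => by
    rw [SKEScheme.encVec_cons, SKEScheme.encVec_cons, List.length_cons, Nat.succ_mul, List.take_take,
      min_eq_left (by omega), show (List.take (ms.length * ρ + ρ) r).drop ρ = (r.drop ρ).take (ms.length * ρ) by
        rw [List.drop_take]; congr 1; omega, SKEScheme.encVec_take S k ρ ms]

/-! ### Cutting a string into consecutive blocks -/

/-- `chop (ℓ₁, …, ℓ_q) w`: the consecutive blocks of `w` of lengths `ℓ₁, ℓ₂, …` (short blocks at
the end if `w` is too short). [Goldreich 2001, §2.3.1 (breaking the input into blocks)] [folklore] -/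
def chop : List ℕ → List Bool → List (List Bool)
  | [], _ => []
  | l :: ls, w => w.take l :: chop ls (w.drop l)

/-- `chop` on no lengths. [folklore] -/
@[simp] theorem chop_nil (w : List Bool) : chop [] w = [] := rfl

/-- `chop` on one more length. [folklore] -/
@[simp] theorem chop_cons (l : ℕ) (ls : List ℕ) (w : List Bool) : chop (l :: ls) w = w.take l :: chop ls (w.drop l) := rfl

/-- One block per length. [folklore] -/
@[simp] theorem length_chop : ∀ (ls : List ℕ) (w : List Bool), (chop ls w).length = ls.length
  | [], _ => rfl
  | _ :: ls, w => by simp [length_chop ls]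

/-- **The `q`-th block** sits at offset `ℓ₁ + ⋯ + ℓ_q` and has length (at most) `ℓ_{q+1}`. [folklore] -/
theorem chop_getElem : ∀ (ls : List ℕ) (w : List Bool) (q : ℕ) (hq : q < (chop ls w).length),
    (chop ls w)[q] = (w.drop (ls.take q).sum).take (ls[q]'(by simpa using hq))
  | [], _, q, hq => by simp at hq
  | l :: ls, w, 0, _ => by simp
  | l :: ls, w, q + 1, hq => by
    simp only [chop_cons, List.getElem_cons_succ, List.take_succ_cons, List.sum_cons, List.getElem_cons_succ]
    rw [chop_getElem ls (w.drop l) q (by simpa using hq), List.drop_drop]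

/-- The `q`-th block, partial version (no index proofs). [folklore] -/
theorem chop_getElem? : ∀ (ls : List ℕ) (w : List Bool) (q : ℕ),
    (chop ls w)[q]? = (ls[q]?).map fun l => (w.drop (ls.take q).sum).take l
  | [], _, q => by simp
  | l :: ls, w, 0 => by simp
  | l :: ls, w, q + 1 => by
    simp only [chop_cons, List.getElem?_cons_succ, List.take_succ_cons, List.sum_cons]
    rw [chop_getElem? ls (w.drop l) q, List.drop_drop]

/-- `chop` only reads the first `Σ ℓᵢ` symbols. [folklore] -/
theorem chop_take : ∀ (ls : List ℕ) (w : List Bool), chop ls (w.take ls.sum) = chop ls w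
  | [], _ => rfl
  | l :: ls, w => by
    simp only [chop_cons, List.sum_cons, List.take_take, min_eq_left (Nat.le_add_right l _)]
    rw [show (List.take (l + ls.sum) w).drop l = (w.drop l).take ls.sum by
      rw [List.drop_take]; congr 1; omega, chop_take ls]

/-- `chop` of a concatenation whose first part has exactly the first length. [folklore] -/
theorem chop_cons_append {l : ℕ} (ls : List ℕ) {x : List Bool} (hx : x.length = l) (w : List Bool) :
    chop (l :: ls) (x ++ w) = x :: chop ls w := by
  simp [chop_cons, List.take_left' hx, List.drop_left' hx]

/-- `chop` past a prefix made of whole blocks. [folklore] -/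
theorem chop_append_append (ls₁ ls₂ : List ℕ) {pre : List Bool} (hpre : pre.length = ls₁.sum) (w : List Bool) :
    chop (ls₁ ++ ls₂) (pre ++ w) = chop ls₁ pre ++ chop ls₂ w := by
  induction ls₁ generalizing pre with
  | nil =>
    simp at hpre
    simp [hpre]
  | cons l ls₁ ih =>
    simp only [List.sum_cons] at hpre
    have hl : l ≤ pre.length := by omega
    rw [List.cons_append, chop_cons, chop_cons, List.take_append_of_le_length hl, List.drop_append_of_le_length hl,
      ih (by simp; omega), List.cons_append]

/-- **The middle block.** With whole blocks before it, block `ls₁.length` of `pre ++ x ++ post` is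
exactly `x`, and the other blocks do not depend on `x`. [folklore] -/
theorem chop_middle (ls₁ : List ℕ) {l : ℕ} (ls₂ : List ℕ) {pre x : List Bool} (hpre : pre.length = ls₁.sum)
    (hx : x.length = l) (post : List Bool) :
    chop (ls₁ ++ l :: ls₂) (pre ++ x ++ post) = chop ls₁ pre ++ x :: chop ls₂ post := by
  rw [List.append_assoc, chop_append_append _ _ hpre, chop_cons_append _ hx]

/-! ### Parameters and the block function -/

/-- The data of the construction: the scheme and three polynomial bounds — `pG` on the
key-generation coins `coinLen_G(n)`, `pK` on the key length, `pE` on the encryption coins as a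
function of the length of `⟨k, m⟩`. [Goldreich 2004, §5.5 Exercise 2] [folklore] -/
structure Params where
  /-- the private-key scheme [folklore] -/
  S : SKEScheme
  /-- bound on the number of key-generation coins [folklore] -/
  pG : Polynomial ℕ
  /-- bound on the key length [folklore] -/
  pK : Polynomial ℕ
  /-- bound on the number of encryption coins [folklore] -/
  pE : Polynomial ℕ

namespace Params

variable (P : Params)

/-- Message length `L(n) = pG(n) + n + 2` (so that `L - 1` exceeds key-coins plus `n`). [folklore] -/
def Lpoly : Polynomial ℕ := P.pG + X + 2

/-- `L(n)`. [folklore] -/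
def L (n : ℕ) : ℕ := P.Lpoly.eval n

/-- Value of `L`. [folklore] -/
theorem L_eq (n : ℕ) : P.L n = P.pG.eval n + n + 2 := by simp [L, Lpoly]

/-- Number of components `T(n) = 2 L(n)`. [folklore] -/
def T (n : ℕ) : ℕ := 2 * P.L n

/-- Bound on the encryption coins for keys of length `≤ pK(n)` and messages of length `L(n)`. [folklore] -/
def Ppoly : Polynomial ℕ := P.pE.comp (2 * P.pK + 2 + P.Lpoly)

/-- Value of `Ppoly`. [folklore] -/
theorem Ppoly_eval (n : ℕ) : P.Ppoly.eval n = P.pE.eval (2 * P.pK.eval n + 2 + P.L n) := by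
  simp [Ppoly, L]

/-- **The base** `B(n) = n + 2 + pG(n) + pK(n) + P(n) + L(n)`: exceeds every budget digit, is `≥ 2`,
and increases by at least `1` per step. [folklore] -/
def Bpoly : Polynomial ℕ := X + 2 + P.pG + P.pK + P.Ppoly + P.Lpoly

/-- `B(n)`. [folklore] -/
def B (n : ℕ) : ℕ := P.Bpoly.eval n

/-- Value of `B`. [folklore] -/
theorem B_eq (n : ℕ) : P.B n = n + 2 + P.pG.eval n + P.pK.eval n + P.Ppoly.eval n + P.L n := by
  simp [B, Bpoly, L]

/-- `B` is monotone. [folklore] -/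
theorem B_mono {a b : ℕ} (h : a ≤ b) : P.B a ≤ P.B b := natPoly_eval_mono _ h

/-- `B` increases by at least one per step. [folklore] -/
theorem B_succ_le (n : ℕ) : P.B n + 1 ≤ P.B (n + 1) := by
  rw [B_eq, B_eq]
  have h1 : P.pG.eval n ≤ P.pG.eval (n + 1) := natPoly_eval_mono P.pG (Nat.le_succ n)
  have h2 : P.pK.eval n ≤ P.pK.eval (n + 1) := natPoly_eval_mono P.pK (Nat.le_succ n)
  have h3 : P.Ppoly.eval n ≤ P.Ppoly.eval (n + 1) := natPoly_eval_mono P.Ppoly (Nat.le_succ n)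
  have h4 : P.L n ≤ P.L (n + 1) := natPoly_eval_mono _ (Nat.le_succ n)
  omega

/-- `2 ≤ B(n)` and `n ≤ B(n)`. [folklore] -/
theorem le_B (n : ℕ) : n + 2 ≤ P.B n := by rw [B_eq]; omega

/-- The plaintext vector of world `b`: `M₀ = (m₀)^L ++ (m₀, …, m_{L-1})`,
`M₁ = (m₀, …, m_{L-1}) ++ (m₀)^L`, listed by the component index `t < 2L`. [Goldreich 2004,
§5.5 Exercise 2 (the two constructible ensembles)] [folklore] -/
def ownIdx (b : Bool) (L t : ℕ) : ℕ := if b then (if t < L then t else 0) else (if t < L then 0 else t - L)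

/-- The plaintext vector `M_b(n)`. [Goldreich 2004, §5.5 Exercise 2] [folklore] -/
def msgs (b : Bool) (n : ℕ) : List (List Bool) := (List.range (P.T n)).map fun t => msg (P.L n) (ownIdx b (P.L n) t)

/-- `M_b(n)` has `T(n)` components. [folklore] -/
@[simp] theorem length_msgs (b : Bool) (n : ℕ) : (P.msgs b n).length = P.T n := by simp [msgs]

/-- Every component of `M_b(n)` has length `L(n)`. [folklore] -/
theorem length_of_mem_msgs {b : Bool} {n : ℕ} {m : List Bool} (h : m ∈ P.msgs b n) : m.length = P.L n := by
  simp only [msgs, List.mem_map, List.mem_range] at h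
  obtain ⟨t, -, rfl⟩ := h
  exact length_msg _ _

/-- The two plaintext vectors have the same component lengths. [folklore] -/
theorem map_length_msgs (n : ℕ) : (P.msgs false n).map List.length = (P.msgs true n).map List.length := by
  simp [msgs, Function.comp_def]

/-- Block form of `M₀(n)`. [folklore] -/
theorem msgs_false_eq (n : ℕ) :
    P.msgs false n = List.replicate (P.L n) (msg (P.L n) 0) ++ (List.range (P.L n)).map (msg (P.L n)) := by
  rw [msgs, T, two_mul, List.range_add, List.map_append, List.map_map]
  congr 1
  · rw [List.eq_replicate_iff]
    refine ⟨by simp, fun m hm => ?_⟩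
    simp only [List.mem_map, List.mem_range] at hm
    obtain ⟨t, ht, rfl⟩ := hm
    simp [ownIdx, ht]
  · refine List.map_congr_left fun t ht => ?_
    simp [ownIdx]

/-- Block form of `M₁(n)`. [folklore] -/
theorem msgs_true_eq (n : ℕ) :
    P.msgs true n = (List.range (P.L n)).map (msg (P.L n)) ++ List.replicate (P.L n) (msg (P.L n) 0) := by
  rw [msgs, T, two_mul, List.range_add, List.map_append, List.map_map]
  congr 1
  · refine List.map_congr_left fun t ht => ?_
    simp [ownIdx, List.mem_range.1 ht]
  · rw [List.eq_replicate_iff]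
    refine ⟨by simp, fun m hm => ?_⟩
    simp only [List.mem_map, List.mem_range] at hm
    obtain ⟨t, ht, rfl⟩ := hm
    simp [ownIdx]

/-- The block length parameter read off an input length: the largest `n ≤ j` with `B(n)^6 ≤ j`. [folklore] -/
def nOf (j : ℕ) : ℕ := Nat.findGreatest (fun n => P.B n ^ 6 ≤ j) j

/-- **The block function `f_j`** on inputs `u` of length `j` (see the module docstring): decode the
budgets `(σ̂, λ̂, ρ̂)` from `j - B(n)^6` in base `B(n)`, read `u = b · s · r̄ · junk`, `k = G(1ⁿ; s)`;
output `⊥ = ε` unless the digits are in range and `|k| = λ̂`, in which case output the encoded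
ciphertext vector `⟨Ē_k(M_b(n); r̄)⟩` (`ρ̂` coins per component, taken consecutively), tagged with
the input length: `⟨1^j, ⟨Ē_k(M_b(n); r̄)⟩⟩` (so that real outputs of different block lengths
never coincide).
[Goldreich 2004, §5.5 Exercise 2; Goldreich 2001, §2.2.3 (all input lengths)] [folklore] -/
def blockFn (u : List Bool) : List Bool :=
  if P.B (P.nOf u.length) ^ 3 ≤ u.length - P.B (P.nOf u.length) ^ 6 then [] else
    if (P.S.keyGen.run (P.nOf u.length) ((u.drop 1).take ((u.length - P.B (P.nOf u.length) ^ 6) % P.B (P.nOf u.length)))).length =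
        (u.length - P.B (P.nOf u.length) ^ 6) / P.B (P.nOf u.length) % P.B (P.nOf u.length) then
      boolPair (ones u.length) ((encodingList Bool).listBool.encode
        (P.S.encVec (P.S.keyGen.run (P.nOf u.length) ((u.drop 1).take ((u.length - P.B (P.nOf u.length) ^ 6) % P.B (P.nOf u.length))))
          ((u.length - P.B (P.nOf u.length) ^ 6) / P.B (P.nOf u.length) ^ 2) (P.msgs (u.headD false) (P.nOf u.length))
          (u.drop (1 + (u.length - P.B (P.nOf u.length) ^ 6) % P.B (P.nOf u.length)))))
    else []

/-- A real output is the tagged pair `⟨1^{|u|}, ·⟩`. [folklore] -/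
theorem blockFn_eq_boolPair_of_ne_nil {u : List Bool} (hne : P.blockFn u ≠ []) :
    ∃ c, P.blockFn u = boolPair (ones u.length) c := by
  unfold blockFn at hne ⊢
  split_ifs at hne ⊢ with h1 h2
  · exact absurd rfl hne
  · exact ⟨_, rfl⟩
  · exact absurd rfl hne

/-- **Equal real outputs come from blocks of equal length** (the length tag). [folklore] -/
theorem length_eq_of_blockFn_eq {u u' : List Bool} (h : P.blockFn u = P.blockFn u') (hne : P.blockFn u ≠ []) :
    u.length = u'.length := by
  obtain ⟨c, hc⟩ := P.blockFn_eq_boolPair_of_ne_nil hne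
  obtain ⟨c', hc'⟩ := P.blockFn_eq_boolPair_of_ne_nil (h ▸ hne)
  rw [hc, hc'] at h
  have := boolPair_injective (a₁ := (ones u.length, c)) (a₂ := (ones u'.length, c')) h
  simp only [Prod.mk.injEq] at this
  simpa using congrArg List.length this.1

/-- **The good input length** for parameter `n` and budgets `(σ, λ, ρ)`:
`j* = B(n)^6 + σ + B(n)·λ + B(n)²·ρ`. [folklore] -/
def jStar (n σ lam ρ : ℕ) : ℕ := P.B n ^ 6 + σ + P.B n * lam + P.B n ^ 2 * ρ

section Good

variable {P} {n σ lam ρ : ℕ} (hσ : σ < P.B n) (hlam : lam < P.B n) (hρ : ρ < P.B n)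
include hσ hlam hρ

/-- The digits part of a good length is below `B^3`. [folklore] -/
theorem jStar_digits_lt : σ + P.B n * lam + P.B n ^ 2 * ρ < P.B n ^ 3 := by
  have hB : 1 ≤ P.B n := by have := P.le_B n; omega
  have h1 : P.B n * lam ≤ P.B n * (P.B n - 1) := Nat.mul_le_mul_left _ (by omega)
  have h2 : P.B n ^ 2 * ρ ≤ P.B n ^ 2 * (P.B n - 1) := Nat.mul_le_mul_left _ (by omega)
  have e : P.B n ^ 3 = P.B n ^ 2 * (P.B n - 1) + P.B n * (P.B n - 1) + (P.B n - 1) + 1 := by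
    cases h : P.B n with
    | zero => omega
    | succ b => simp [pow_succ, pow_zero]; ring
  omega

/-- **A good length decodes to its parameter**: `nOf j* = n`. [folklore] -/
theorem nOf_jStar : P.nOf (P.jStar n σ lam ρ) = n := by
  have hd := jStar_digits_lt hσ hlam hρ
  rw [nOf, Nat.findGreatest_eq_iff]
  refine ⟨?_, fun _ => ?_, fun m hnm _ hle => ?_⟩
  · have := P.le_B n
    calc n ≤ P.B n := by omega
      _ ≤ P.B n ^ 6 := Nat.le_self_pow (by norm_num) _
      _ ≤ _ := by unfold jStar; omega
  · unfold jStar; omega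
  · have hB1 : P.B n + 1 ≤ P.B m := (P.B_succ_le n).trans (P.B_mono hnm)
    have hpow : (P.B n + 1) ^ 6 ≤ P.B m ^ 6 := Nat.pow_le_pow_left hB1 6
    have hexp : P.B n ^ 6 + P.B n ^ 3 ≤ (P.B n + 1) ^ 6 := by
      have : (P.B n + 1) ^ 6 = P.B n ^ 6 + 6 * P.B n ^ 5 + 15 * P.B n ^ 4 + 20 * P.B n ^ 3 + 15 * P.B n ^ 2 + 6 * P.B n + 1 := by ring
      omega
    unfold jStar at hle
    omega

omit hσ hlam hρ in
/-- The digits of a good length. [folklore] -/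
theorem jStar_sub : P.jStar n σ lam ρ - P.B n ^ 6 = σ + P.B n * lam + P.B n ^ 2 * ρ := by
  unfold jStar; omega

omit hlam hρ in
/-- Reading `σ` off a good length. [folklore] -/
theorem jStar_digit₀ : (σ + P.B n * lam + P.B n ^ 2 * ρ) % P.B n = σ := by
  rw [show σ + P.B n * lam + P.B n ^ 2 * ρ = σ + P.B n * (lam + P.B n * ρ) by ring, Nat.add_mul_mod_self_left,
    Nat.mod_eq_of_lt hσ]

omit hρ in
/-- Reading `λ` off a good length. [folklore] -/
theorem jStar_digit₁ : (σ + P.B n * lam + P.B n ^ 2 * ρ) / P.B n % P.B n = lam := by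
  have hB : 0 < P.B n := by omega
  rw [show σ + P.B n * lam + P.B n ^ 2 * ρ = σ + P.B n * (lam + P.B n * ρ) by ring, Nat.add_mul_div_left _ _ hB,
    Nat.div_eq_of_lt hσ, zero_add, Nat.add_mul_mod_self_left, Nat.mod_eq_of_lt hlam]

omit hρ in
/-- Reading `ρ` off a good length. [folklore] -/
theorem jStar_digit₂ : (σ + P.B n * lam + P.B n ^ 2 * ρ) / P.B n ^ 2 = ρ := by
  have hB : 0 < P.B n ^ 2 := pow_pos (by have := P.le_B n; omega) 2
  rw [show σ + P.B n * lam + P.B n ^ 2 * ρ = (σ + P.B n * lam) + P.B n ^ 2 * ρ by ring, Nat.add_mul_div_left _ _ hB,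
    Nat.div_eq_of_lt, zero_add]
  calc σ + P.B n * lam < P.B n + P.B n * lam := by omega
    _ = P.B n * (lam + 1) := by ring
    _ ≤ P.B n * P.B n := Nat.mul_le_mul_left _ hlam
    _ = P.B n ^ 2 := (sq _).symm

/-- **The block function on a good length**: with `n`, the true budgets and `u = b · s · rest`
(`|s| = σ`), `f_{j*}(u) = ⟨Ē_k(M_b(n); rest)⟩` if `|k| = λ` for `k = G(1ⁿ; s)`, and `⊥` otherwise. [folklore] -/
theorem blockFn_jStar {u : List Bool} (hu : u.length = P.jStar n σ lam ρ) :
    P.blockFn u =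
      if (P.S.keyGen.run n ((u.drop 1).take σ)).length = lam then
        boolPair (ones (P.jStar n σ lam ρ)) ((encodingList Bool).listBool.encode
          (P.S.encVec (P.S.keyGen.run n ((u.drop 1).take σ)) ρ (P.msgs (u.headD false) n) (u.drop (1 + σ))))
      else [] := by
  have h0 := nOf_jStar hσ hlam hρ
  have h1 : P.jStar n σ lam ρ - P.B n ^ 6 = σ + P.B n * lam + P.B n ^ 2 * ρ := jStar_sub
  have hd := jStar_digits_lt hσ hlam hρ
  simp only [blockFn, hu, h0, h1, jStar_digit₀ hσ, jStar_digit₁ hσ hlam, jStar_digit₂ hσ hlam,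
    if_neg (not_le.2 hd)]

end Good

end Params

/-! ### The direct product over all block lengths -/

/-- Number of block lengths (and of copies per length) on inputs of length `N`: the largest `M ≤ N`
with `M³ ≤ N`. [Goldreich 2001, §2.3.1] [folklore] -/
def Mof (N : ℕ) : ℕ := Nat.findGreatest (fun m => m ^ 3 ≤ N) N

/-- `Mof N ^ 3 ≤ N`. [folklore] -/
theorem Mof_pow_le (N : ℕ) : Mof N ^ 3 ≤ N := by
  by_cases h : Mof N = 0
  · rw [h]; simp
  · exact Nat.findGreatest_of_ne_zero (P := fun m => m ^ 3 ≤ N) (n := N) rfl h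

/-- Anything whose cube fits is below `Mof`. [folklore] -/
theorem le_Mof {N m : ℕ} (h : m ^ 3 ≤ N) : m ≤ Mof N :=
  Nat.le_findGreatest (le_trans (Nat.le_self_pow (by norm_num) m) h) h

/-- `Mof` is monotone. [folklore] -/
theorem Mof_mono {N N' : ℕ} (h : N ≤ N') : Mof N ≤ Mof N' := le_Mof ((Mof_pow_le N).trans h)

/-- The list of block lengths: `M` copies of each length `1, …, M`, in this order
(flat index `q ↦ q / M + 1`). [Goldreich 2001, §2.3.1] [folklore] -/
def lens (M : ℕ) : List ℕ := (List.range (M * M)).map fun q => q / M + 1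

/-- There are `M²` blocks. [folklore] -/
@[simp] theorem length_lens (M : ℕ) : (lens M).length = M * M := by simp [lens]

/-- The block length at flat index `q`. [folklore] -/
@[simp] theorem lens_getElem {M q : ℕ} (hq : q < (lens M).length) : (lens M)[q] = q / M + 1 := by
  simp [lens]

/-- Every block length is between `1` and `M`. [folklore] -/
theorem mem_lens_iff {M l : ℕ} : l ∈ lens M ↔ 1 ≤ l ∧ l ≤ M := by
  simp only [lens, List.mem_map, List.mem_range]
  constructor
  · rintro ⟨q, hq, rfl⟩
    have hM : 0 < M := Nat.pos_of_ne_zero fun h => by simp [h] at hq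
    have : q / M < M := Nat.div_lt_of_lt_mul hq
    exact ⟨Nat.succ_le_succ (Nat.zero_le _), Nat.succ_le_of_lt this⟩
  · rintro ⟨h1, h2⟩
    refine ⟨(l - 1) * M, ?_, ?_⟩
    · calc (l - 1) * M < l * M := Nat.mul_lt_mul_of_pos_right (by omega) (by omega)
        _ ≤ M * M := Nat.mul_le_mul_right _ h2
    · rw [Nat.mul_div_cancel _ (by omega)]; omega

/-- The blocks fit into the input: `Σ lens M ≤ M³`. [folklore] -/
theorem sum_lens_le (M : ℕ) : (lens M).sum ≤ M ^ 3 := by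
  have h : ∀ l ∈ lens M, l ≤ M := fun l hl => (mem_lens_iff.1 hl).2
  calc (lens M).sum ≤ (lens M).length * M := List.sum_le_card_nsmul _ _ h
    _ = M ^ 3 := by rw [length_lens]; ring

/-- The blocks of an input `w`: `M = Mof |w|` copies of each length `1, …, M`, cut consecutively
from the front of `w`. [Goldreich 2001, §2.3.1] [folklore] -/
def blocks (w : List Bool) : List (List Bool) := chop (lens (Mof w.length)) w

/-- Number of blocks. [folklore] -/
@[simp] theorem length_blocks (w : List Bool) : (blocks w).length = Mof w.length * Mof w.length := by
  simp [blocks]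

/-- A block is at most as long as the input. [folklore] -/
theorem length_of_mem_blocks {w x : List Bool} (hx : x ∈ blocks w) : x.length ≤ w.length := by
  unfold blocks at hx
  have key : ∀ (ls : List ℕ) (w : List Bool) (x : List Bool), x ∈ chop ls w → x.length ≤ w.length := by
    intro ls
    induction ls with
    | nil => intro w x h; simp at h
    | cons l ls ih =>
      intro w x h
      simp only [chop_cons, List.mem_cons] at h
      rcases h with rfl | h
      · simp
      · exact (ih _ _ h).trans (by simp)
  exact key _ _ _ hx

/-- The common output length before padding: `Λ(N) = 2N + 2 + N·(2 sf(N) + 2)` bounds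
`|⟨1^M, frames outputs⟩|` when `|f_j(u)| ≤ sf(|u|)`. [folklore] -/
def Λof (sf : Polynomial ℕ) (N : ℕ) : ℕ := 2 * N + 2 + N * (2 * sf.eval N + 2)

/-- Assembling the output from the block outputs: `pad_{Λ(N)}(⟨1^{Mof N}, frames outputs⟩)`. [folklore] -/
def assemble (sf : Polynomial ℕ) (N : ℕ) (os : List (List Bool)) : List Bool :=
  padTo (Λof sf N) (boolPair (ones (Mof N)) (frames os))

/-- **`assemble` is injective** in the block outputs and remembers the number of blocks. [folklore] -/
theorem assemble_inj {sf : Polynomial ℕ} {N N' : ℕ} {os os' : List (List Bool)}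
    (h : assemble sf N os = assemble sf N' os') : Mof N = Mof N' ∧ os = os' := by
  have h1 := padTo_inj h
  have h2 := boolPair_injective (a₁ := (ones (Mof N), frames os)) (a₂ := (ones (Mof N'), frames os')) h1
  simp only [Prod.mk.injEq, frames_eq_iff] at h2
  exact ⟨by simpa using congrArg List.length h2.1, h2.2⟩

/-- The block of `z` at flat index `q`, partial version. [folklore] -/
theorem blocks_getElem? (z : List Bool) (q : ℕ) :
    (blocks z)[q]? = ((lens (Mof z.length))[q]?).map fun l => (z.drop ((lens (Mof z.length)).take q).sum).take l :=
  chop_getElem? _ _ _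

/-- The block of `z` at flat index `q`, as an explicit window of `z`. [folklore] -/
theorem blocks_getElem {z : List Bool} {q : ℕ} (hq : q < (blocks z).length) :
    (blocks z)[q] = (z.drop ((lens (Mof z.length)).take q).sum).take ((lens (Mof z.length))[q]'(by simpa using hq)) := by
  unfold blocks
  exact chop_getElem _ _ _ _

/-- The blocks in the splice situation. [folklore] -/
theorem blocks_middle {M : ℕ} {ls₁ ls₂ : List ℕ} {l : ℕ} (hls : lens M = ls₁ ++ l :: ls₂)
    {pre x post : List Bool} (hN : Mof (pre ++ x ++ post).length = M) (hpre : pre.length = ls₁.sum)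
    (hx : x.length = l) : blocks (pre ++ x ++ post) = chop ls₁ pre ++ x :: chop ls₂ post := by
  unfold blocks
  rw [hN, hls, chop_middle ls₁ ls₂ hpre hx post]

/-- **Length of an assembled value**: exactly `Λ(N) + 1`, provided `sf` bounds the block outputs. [folklore] -/
theorem length_assemble {sf : Polynomial ℕ} {N : ℕ} {os : List (List Bool)} (hlen : os.length = Mof N * Mof N)
    (hos : ∀ o ∈ os, o.length ≤ sf.eval N) : (assemble sf N os).length = Λof sf N + 1 := by
  unfold assemble
  apply length_padTo
  rw [length_boolPair, List.length_replicate, Yao.length_frames, Λof]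
  have hM3 := Mof_pow_le N
  have hM1 : Mof N ≤ N := le_trans (Nat.le_self_pow (by norm_num) _) hM3
  have hM2 : Mof N * Mof N ≤ N := by
    rcases Nat.eq_zero_or_pos (Mof N) with h | h
    · rw [h]; simp
    · calc Mof N * Mof N ≤ Mof N * Mof N * Mof N := Nat.le_mul_of_pos_right _ h
        _ = Mof N ^ 3 := by ring
        _ ≤ N := hM3
  have hsum : (os.map fun a => 2 * a.length + 2).sum ≤ (os.map fun a => 2 * a.length + 2).length • (2 * sf.eval N + 2) :=
    List.sum_le_card_nsmul _ _ (by
      intro v hv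
      obtain ⟨o, ho, rfl⟩ := List.mem_map.1 hv
      have := hos o ho
      omega)
  rw [List.length_map, smul_eq_mul, hlen] at hsum
  have : Mof N * Mof N * (2 * sf.eval N + 2) ≤ N * (2 * sf.eval N + 2) := Nat.mul_le_mul_right _ hM2
  omega

namespace Params

variable (P : Params)

/-- **The candidate one-way function** `F`: apply the block function to every block and assemble.
[Impagliazzo–Luby 1989, Thm. 1; Goldreich 2004, §5.5 Exercise 2; Goldreich 2001, §2.3.1] [folklore] -/
def F (sf : Polynomial ℕ) (w : List Bool) : List Bool := assemble sf w.length ((blocks w).map P.blockFn)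

/-- `F` with the output of block `q` replaced by `o` (the distinguisher's splice). [folklore] -/
def Fsplice (sf : Polynomial ℕ) (q : ℕ) (o : List Bool) (w : List Bool) : List Bool :=
  assemble sf w.length (((blocks w).map P.blockFn).set q o)

/-- `F` is its own splice with the true block output. [folklore] -/
theorem F_eq_Fsplice (sf : Polynomial ℕ) {q : ℕ} {w : List Bool} (hq : q < (blocks w).length) :
    P.F sf w = P.Fsplice sf q (P.blockFn ((blocks w)[q])) w := by
  unfold F Fsplice
  congr 1
  rw [← List.getElem_map P.blockFn (h := by simpa using hq), List.set_getElem_self]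

/-- **Equal `F`-values have equal block outputs** (and equally many blocks). [folklore] -/
theorem map_blockFn_eq_of_F_eq {sf : Polynomial ℕ} {w w' : List Bool} (h : P.F sf w' = P.F sf w) :
    Mof w'.length = Mof w.length ∧ (blocks w').map P.blockFn = (blocks w).map P.blockFn :=
  assemble_inj h

/-- A successful inversion of a spliced value reproduces the spliced block output: if
`F z = Fsplice q o w` then `f((blocks z)[q]) = o`. [folklore] -/
theorem blockFn_blocks_eq_of_F_eq_Fsplice {sf : Polynomial ℕ} {q : ℕ} {o : List Bool} {w z : List Bool}
    (hq : q < (blocks w).length) (h : P.F sf z = P.Fsplice sf q o w) :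
    ∃ hz : q < (blocks z).length, P.blockFn ((blocks z)[q]) = o := by
  obtain ⟨hM, hos⟩ := assemble_inj h
  have hz : q < (blocks z).length := by rw [length_blocks, hM, ← length_blocks]; exact hq
  refine ⟨hz, ?_⟩
  have := congrArg (fun l => l[q]?) hos
  simp only [List.getElem?_map, List.getElem?_set_self (by simpa using hq : q < ((blocks w).map P.blockFn).length),
    List.getElem?_eq_getElem hz, Option.map_some] at this
  exact Option.some_injective _ this

/-- **Splice formula.** Write the block lengths as `ls₁ ++ l :: ls₂` (`q = |ls₁|`) and the input as
`pre ++ x ++ post` with `|pre| = Σ ls₁`, `|x| = l`; then the spliced value does not depend on `x`.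
[folklore] -/
theorem Fsplice_middle (sf : Polynomial ℕ) {M : ℕ} {ls₁ ls₂ : List ℕ} {l : ℕ} (hls : lens M = ls₁ ++ l :: ls₂)
    {pre x post : List Bool} (hN : Mof (pre ++ x ++ post).length = M) (hpre : pre.length = ls₁.sum)
    (hx : x.length = l) (o : List Bool) :
    P.Fsplice sf ls₁.length o (pre ++ x ++ post) =
      assemble sf (pre ++ x ++ post).length ((chop ls₁ pre).map P.blockFn ++ o :: (chop ls₂ post).map P.blockFn) := by
  unfold Fsplice blocks
  rw [hN, hls, chop_middle ls₁ ls₂ hpre hx post, List.map_append, List.map_cons, List.set_append]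
  simp

/-- **Length of `F w`**: exactly `Λ(|w|) + 1` under the output bound `sf` for the block function. [folklore] -/
theorem length_F {sf : Polynomial ℕ} (hsf : ∀ u, (P.blockFn u).length ≤ sf.eval u.length) (w : List Bool) :
    (P.F sf w).length = Λof sf w.length + 1 := by
  refine length_assemble (by simp) fun o ho => ?_
  obtain ⟨x, hx, rfl⟩ := List.mem_map.1 ho
  exact (hsf x).trans (natPoly_eval_mono _ (length_of_mem_blocks hx))

/-- Length of a spliced value whose new entry obeys the same bound. [folklore] -/
theorem length_Fsplice {sf : Polynomial ℕ} (hsf : ∀ u, (P.blockFn u).length ≤ sf.eval u.length) {q : ℕ}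
    {o : List Bool} (w : List Bool) (ho : o.length ≤ sf.eval w.length) :
    (P.Fsplice sf q o w).length = Λof sf w.length + 1 := by
  refine length_assemble (by simp) fun o' ho' => ?_
  rcases List.mem_or_eq_of_mem_set ho' with h | rfl
  · obtain ⟨x, hx, rfl⟩ := List.mem_map.1 h
    exact (hsf x).trans (natPoly_eval_mono _ (length_of_mem_blocks hx))
  · exact ho

end Params

end

end SKEOWF

end Literature.Computability.Cryptography


/-!
# Private-key encryption ⇒ one-way functions, III: the distinguisher at one security parameter

Third file of the discharge of `OWFExist_of_secureSKEExist` (Impagliazzo–Luby 1989, Thm. 1); see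
`SchemesOWF.lean`, Part I (architecture) and `SchemesOWF.lean`, Part II (the candidate `F`).

Fix an inverter `A` for `F` and one security parameter `n` together with the numbers the
distinguisher is advised of (`Setup`: the attacked input length `N` of `F`, the true budgets
`σ, λ, ρ`, hence the good block length `j* = jStar n σ λ ρ`, the copy `i₀` of that block length
into which the challenge is spliced, and `A`'s coin count `κ`). The distinguisher's work on a
challenge `v = ⟨c̄⟩` with coins `r = w · r_A · e ⋯` is `Setup.Dcore`:
`y = Fsplice_q(⟨1^{j*}, v⟩, w)`, `z = A(1^N, y; r_A)`, `blk = z[off, off + j*)`, answer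
`head blk` if `f_{j*}(blk) = ⟨1^{j*}, v⟩` ("`A` explained the challenge") and the fresh coin `e`
otherwise (Goldreich's inverter-to-distinguisher step, FoC I §3.8 Exercise 11, "disjoint case").
This file proves, by counting coin strings:

* `Setup.blockFn_parse_symm` — on a block of the good length the block function is the tagged, encoded
  honest ciphertext vector of `M_b(n)` under `k = G(1ⁿ; s)` (or `⊥` if `|k| ≠ λ`);
* `Setup.card_Dcore` — `Pr_r[Dcore = 1] = ½ + (#{V ∧ head = 1} - ½ #{V}) / 2^{N+κ}` (`V` = "explained");
* `Setup.exists_dec_of_DV` — an explanation with the wrong world bit exhibits a key of `keyFinset n`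
  decrypting every challenge component to the other world's plaintext (perfect correctness), the
  event bounded in `SchemesOWF.lean`, Part I;
* `Setup.Dacc_true_ge`, `Setup.Dacc_false_le` — hence, per challenge, the acceptance probability is
  `≥ ½ + ½·V/2^{N+κ} - 1_{Bad}` in world `1` and `≤ ½ - ½·V/2^{N+κ} + 1_{Bad}` in world `0`.

The comparison of `#{V}` with the inversion probability of `A` (the simulation identity) and the
asymptotics are in `SchemesOWF.lean`, Part IV.

## References

* R. Impagliazzo, M. Luby, *One-way functions are essential for complexity based cryptography*,
  FOCS 1989, Thm. 1.
* O. Goldreich, *Foundations of Cryptography I*, CUP 2001, §3.8 Exercise 11 (guideline), proof of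
  Prop. 3.3.8; *Foundations of Cryptography II*, CUP 2004, §5.5 Exercise 2.
-/

namespace Literature.Computability.Cryptography

open _root_.Computability Complexity Polynomial Finset
open scoped ENNReal Classical

namespace SKEOWF

noncomputable section

/-- `1`-bit vectors are bits. [folklore] -/
def vec1Equiv : List.Vector Bool 1 ≃ Bool where
  toFun v := v.head
  invFun b := ⟨[b], rfl⟩
  left_inv v := by
    obtain ⟨l, hl⟩ := v
    match l, hl with
    | [b], _ => rfl
  right_inv b := rfl

/-- **The advice at one security parameter** (see the module docstring). [folklore] -/
structure Setup (P : Params) (sf : Polynomial ℕ) (A : RandAlg (List Bool) (List Bool)) where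
  /-- security parameter [folklore] -/
  n : ℕ
  /-- attacked input length of `F` [folklore] -/
  N : ℕ
  /-- key-generation coins `coinLen_G(n)` [folklore] -/
  σ : ℕ
  /-- the designated (most likely) key length [folklore] -/
  lam : ℕ
  /-- encryption coins for keys of length `λ` and messages of length `L(n)` [folklore] -/
  ρ : ℕ
  /-- the copy of block length `j*` receiving the challenge [folklore] -/
  i₀ : ℕ
  /-- `A`'s coin count on `(1^N, y)`, `|y| = Λ(N) + 1` [folklore] -/
  κ : ℕ
  /-- `σ` is the key-generation budget [folklore] -/
  hσ : P.S.keyGen.coinLen (unaryEncodeNat n).length = σ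
  /-- … and obeys its bound [folklore] -/
  hσG : σ ≤ P.pG.eval n
  /-- `ρ` is the encryption budget at key length `λ`, message length `L(n)` [folklore] -/
  hρ : P.S.enc.coinLen (2 * lam + 2 + P.L n) = ρ
  /-- digit bounds [folklore] -/
  hσB : σ < P.B n
  /-- digit bounds [folklore] -/
  hlamB : lam < P.B n
  /-- digit bounds [folklore] -/
  hρB : ρ < P.B n
  /-- the good block length is present among the block lengths `1, …, Mof N` [folklore] -/
  hjM : P.jStar n σ lam ρ ≤ Mof N
  /-- the copy index is in range [folklore] -/
  hi₀ : i₀ < Mof N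
  /-- `κ` is `A`'s coin count [folklore] -/
  hκ : A.coinLen (2 * N + 2 + (Λof sf N + 1)) = κ

namespace Setup

variable {P : Params} {sf : Polynomial ℕ} {A : RandAlg (List Bool) (List Bool)} (E : Setup P sf A)

/-- The good block length `j*`. [folklore] -/
def jj : ℕ := P.jStar E.n E.σ E.lam E.ρ

/-- Number of block lengths / copies. [folklore] -/
def M : ℕ := Mof E.N

/-- Flat index of the challenge block (copy `i₀` of length `j*`). [folklore] -/
def q : ℕ := (E.jj - 1) * E.M + E.i₀

/-- Block lengths before the challenge block. [folklore] -/
def ls₁ : List ℕ := (lens E.M).take E.q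

/-- Block lengths after the challenge block. [folklore] -/
def ls₂ : List ℕ := (lens E.M).drop (E.q + 1)

/-- Offset of the challenge block. [folklore] -/
def off : ℕ := E.ls₁.sum

/-- Encryption coins of one plaintext vector: `T(n)·ρ`. [folklore] -/
def Tρ : ℕ := P.T E.n * E.ρ

/-- Unused bits of a block of the good length. [folklore] -/
def pad : ℕ := E.jj - (1 + E.σ + E.Tρ)

/-- Input bits after the challenge block. [folklore] -/
def post : ℕ := E.N - (E.off + E.jj)

/-- `1 ≤ B(n)` bookkeeping: `2 ≤ B`. [folklore] -/
theorem two_le_B : 2 ≤ P.B E.n := by have := P.le_B E.n; omega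

/-- The good length affords its data: `1 + σ + Tρ ≤ j*`. [folklore] -/
theorem data_le_jj : 1 + E.σ + E.Tρ ≤ E.jj := by
  have hB := E.two_le_B
  have hL : P.L E.n ≤ P.B E.n := by rw [P.B_eq]; omega
  have hT : E.Tρ ≤ 2 * P.B E.n * P.B E.n := by
    unfold Tρ Params.T
    exact Nat.mul_le_mul (Nat.mul_le_mul_left 2 hL) E.hρB.le
  have h6 : 2 * P.B E.n * P.B E.n + P.B E.n + 1 ≤ P.B E.n ^ 6 := by
    have : P.B E.n ^ 6 = P.B E.n * P.B E.n * P.B E.n ^ 4 := by ring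
    have h4 : 16 ≤ P.B E.n ^ 4 := by
      calc (16 : ℕ) = 2 ^ 4 := by norm_num
        _ ≤ P.B E.n ^ 4 := Nat.pow_le_pow_left hB 4
    nlinarith
  have hσ := E.hσB
  unfold jj Params.jStar
  omega

/-- Decomposition of the good length. [folklore] -/
theorem jj_eq : E.jj = 1 + E.σ + E.Tρ + E.pad := by
  have := E.data_le_jj; unfold pad; omega

/-- The same, rearranged for vector splitting. [folklore] -/
theorem jj_eq' : E.jj = 1 + (E.σ + (E.Tρ + E.pad)) := by rw [E.jj_eq]; ring

/-- `1 ≤ j*`. [folklore] -/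
theorem one_le_jj : 1 ≤ E.jj := by have := E.data_le_jj; omega

/-- The flat index is in range. [folklore] -/
theorem q_lt : E.q < E.M * E.M := by
  have h1 : E.jj ≤ E.M := E.hjM
  have h2 : E.i₀ < E.M := E.hi₀
  have h3 := E.one_le_jj
  unfold q
  calc (E.jj - 1) * E.M + E.i₀ < (E.jj - 1) * E.M + E.M := by omega
    _ = E.jj * E.M := by
      conv_rhs => rw [show E.jj = (E.jj - 1) + 1 by omega]
      ring
    _ ≤ E.M * E.M := Nat.mul_le_mul_right _ h1

/-- The flat index is in range of `lens`. [folklore] -/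
theorem q_lt_length : E.q < (lens E.M).length := by simpa using E.q_lt

/-- The challenge block has length `j*`. [folklore] -/
theorem lens_q : (lens E.M)[E.q]'E.q_lt_length = E.jj := by
  rw [lens_getElem]
  have hM : 0 < E.M := by have := E.hi₀; unfold M at this ⊢; omega
  have h3 := E.one_le_jj
  unfold q
  have hi : E.i₀ < E.M := E.hi₀
  rw [Nat.add_comm ((E.jj - 1) * E.M), Nat.add_mul_div_right _ _ hM, Nat.div_eq_of_lt hi]
  omega

/-- **The block lengths around the challenge block.** [folklore] -/
theorem lens_eq : lens E.M = E.ls₁ ++ E.jj :: E.ls₂ := by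
  rw [← E.lens_q]
  unfold ls₁ ls₂
  rw [List.cons_getElem_drop_succ, List.take_append_drop]

/-- `|ls₁| = q`. [folklore] -/
@[simp] theorem length_ls₁ : E.ls₁.length = E.q := by
  unfold ls₁; simp [E.q_lt.le]

/-- The challenge block fits into the input. [folklore] -/
theorem off_add_jj_le : E.off + E.jj ≤ E.N := by
  have h1 : (lens E.M).sum = E.ls₁.sum + (E.jj + E.ls₂.sum) := by
    rw [E.lens_eq, List.sum_append, List.sum_cons]
  have h2 := sum_lens_le E.M
  have h3 := Mof_pow_le E.N
  unfold off M at *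
  omega

/-- Decomposition of the input length. [folklore] -/
theorem N_eq : E.N = E.off + (E.jj + E.post) := by
  have := E.off_add_jj_le; unfold post; omega

/-! ### Reading a block of the good length -/

/-- The first bit of a string assembled from a `1`-bit vector. [folklore] -/
theorem headD_vec1_append (v : List.Vector Bool 1) (l : List Bool) : (v.toList ++ l).headD false = vec1Equiv v := by
  obtain ⟨l', hl⟩ := v
  match l', hl with
  | [b], _ => rfl

/-- Splitting a block of the good length into bit, seed, encryption coins and junk. [folklore] -/
def parse : List.Vector Bool E.jj ≃ List.Vector Bool 1 × (List.Vector Bool E.σ × (List.Vector Bool E.Tρ × List.Vector Bool E.pad)) :=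
  (vecCut 1 _ _ E.jj_eq').trans ((Equiv.refl _).prodCongr ((vecCut _ _ _ rfl).trans
    ((Equiv.refl _).prodCongr (vecCut _ _ _ rfl))))

/-- The parsed block, reassembled. [folklore] -/
theorem parse_symm_toList (bv : List.Vector Bool 1) (s : List.Vector Bool E.σ) (r : List.Vector Bool E.Tρ) (u : List.Vector Bool E.pad) :
    (E.parse.symm (bv, (s, (r, u)))).toList = bv.toList ++ (s.toList ++ (r.toList ++ u.toList)) := rfl

/-- Reading the bit. [folklore] -/
theorem headD_parse_symm (bv : List.Vector Bool 1) (s : List.Vector Bool E.σ) (r : List.Vector Bool E.Tρ) (u : List.Vector Bool E.pad) :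
    (E.parse.symm (bv, (s, (r, u)))).toList.headD false = vec1Equiv bv := by
  rw [parse_symm_toList]; exact headD_vec1_append _ _

/-- Reading the seed. [folklore] -/
theorem seed_parse_symm (bv : List.Vector Bool 1) (s : List.Vector Bool E.σ) (r : List.Vector Bool E.Tρ) (u : List.Vector Bool E.pad) :
    ((E.parse.symm (bv, (s, (r, u)))).toList.drop 1).take E.σ = s.toList := by
  rw [parse_symm_toList, List.drop_left' (by simp), List.take_left' (by simp)]

/-- Reading the encryption coins (with the junk behind them). [folklore] -/
theorem coins_parse_symm (bv : List.Vector Bool 1) (s : List.Vector Bool E.σ) (r : List.Vector Bool E.Tρ) (u : List.Vector Bool E.pad) :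
    (E.parse.symm (bv, (s, (r, u)))).toList.drop (1 + E.σ) = r.toList ++ u.toList := by
  rw [parse_symm_toList, ← List.drop_drop, List.drop_left' (by simp), List.drop_left' (by simp)]

/-- The key grown from a seed. [folklore] -/
def key (s : List.Vector Bool E.σ) : List Bool := P.S.keyGen.run E.n s.toList

/-- The tagged encoded ciphertext vector of world `b` under the key of seed `s` with coins `r`:
`⟨1^{j*}, ⟨Ē_{G(1ⁿ;s)}(M_b(n); r)⟩⟩`. [folklore] -/
def realOut (b : Bool) (s : List.Vector Bool E.σ) (r : List.Vector Bool E.Tρ) : List Bool :=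
  boolPair (ones E.jj) ((encodingList Bool).listBool.encode (P.S.encVec (E.key s) E.ρ (P.msgs b E.n) r.toList))

/-- **The block function on a parsed block of the good length**: `⊥` if the key has the wrong
length, and the tagged encoded honest ciphertext vector otherwise (the junk is not read).
[Goldreich 2004, §5.5 Exercise 2] [folklore] -/
theorem blockFn_parse_symm (bv : List.Vector Bool 1) (s : List.Vector Bool E.σ) (r : List.Vector Bool E.Tρ) (u : List.Vector Bool E.pad) :
    P.blockFn (E.parse.symm (bv, (s, (r, u)))).toList =
      if (E.key s).length = E.lam then E.realOut (vec1Equiv bv) s r else [] := by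
  rw [P.blockFn_jStar E.hσB E.hlamB E.hρB (by simp [jj]), seed_parse_symm, headD_parse_symm, coins_parse_symm]
  unfold realOut key jj
  rw [← P.S.encVec_take _ _ _ (r.toList ++ u.toList), P.length_msgs, show P.T E.n * E.ρ = r.toList.length by simp [Tρ],
    List.take_left]

/-- A real output is not `⊥`. [folklore] -/
theorem realOut_ne_nil (b : Bool) (s : List.Vector Bool E.σ) (r : List.Vector Bool E.Tρ) : E.realOut b s r ≠ [] :=
  boolPair_ne_nil _ _


/-! ### The distinguisher's core and its acceptance count -/

/-- The spliced challenge `⟨1^{j*}, v⟩` (the shape of a real block output). [folklore] -/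
def tagv (v : List Bool) : List Bool := boolPair (ones E.jj) v

/-- The simulated `F`-value handed to `A`: the outputs of the blocks of `w`, with block `q`
replaced by the tagged challenge. [Goldreich 2001, §3.8 Exercise 11 (guideline)] [folklore] -/
def Dy (v w : List Bool) : List Bool := P.Fsplice sf E.q (E.tagv v) w

/-- `A`'s answer `z = A(1^N, y; r_A)`. [folklore] -/
def Dz (v w rA : List Bool) : List Bool := A.run (boolPair (unaryEncodeNat E.N) (E.Dy v w)) rA

/-- The window of `A`'s answer where block `q` lives. [folklore] -/
def Dblk (v w rA : List Bool) : List Bool := ((E.Dz v w rA).drop E.off).take E.jj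

/-- `V`: "`A` explained the challenge" — the block function maps the window to the tagged
challenge (an `abbrev`, so that it is decided by list equality). [folklore] -/
abbrev DV (v w rA : List Bool) : Prop := P.blockFn (E.Dblk v w rA) = E.tagv v

/-- The world bit read off the explanation. [folklore] -/
def Dhb (v w rA : List Bool) : Bool := (E.Dblk v w rA).headD false

/-- **The distinguisher's core** on challenge `v` and coins `r = w · r_A · e ⋯`: the explained
world bit if `A` explained the challenge, the fresh coin `e` otherwise (`Setup.Dcore` is
`DcoreRaw` at the advised numbers; the raw form is what the program computes).
[Goldreich 2001, §3.8 Exercise 11, proof of Prop. 3.3.8 (the distinguisher built from an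
inverter)] [folklore] -/
def _root_.Literature.Computability.Cryptography.SKEOWF.DcoreRaw (P : Params) (sf : Polynomial ℕ)
    (A : RandAlg (List Bool) (List Bool)) (N q off jj κ : ℕ) (v r : List Bool) : Bool :=
  if P.blockFn (((A.run (boolPair (unaryEncodeNat N) (P.Fsplice sf q (boolPair (ones jj) v) (r.take N))) ((r.drop N).take κ)).drop off).take jj) =
      boolPair (ones jj) v then
    ((((A.run (boolPair (unaryEncodeNat N) (P.Fsplice sf q (boolPair (ones jj) v) (r.take N))) ((r.drop N).take κ)).drop off).take jj)).headD false
  else (r.drop (N + κ)).headD false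

/-- The core at the advised numbers. [folklore] -/
def Dcore (v r : List Bool) : Bool := DcoreRaw P sf A E.N E.q E.off E.jj E.κ v r

/-- The core, structured. [folklore] -/
theorem Dcore_eq (v r : List Bool) : E.Dcore v r =
    if E.DV v (r.take E.N) ((r.drop E.N).take E.κ) then E.Dhb v (r.take E.N) ((r.drop E.N).take E.κ)
    else (r.drop (E.N + E.κ)).headD false := rfl

/-- Number of coin pairs `(w, r_A)` on which `A` explains the challenge. [folklore] -/
def cntV (v : List Bool) : ℕ :=
  (univ.filter fun p : List.Vector Bool E.N × List.Vector Bool E.κ => E.DV v p.1.toList p.2.toList).card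

/-- … with explained world bit `b`. [folklore] -/
def cntVb (v : List Bool) (b : Bool) : ℕ :=
  (univ.filter fun p : List.Vector Bool E.N × List.Vector Bool E.κ =>
    E.DV v p.1.toList p.2.toList ∧ E.Dhb v p.1.toList p.2.toList = b).card

/-- `cntVb ≤ cntV`. [folklore] -/
theorem cntVb_le (v : List Bool) (b : Bool) : E.cntVb v b ≤ E.cntV v :=
  card_le_card (fun p => by simp only [mem_filter, mem_univ, true_and]; exact And.left)

/-- `cntV ≤ 2^{N+κ}`. [folklore] -/
theorem cntV_le (v : List Bool) : E.cntV v ≤ 2 ^ (E.N + E.κ) := by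
  refine (card_filter_le _ _).trans ?_
  simp [card_univ, Fintype.card_prod, card_vector, pow_add]

/-- The two explained bits partition the explanations. [folklore] -/
theorem cntVb_add (v : List Bool) : E.cntVb v true + E.cntVb v false = E.cntV v := by
  unfold cntVb cntV
  rw [← card_union_of_disjoint]
  · congr 1; ext p; simp only [mem_union, mem_filter, mem_univ, true_and]
    constructor
    · rintro (⟨h, -⟩ | ⟨h, -⟩) <;> exact h
    · intro h
      cases hb : E.Dhb v p.1.toList p.2.toList
      · exact Or.inr ⟨h, rfl⟩
      · exact Or.inl ⟨h, rfl⟩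
  · exact disjoint_filter.2 fun p _ h1 h2 => by rw [h1.2] at h2; exact Bool.noConfusion h2.2

/-- The first bit of a `(1 + rest)`-bit vector, through the splitting. [folklore] -/
theorem headD_eq_vec1 {rest : ℕ} (t : List.Vector Bool (1 + rest)) :
    t.toList.headD false = vec1Equiv ((vecCut 1 rest _ rfl) t).1 := by
  obtain ⟨l, hl⟩ := t
  match l, hl with
  | [], h => exact absurd h (by simp; omega)
  | b :: l', _ => rfl

/-- Number of `(1 + rest)`-bit strings starting with `1`. [folklore] -/
theorem sum_head_true (rest : ℕ) :
    ∑ t : List.Vector Bool (1 + rest), (if t.toList.headD false = true then 1 else 0) = 2 ^ rest := by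
  rw [Fintype.sum_equiv (vecCut 1 rest _ rfl) _ (fun p => if vec1Equiv p.1 = true then 1 else 0)
    (fun t => by rw [headD_eq_vec1]), Fintype.sum_prod_type,
    Fintype.sum_equiv vec1Equiv _ (fun b => ∑ _u : List.Vector Bool rest, if b = true then 1 else 0) (fun _ => rfl),
    Fintype.sum_bool]
  simp [card_univ, card_vector]

/-- Unfolding the core on coins `w · r_A · t`. [folklore] -/
theorem Dcore_append (v : List Bool) (w : List.Vector Bool E.N) (rA : List.Vector Bool E.κ) (t : List Bool) :
    E.Dcore v (w.toList ++ rA.toList ++ t) =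
      if E.DV v w.toList rA.toList then E.Dhb v w.toList rA.toList else t.headD false := by
  have hw : w.toList.length = E.N := by simp
  have hrA : rA.toList.length = E.κ := by simp
  rw [Dcore_eq, List.append_assoc, List.take_left' hw, List.drop_left' hw, List.take_left' hrA,
    show E.N + E.κ = (w.toList ++ rA.toList).length by simp, ← List.append_assoc, List.drop_left]

/-- Number of coin strings of length `N + κ + (1 + rest)` on which the core accepts. [folklore] -/
def Dnum (rest : ℕ) (v : List Bool) : ℕ :=
  (univ.filter fun r : List.Vector Bool (E.N + E.κ + (1 + rest)) => E.Dcore v r.toList = true).card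

/-- **The acceptance count of the core**:
`#{r : Dcore = 1} + 2^{rest}·#{V} = 2^{rest}·(2·#{V ∧ bit = 1} + 2^{N+κ})`, i.e.
`Pr_r[Dcore = 1] = ½ + (#{V ∧ bit = 1} - ½·#{V}) / 2^{N+κ}` (the fresh coin decides when `A`
does not explain). [Goldreich 2001, proof of Prop. 3.3.8 (analysis of the distinguisher)] [folklore] -/
theorem card_Dcore (v : List Bool) (rest : ℕ) :
    E.Dnum rest v + 2 ^ rest * E.cntV v = 2 ^ rest * (2 * E.cntVb v true + 2 ^ (E.N + E.κ)) := by
  -- the count as an iterated sum over `(w, r_A)` and `t`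
  set e := (vecCut (E.N + E.κ) (1 + rest) _ rfl).trans ((vecCut E.N E.κ _ rfl).prodCongr (Equiv.refl (List.Vector Bool (1 + rest))))
  set X : List.Vector Bool E.N × List.Vector Bool E.κ → ℕ := fun p =>
    if E.DV v p.1.toList p.2.toList then (if E.Dhb v p.1.toList p.2.toList = true then 2 ^ (1 + rest) else 0) else 2 ^ rest with hX
  have hcount : E.Dnum rest v = ∑ p : List.Vector Bool E.N × List.Vector Bool E.κ, X p := by
    unfold Dnum
    rw [card_filter, ← Fintype.sum_equiv e.symm (fun pt => if E.Dcore v (e.symm pt).toList = true then 1 else 0) _ (fun _ => rfl),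
      Fintype.sum_prod_type]
    refine sum_congr rfl fun p _ => ?_
    obtain ⟨w, rA⟩ := p
    have hrw : ∀ t : List.Vector Bool (1 + rest), (e.symm ((w, rA), t)).toList = w.toList ++ rA.toList ++ t.toList := fun _ => rfl
    simp only [hrw, Dcore_append, hX]
    split_ifs with h1 h2
    · simp [card_univ, card_vector]
    · simp
    · exact sum_head_true rest
  have key : ∀ p : List.Vector Bool E.N × List.Vector Bool E.κ,
      X p + 2 ^ rest * (if E.DV v p.1.toList p.2.toList then 1 else 0) =
        2 ^ rest * (2 * (if E.DV v p.1.toList p.2.toList ∧ E.Dhb v p.1.toList p.2.toList = true then 1 else 0) + 1) := by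
    intro p; simp only [hX]
    by_cases h1 : E.DV v p.1.toList p.2.toList
    · by_cases h2 : E.Dhb v p.1.toList p.2.toList = true
      · rw [if_pos h1, if_pos h2, if_pos h1, if_pos ⟨h1, h2⟩]; ring
      · rw [if_pos h1, if_neg h2, if_pos h1, if_neg (fun h => h2 h.2)]; ring
    · rw [if_neg h1, if_neg h1, if_neg (fun h => h1 h.1)]; ring
  unfold cntV cntVb
  rw [hcount, card_filter, card_filter, mul_sum, ← sum_add_distrib, sum_congr rfl fun p _ => key p, ← mul_sum,
    sum_add_distrib, ← mul_sum]
  simp [card_univ, Fintype.card_prod, card_vector, pow_add]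

/-! ### Explanations with the wrong world bit are rare: reduction to the counting core -/

/-- Honest chunked encryptions decrypt correctly under their own (supported) key. [Goldreich 2004,
Def. 5.1.1 (2) (perfect correctness)] [cite: Goldreich2004, Def. 5.1.1] -/
theorem forall₂_dec_encVec (hC : P.S.IsCorrect) {k : List Bool} (hk : k ∈ (P.S.keyPMF E.n).support) (ρ : ℕ) :
    ∀ (ms : List (List Bool)) (r : List Bool), (∀ m ∈ ms, P.S.enc.coinLen (boolPair k m).length = ρ) →
      ms.length * ρ ≤ r.length → List.Forall₂ (fun c m => P.S.dec k c = some m) (P.S.encVec k ρ ms r) ms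
  | [], _, _, _ => List.Forall₂.nil
  | m :: ms, r, hρ, hr => by
    rw [SKEScheme.encVec_cons]
    refine List.Forall₂.cons ?_ (forall₂_dec_encVec hC hk ρ ms (r.drop ρ) (fun m' hm' => hρ m' (by simp [hm']))
      (by simp only [List.length_cons, Nat.succ_mul] at hr; simp; omega))
    refine hC E.n k hk m _ ?_
    rw [P.S.ctPMF_eq_map (hρ m (by simp)), PMF.support_map, PMF.support_uniformOfFintype, Set.top_eq_univ, Set.image_univ]
    have hlen : (r.take ρ).length = ρ := by
      simp only [List.length_take, List.length_cons, Nat.succ_mul] at hr ⊢; omega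
    exact ⟨⟨r.take ρ, hlen⟩, rfl⟩

/-- A seed's key is supported. [folklore] -/
theorem key_mem_support (s : List.Vector Bool E.σ) : E.key s ∈ (P.S.keyPMF E.n).support := by
  rw [P.S.keyPMF_eq_map E.hσ, PMF.support_map, PMF.support_uniformOfFintype, Set.top_eq_univ, Set.image_univ]
  exact ⟨s, rfl⟩

/-- A seed's key is in the key `Finset`. [folklore] -/
theorem key_mem_keyFinset (s : List.Vector Bool E.σ) : E.key s ∈ P.S.keyFinset E.n :=
  P.S.mem_keyFinset_of_mem_support (E.key_mem_support s)

/-- **An explanation decrypts.** If `A` explains the encoded challenge `⟨c̄⟩` with world bit `b'`,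
then some key of `keyFinset n` decrypts every component of `c̄` to the corresponding component of
`M_{b'}(n)` (the explaining block, being of the good length, names a seed `s` with `|G(1ⁿ;s)| = λ`
and coins under which `Ē_{G(1ⁿ;s)}(M_{b'}(n)) = c̄`; perfect correctness does the rest).
[Goldreich 2004, §5.5 Exercise 2 (guideline: "the correct decryption condition"); Goldreich 2001,
§3.8 Exercise 11] [cite: Goldreich2004, §5.5 Exercise 2 (guideline)] -/
theorem exists_dec_of_DV (hC : P.S.IsCorrect) (cs : List (List Bool)) {w rA : List Bool}
    (hV : E.DV ((encodingList Bool).listBool.encode cs) w rA) :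
    ∃ k' ∈ P.S.keyFinset E.n, List.Forall₂ (fun c m => P.S.dec k' c = some m) cs
      (P.msgs (E.Dhb ((encodingList Bool).listBool.encode cs) w rA) E.n) := by
  set v := (encodingList Bool).listBool.encode cs with hv
  set blk := E.Dblk v w rA with hblk
  have hV' : P.blockFn blk = E.tagv v := hV
  have hne : P.blockFn blk ≠ [] := by rw [hV']; exact boolPair_ne_nil _ _
  obtain ⟨c, hc⟩ := P.blockFn_eq_boolPair_of_ne_nil hne
  have hlen : blk.length = E.jj := by
    rw [hc] at hV'
    have := boolPair_injective (a₁ := (ones blk.length, c)) (a₂ := (ones E.jj, v)) hV'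
    simp only [Prod.mk.injEq] at this
    simpa using congrArg List.length this.1
  -- parse the explaining block
  set x : List.Vector Bool E.jj := ⟨blk, hlen⟩ with hx
  set bv := (E.parse x).1
  set s := (E.parse x).2.1
  set r := (E.parse x).2.2.1
  set u := (E.parse x).2.2.2
  have hxe : x = E.parse.symm (bv, (s, (r, u))) := by simp [bv, s, r, u]
  have hblk' : blk = (E.parse.symm (bv, (s, (r, u)))).toList := by rw [← hxe]; rfl
  have hf := E.blockFn_parse_symm bv s r u
  rw [← hblk', hV'] at hf
  split_ifs at hf with hkl
  swap
  · exact absurd hf (boolPair_ne_nil _ _)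
  have hb : E.Dhb v w rA = vec1Equiv bv := by
    change blk.headD false = _; rw [hblk', headD_parse_symm]
  rw [hb]
  -- the ciphertext vectors agree
  have hcs : P.S.encVec (E.key s) E.ρ (P.msgs (vec1Equiv bv) E.n) r.toList = cs := by
    unfold realOut tagv at hf
    have h2 := boolPair_injective (a₁ := (ones E.jj, v)) (a₂ := (ones E.jj, _)) hf
    simp only [Prod.mk.injEq, true_and] at h2
    exact ((encodingList Bool).listBool.encode_injective h2).symm
  refine ⟨E.key s, E.key_mem_keyFinset s, ?_⟩
  rw [← hcs]
  refine E.forall₂_dec_encVec hC (E.key_mem_support s) E.ρ _ _ (fun m hm => ?_) (by simp [Tρ])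
  rw [length_boolPair, P.length_of_mem_msgs hm, show (E.key s).length = E.lam from hkl, E.hρ]

/-- **The bad challenges of world `b`**: those ciphertext vectors that some key of `keyFinset n`
decrypts componentwise to the *other* world's plaintext vector. [Goldreich 2001, §3.8 Exercise 11
("almost disjoint")] [folklore] -/
def Bad (b : Bool) : Set (List (List Bool)) :=
  {cs | ∃ k' ∈ P.S.keyFinset E.n, List.Forall₂ (fun c m => P.S.dec k' c = some m) cs (P.msgs (!b) E.n)}

/-- Outside `Bad b`, every explanation carries the true world bit `b`. [folklore] -/
theorem cntVb_not_eq_zero (hC : P.S.IsCorrect) {b : Bool} {cs : List (List Bool)} (hcs : cs ∉ E.Bad b) :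
    E.cntVb ((encodingList Bool).listBool.encode cs) (!b) = 0 := by
  rw [cntVb, card_eq_zero, filter_eq_empty_iff]
  rintro p - ⟨hV, hb⟩
  refine hcs ?_
  rw [Bad, Set.mem_setOf_eq, ← hb]
  exact E.exists_dec_of_DV hC cs hV

/-- **Bad challenges are rare**: `Pr_{c̄ ← Ē_k(M_b(n))}[Bad b] ≤ 2^{-(n+1)}` for every key `k`
(from `SKEScheme.toOuterMeasure_exists_dec_le` with `|keyFinset n| ≤ 2^σ` and `L(n) - 1 ≥ σ + n + 1`).
[Goldreich 2001, §3.8 Exercise 11; Goldreich 2004, §5.5 Exercise 2] [cite: Goldreich2004, §5.5 Exercise 2 (guideline)] -/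
theorem toOuterMeasure_Bad_le (k : List Bool) (b : Bool) :
    (P.S.ctVecPMF k (P.msgs b E.n)).toOuterMeasure (E.Bad b) ≤ 2⁻¹ ^ (E.n + 1) := by
  have hnd := nodup_map_msg (P.L E.n)
  have hK := P.S.card_keyFinset_le E.hσ
  have hL : ((List.range (P.L E.n)).map (msg (P.L E.n))).length = P.L E.n := by simp
  have key : (P.S.ctVecPMF k (P.msgs b E.n)).toOuterMeasure (E.Bad b) ≤ (P.S.keyFinset E.n).card * 2⁻¹ ^ (P.L E.n - 1) := by
    cases b
    · have h := P.S.toOuterMeasure_exists_dec_le k (P.S.keyFinset E.n) (l₁ := []) (l₃ := (List.range (P.L E.n)).map (msg (P.L E.n)))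
        (l₁' := []) (l₃' := List.replicate (P.L E.n) (msg (P.L E.n) 0)) (m₀ := msg (P.L E.n) 0) rfl hnd
      rw [hL] at h
      simpa [Bad, P.msgs_false_eq, P.msgs_true_eq] using h
    · have h := P.S.toOuterMeasure_exists_dec_le k (P.S.keyFinset E.n) (l₁ := (List.range (P.L E.n)).map (msg (P.L E.n))) (l₃ := [])
        (l₁' := List.replicate (P.L E.n) (msg (P.L E.n) 0)) (l₃' := []) (m₀ := msg (P.L E.n) 0) (by simp) hnd
      rw [hL] at h
      simpa [Bad, P.msgs_false_eq, P.msgs_true_eq] using h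
  refine key.trans ?_
  have hLn : P.L E.n - 1 = E.σ + (E.n + 1) + (P.pG.eval E.n - E.σ) := by
    have := E.hσG; rw [P.L_eq]; omega
  rw [hLn, pow_add, pow_add, ← mul_assoc, ← mul_assoc]
  calc _ ≤ (2 : ℝ≥0∞) ^ E.σ * 2⁻¹ ^ E.σ * 2⁻¹ ^ (E.n + 1) * 2⁻¹ ^ (P.pG.eval E.n - E.σ) := by
        gcongr
        exact_mod_cast hK
    _ = 2⁻¹ ^ (E.n + 1) * 2⁻¹ ^ (P.pG.eval E.n - E.σ) := by
        rw [← mul_pow, ENNReal.mul_inv_cancel two_ne_zero (by simp), one_pow, one_mul]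
    _ ≤ 2⁻¹ ^ (E.n + 1) * 1 := by gcongr; exact pow_le_one' (by norm_num) _
    _ = _ := mul_one _

/-! ### Per-challenge acceptance bounds in the two worlds -/

/-- `Dnum ≤ 2^{cl}`. [folklore] -/
theorem Dnum_le (rest : ℕ) (v : List Bool) : E.Dnum rest v ≤ 2 ^ (E.N + E.κ + (1 + rest)) := by
  unfold Dnum
  refine (card_filter_le _ _).trans ?_
  rw [card_univ, card_vector, Fintype.card_bool]

/-- **World `1`, in counts**: `2^{N+κ+rest} + 2^{rest}·#{V} ≤ #{Dcore = 1} + 2^{cl}·1_{Bad 1}` for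
the encoded challenge `⟨c̄⟩`. [Goldreich 2001, proof of Prop. 3.3.8] [folklore] -/
theorem Dnum_true_ge (hC : P.S.IsCorrect) (rest : ℕ) (cs : List (List Bool)) :
    2 ^ (E.N + E.κ + rest) + 2 ^ rest * E.cntV ((encodingList Bool).listBool.encode cs) ≤
      E.Dnum rest ((encodingList Bool).listBool.encode cs) +
        2 ^ (E.N + E.κ + (1 + rest)) * (if cs ∈ E.Bad true then 1 else 0) := by
  set v := (encodingList Bool).listBool.encode cs
  have hV := E.cntV_le v
  by_cases hcs : cs ∈ E.Bad true
  · rw [if_pos hcs, mul_one]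
    have : 2 ^ rest * E.cntV v ≤ 2 ^ rest * 2 ^ (E.N + E.κ) := Nat.mul_le_mul_left _ hV
    have e : 2 ^ (E.N + E.κ + (1 + rest)) = 2 ^ (E.N + E.κ + rest) + 2 ^ rest * 2 ^ (E.N + E.κ) := by ring
    omega
  · rw [if_neg hcs, mul_zero, add_zero]
    have h0 : E.cntVb v false = 0 := E.cntVb_not_eq_zero hC hcs
    have h1 : E.cntVb v true = E.cntV v := by have := E.cntVb_add v; omega
    have h := E.card_Dcore v rest
    rw [h1] at h
    have e : 2 ^ rest * (2 * E.cntV v + 2 ^ (E.N + E.κ)) = 2 ^ rest * E.cntV v + 2 ^ rest * E.cntV v + 2 ^ (E.N + E.κ + rest) := by ring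
    omega

/-- **World `0`, in counts**: `#{Dcore = 1} + 2^{rest}·#{V} ≤ 2^{N+κ+rest} + 2^{cl}·1_{Bad 0}`.
[Goldreich 2001, proof of Prop. 3.3.8] [folklore] -/
theorem Dnum_false_le (hC : P.S.IsCorrect) (rest : ℕ) (cs : List (List Bool)) :
    E.Dnum rest ((encodingList Bool).listBool.encode cs) + 2 ^ rest * E.cntV ((encodingList Bool).listBool.encode cs) ≤
      2 ^ (E.N + E.κ + rest) + 2 ^ (E.N + E.κ + (1 + rest)) * (if cs ∈ E.Bad false then 1 else 0) := by
  set v := (encodingList Bool).listBool.encode cs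
  have hV := E.cntV_le v
  have hD := E.Dnum_le rest v
  by_cases hcs : cs ∈ E.Bad false
  · rw [if_pos hcs, mul_one]
    have : 2 ^ rest * E.cntV v ≤ 2 ^ rest * 2 ^ (E.N + E.κ) := Nat.mul_le_mul_left _ hV
    have e : 2 ^ rest * 2 ^ (E.N + E.κ) = 2 ^ (E.N + E.κ + rest) := by ring
    omega
  · rw [if_neg hcs, mul_zero, add_zero]
    have h0 : E.cntVb v true = 0 := by simpa using E.cntVb_not_eq_zero hC hcs
    have h := E.card_Dcore v rest
    rw [h0, mul_zero, zero_add] at h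
    have e : 2 ^ rest * 2 ^ (E.N + E.κ) = 2 ^ (E.N + E.κ + rest) := by ring
    omega

/-- The acceptance probability of the core on challenge `v` with `N + κ + (1 + rest)` coins. [folklore] -/
def Dacc (rest : ℕ) (v : List Bool) : ℝ≥0∞ := (E.Dnum rest v : ℝ≥0∞) / 2 ^ (E.N + E.κ + (1 + rest))

/-- Half the fraction of coin pairs on which `A` explains the challenge, `½ · #{V} / 2^{N+κ}`, over
the common denominator `2^{N+κ+1+rest}`. [folklore] -/
def Vh (rest : ℕ) (v : List Bool) : ℝ≥0∞ := ((2 ^ rest * E.cntV v : ℕ) : ℝ≥0∞) / 2 ^ (E.N + E.κ + (1 + rest))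

/-- `½` over the common denominator. [folklore] -/
theorem half_eq (rest : ℕ) : ((2 ^ (E.N + E.κ + rest) : ℕ) : ℝ≥0∞) / 2 ^ (E.N + E.κ + (1 + rest)) = 2⁻¹ := by
  rw [show E.N + E.κ + (1 + rest) = (E.N + E.κ + rest) + 1 by ring, pow_succ, Nat.cast_pow, Nat.cast_ofNat,
    ← mul_one ((2 : ℝ≥0∞) ^ (E.N + E.κ + rest)), mul_assoc, one_mul,
    ENNReal.mul_div_mul_left _ _ (by simp) (by simp), one_div]

/-- **World `1`: the distinguisher accepts an honest-world-`1` challenge with probability at least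
`½ + ½·V`, unless the challenge is bad.** [Goldreich 2001, proof of Prop. 3.3.8; §3.8
Exercise 11] [folklore] -/
theorem Dacc_true_ge (hC : P.S.IsCorrect) (rest : ℕ) (cs : List (List Bool)) :
    2⁻¹ + E.Vh rest ((encodingList Bool).listBool.encode cs) ≤
      E.Dacc rest ((encodingList Bool).listBool.encode cs) + (E.Bad true).indicator 1 cs := by
  have h := E.Dnum_true_ge hC rest cs
  have h' : (((2 ^ (E.N + E.κ + rest) + 2 ^ rest * E.cntV ((encodingList Bool).listBool.encode cs) : ℕ) : ℝ≥0∞)) /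
      2 ^ (E.N + E.κ + (1 + rest)) ≤
      ((E.Dnum rest ((encodingList Bool).listBool.encode cs) + 2 ^ (E.N + E.κ + (1 + rest)) * (if cs ∈ E.Bad true then 1 else 0) : ℕ) : ℝ≥0∞) /
        2 ^ (E.N + E.κ + (1 + rest)) := ENNReal.div_le_div_right (by exact_mod_cast h) _
  rw [Nat.cast_add, ENNReal.add_div, half_eq, Nat.cast_add, ENNReal.add_div] at h'
  refine h'.trans (le_of_eq ?_)
  unfold Dacc
  congr 1
  split_ifs with hcs
  · rw [Set.indicator_of_mem hcs, Pi.one_apply, mul_one, Nat.cast_pow, Nat.cast_ofNat, ENNReal.div_self (by simp) (by simp)]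
  · rw [Set.indicator_of_notMem hcs, mul_zero, Nat.cast_zero, ENNReal.zero_div]

/-- **World `0`: the distinguisher accepts an honest-world-`0` challenge with probability at most
`½ - ½·V`, unless the challenge is bad.** [Goldreich 2001, proof of Prop. 3.3.8; §3.8
Exercise 11] [folklore] -/
theorem Dacc_false_le (hC : P.S.IsCorrect) (rest : ℕ) (cs : List (List Bool)) :
    E.Dacc rest ((encodingList Bool).listBool.encode cs) + E.Vh rest ((encodingList Bool).listBool.encode cs) ≤
      2⁻¹ + (E.Bad false).indicator 1 cs := by
  have h := E.Dnum_false_le hC rest cs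
  have h' : (((E.Dnum rest ((encodingList Bool).listBool.encode cs) + 2 ^ rest * E.cntV ((encodingList Bool).listBool.encode cs) : ℕ) : ℝ≥0∞)) /
      2 ^ (E.N + E.κ + (1 + rest)) ≤
      ((2 ^ (E.N + E.κ + rest) + 2 ^ (E.N + E.κ + (1 + rest)) * (if cs ∈ E.Bad false then 1 else 0) : ℕ) : ℝ≥0∞) /
        2 ^ (E.N + E.κ + (1 + rest)) := ENNReal.div_le_div_right (by exact_mod_cast h) _
  rw [Nat.cast_add, ENNReal.add_div, Nat.cast_add, ENNReal.add_div, half_eq] at h'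
  refine le_trans (le_of_eq rfl) (h'.trans (le_of_eq ?_))
  congr 1
  split_ifs with hcs
  · rw [Set.indicator_of_mem hcs, Pi.one_apply, mul_one, Nat.cast_pow, Nat.cast_ofNat, ENNReal.div_self (by simp) (by simp)]
  · rw [Set.indicator_of_notMem hcs, mul_zero, Nat.cast_zero, ENNReal.zero_div]

end Setup

end

end SKEOWF

end Literature.Computability.Cryptography


/-!
# Private-key encryption ⇒ one-way functions, IV: the simulation identity

Fourth file of the discharge of `OWFExist_of_secureSKEExist` (Impagliazzo–Luby 1989, Thm. 1); see
`SchemesOWF.lean`, Part I (architecture), `SchemesOWF.lean`, Part II (the candidate `F`),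
`SchemesOWF.lean`, Part III (the distinguisher's core at one security parameter).

At a fixed `Setup` this file compares the distinguisher's explanation count `#{V}` with the
inversion count of `A` on `F` — the heart of Goldreich's "disjoint case" argument (FoC I, §3.8
Exercise 11 with the proof of Prop. 3.3.8): the value `y` the distinguisher hands to `A` is
distributed *exactly* as `F(U_N)` conditioned on the challenge block being a real block of the
challenge's world, because a uniformly random block of the good length `j*` *is* (bit, key seed,
encryption coins, junk). Everything is counting of coin strings:

* `Setup.Y`, `Setup.F_eq_Y`, `Setup.Fsplice_eq_Y` — `F` and the splice as a function of the
  blocks around the challenge block;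
* `Setup.cntV_eq` — `#{V}(v) = 2^{j*} · Vcount(⟨1^{j*}, v⟩)` (the challenge block's own input bits
  are free);
* `Setup.invertProb_eq` — `Pr[A inverts F on U_N] = cntInv / 2^{N+κ}`;
* `Setup.cntInv_le` — an inversion either happens with some copy of the good block length real,
  or all `M` copies are `⊥`: `cntInv ≤ Σᵢ cntIR i + 2^κ · cntAllBot`;
* `Setup.cntIR_le` — **simulation**: `cntIR i₀ ≤ 2^{pad} Σ_b Σ_{s : |G(1ⁿ;s)| = λ} Σ_r̄ Vcount(real
  output)` (an inversion with copy `i₀` real explains that real block);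
* `Setup.cntAllBot_eq` — `cntAllBot = 2^{N - M j*} · (2^{1+Tρ+pad} (2^σ - cntλ))^M`
  (independent copies; `cntλ = #{s : |G(1ⁿ; s)| = λ}`).

The integration against the key and ciphertext distributions and the asymptotics follow in
`SchemesOWF.lean`, Part VI.

## References

* R. Impagliazzo, M. Luby, *One-way functions are essential for complexity based cryptography*,
  FOCS 1989, Thm. 1.
* O. Goldreich, *Foundations of Cryptography I*, CUP 2001, §3.8 Exercise 11, proof of Prop. 3.3.8;
  *Foundations of Cryptography II*, CUP 2004, §5.5 Exercise 2.
-/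

namespace Literature.Computability.Cryptography

open _root_.Computability Complexity Polynomial Finset
open scoped ENNReal Classical

namespace SKEOWF

noncomputable section

namespace Setup

variable {P : Params} {sf : Polynomial ℕ} {A : RandAlg (List Bool) (List Bool)} (E : Setup P sf A)

/-! ### `F` and the splice around the challenge block -/

/-- The assembled value as a function of the input bits before and after the challenge block and
of the challenge block's *output* `o`. [folklore] -/
def Y (pre post o : List Bool) : List Bool :=
  assemble sf E.N ((chop E.ls₁ pre).map P.blockFn ++ o :: (chop E.ls₂ post).map P.blockFn)

/-- Length bookkeeping for a three-part input. [folklore] -/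
theorem length_three (pre : List.Vector Bool E.off) (x : List.Vector Bool E.jj) (post : List.Vector Bool E.post) :
    (pre.toList ++ x.toList ++ post.toList).length = E.N := by
  simp [E.N_eq]

/-- The blocks of a three-part input. [folklore] -/
theorem blocks_three (pre : List.Vector Bool E.off) (x : List.Vector Bool E.jj) (post : List.Vector Bool E.post) :
    blocks (pre.toList ++ x.toList ++ post.toList) = chop E.ls₁ pre.toList ++ x.toList :: chop E.ls₂ post.toList :=
  blocks_middle E.lens_eq (by rw [E.length_three]; rfl) (by simp [off]) (by simp)

/-- **The splice is `Y`**: it does not depend on the challenge block's input bits. [folklore] -/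
theorem Fsplice_eq_Y (pre : List.Vector Bool E.off) (x : List.Vector Bool E.jj) (post : List.Vector Bool E.post) (o : List Bool) :
    P.Fsplice sf E.q o (pre.toList ++ x.toList ++ post.toList) = E.Y pre.toList post.toList o := by
  rw [← E.length_ls₁, P.Fsplice_middle sf E.lens_eq (by rw [E.length_three]; rfl) (by simp [off]) (by simp) o, E.length_three]
  rfl

/-- **`F` is `Y` at the true block output.** [folklore] -/
theorem F_eq_Y (pre : List.Vector Bool E.off) (x : List.Vector Bool E.jj) (post : List.Vector Bool E.post) :
    P.F sf (pre.toList ++ x.toList ++ post.toList) = E.Y pre.toList post.toList (P.blockFn x.toList) := by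
  have hq : E.q < (blocks (pre.toList ++ x.toList ++ post.toList)).length := by
    rw [length_blocks, E.length_three]; exact E.q_lt
  rw [P.F_eq_Fsplice sf hq, ← E.Fsplice_eq_Y pre x post]
  congr 2
  simp only [E.blocks_three]
  rw [List.getElem_append_right (by simp [length_chop])]
  simp [length_chop]

/-- `V'_o`: on `(1^N, Y(pre, post, o))` with coins `r_A`, `A` returns a string whose challenge
window the block function maps to `o` (an `abbrev`, decided by list equality). [folklore] -/
abbrev VY (o pre post rA : List Bool) : Prop :=
  P.blockFn (((A.run (boolPair (unaryEncodeNat E.N) (E.Y pre post o)) rA).drop E.off).take E.jj) = o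

/-- Number of `(pre, post, r_A)` on which `A` explains the block output `o`. [folklore] -/
def Vcount (o : List Bool) : ℕ :=
  (univ.filter fun t : List.Vector Bool E.off × List.Vector Bool E.post × List.Vector Bool E.κ =>
    E.VY o t.1.toList t.2.1.toList t.2.2.toList).card

/-- Splitting the distinguisher's `w` into the three parts. [folklore] -/
def split3 : List.Vector Bool E.N ≃ List.Vector Bool E.off × (List.Vector Bool E.jj × List.Vector Bool E.post) :=
  (vecCut E.off (E.jj + E.post) _ E.N_eq).trans ((Equiv.refl _).prodCongr (vecCut _ _ _ rfl))

/-- The three parts, reassembled. [folklore] -/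
theorem split3_symm_toList (pre : List.Vector Bool E.off) (x : List.Vector Bool E.jj) (post : List.Vector Bool E.post) :
    (E.split3.symm (pre, (x, post))).toList = pre.toList ++ x.toList ++ post.toList := by
  rw [List.append_assoc]; rfl

/-- **The distinguisher's explanation count through `Vcount`**: `#{V}(v) = 2^{j*} · Vcount(⟨1^{j*}, v⟩)`.
[folklore] -/
theorem cntV_eq (v : List Bool) : E.cntV v = 2 ^ E.jj * E.Vcount (E.tagv v) := by
  unfold cntV Vcount
  rw [card_filter, card_filter, ← Fintype.sum_equiv (E.split3.symm.prodCongr (Equiv.refl (List.Vector Bool E.κ)))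
      (fun pt => if E.DV v (E.split3.symm pt.1).toList pt.2.toList then 1 else 0) _ (fun _ => rfl),
    Fintype.sum_prod_type, Fintype.sum_prod_type, Fintype.sum_prod_type, mul_sum]
  refine sum_congr rfl fun pre _ => ?_
  rw [Fintype.sum_prod_type, Fintype.sum_prod_type, mul_sum, sum_comm]
  refine sum_congr rfl fun post _ => ?_
  rw [mul_sum, sum_comm]
  refine sum_congr rfl fun rA _ => ?_
  have h : ∀ x : List.Vector Bool E.jj, (E.DV v (E.split3.symm (pre, (x, post))).toList rA.toList ↔ E.VY (E.tagv v) pre.toList post.toList rA.toList) := by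
    intro x
    change P.blockFn (((A.run (boolPair (unaryEncodeNat E.N) (P.Fsplice sf E.q (E.tagv v) (E.split3.symm (pre, (x, post))).toList)) rA.toList).drop E.off).take E.jj) = E.tagv v ↔ _
    rw [split3_symm_toList, Fsplice_eq_Y]
  simp only [h, sum_const, card_univ, card_vector, Fintype.card_bool, smul_eq_mul]

/-! ### The inversion count of `A` on `F` -/

/-- `A` inverts `F` at `x` with coins `r_A`. [Goldreich 2001, Def. 2.2.1] [folklore] -/
abbrev Inv (x : List.Vector Bool E.N) (rA : List.Vector Bool E.κ) : Prop :=
  P.F sf (A.run (boolPair (unaryEncodeNat E.N) (P.F sf x.toList)) rA.toList) = P.F sf x.toList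

/-- Number of `(x, r_A)` on which `A` inverts. [folklore] -/
def cntInv : ℕ := (univ.filter fun p : List.Vector Bool E.N × List.Vector Bool E.κ => E.Inv p.1 p.2).card

/-- **The inversion probability as a count** (all `F`-values at length `N` have length `Λ(N)+1`, so
`A` always uses `κ` coins). [Goldreich 2001, Def. 2.2.1; Arora–Barak 2009, §7.1] [folklore] -/
theorem invertProb_eq (hsf : ∀ u, (P.blockFn u).length ≤ sf.eval u.length) :
    invertProb (P.F sf) A E.N = (E.cntInv : ℝ) / 2 ^ (E.N + E.κ) := by
  unfold invertProb uniformAvg cntInv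
  have hκ : ∀ x : List.Vector Bool E.N, A.coinLen (id (boolPair (unaryEncodeNat E.N) (P.F sf x.toList))).length = E.κ := by
    intro x
    rw [id, length_boolPair, SKEScheme.length_unaryEncodeNat, P.length_F hsf, x.toList_length, E.hκ]
  rw [sum_congr rfl fun (x : List.Vector Bool E.N) _ => Yao.Params.prCount_eq A id (boolPair (unaryEncodeNat E.N) (P.F sf x.toList))
    {z | P.F sf z = P.F sf x.toList} (hκ x)]
  rw [← sum_div, div_div, ← pow_add, add_comm E.κ, card_filter]
  congr 1
  rw [Nat.cast_sum, Fintype.sum_prod_type]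
  refine sum_congr rfl fun x _ => ?_
  rw [card_filter, Nat.cast_sum]
  rfl

/-- Flat index of copy `i` of the good block length. [folklore] -/
def qi (i : ℕ) : ℕ := (E.jj - 1) * E.M + i

/-- Copy `i₀` is the challenge block. [folklore] -/
@[simp] theorem qi_i₀ : E.qi E.i₀ = E.q := rfl

/-- Copy `i` of the good block length of `x` is real (a non-`⊥` block output). [folklore] -/
def RealAt (i : ℕ) (x : List.Vector Bool E.N) : Prop := P.blockFn (((blocks x.toList)[E.qi i]?).getD []) ≠ []

/-- Number of `(x, r_A)` on which `A` inverts and copy `i` is real. [folklore] -/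
def cntIR (i : ℕ) : ℕ := (univ.filter fun p : List.Vector Bool E.N × List.Vector Bool E.κ => E.Inv p.1 p.2 ∧ E.RealAt i p.1).card

/-- Number of `x` all of whose copies of the good block length are `⊥`. [folklore] -/
def cntAllBot : ℕ := (univ.filter fun x : List.Vector Bool E.N => ∀ i < E.M, ¬ E.RealAt i x).card

/-- **Inversions happen on a real copy, or all copies are `⊥`.** [folklore] -/
theorem cntInv_le : E.cntInv ≤ ∑ i ∈ range E.M, E.cntIR i + 2 ^ E.κ * E.cntAllBot := by
  unfold cntInv cntIR cntAllBot
  have hsub : (univ.filter fun p : List.Vector Bool E.N × List.Vector Bool E.κ => E.Inv p.1 p.2) ⊆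
      (range E.M).biUnion (fun i => univ.filter fun p : List.Vector Bool E.N × List.Vector Bool E.κ => E.Inv p.1 p.2 ∧ E.RealAt i p.1) ∪
        (univ.filter fun p : List.Vector Bool E.N × List.Vector Bool E.κ => ∀ i < E.M, ¬ E.RealAt i p.1) := by
    intro p hp
    simp only [mem_filter, mem_univ, true_and] at hp
    by_cases h : ∃ i < E.M, E.RealAt i p.1
    · obtain ⟨i, hi, hr⟩ := h
      exact mem_union_left _ (mem_biUnion.2 ⟨i, mem_range.2 hi, mem_filter.2 ⟨mem_univ _, hp, hr⟩⟩)
    · push Not at h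
      exact mem_union_right _ (mem_filter.2 ⟨mem_univ _, h⟩)
  refine (card_le_card hsub).trans ((card_union_le _ _).trans (Nat.add_le_add card_biUnion_le (le_of_eq ?_)))
  rw [show (univ.filter fun p : List.Vector Bool E.N × List.Vector Bool E.κ => ∀ i < E.M, ¬ E.RealAt i p.1) =
      (univ.filter fun x : List.Vector Bool E.N => ∀ i < E.M, ¬ E.RealAt i x) ×ˢ (univ : Finset (List.Vector Bool E.κ)) by
    ext p; simp, card_product, card_univ, card_vector, Fintype.card_bool, mul_comm]

/-! ### Simulation: an inversion with the challenge copy real explains a real block -/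

/-- Seeds whose key has the designated length `λ`. [folklore] -/
def goodSeeds : Finset (List.Vector Bool E.σ) := univ.filter fun s => (E.key s).length = E.lam

/-- Membership in `goodSeeds`. [folklore] -/
@[simp] theorem mem_goodSeeds {s : List.Vector Bool E.σ} : s ∈ E.goodSeeds ↔ (E.key s).length = E.lam := by
  simp [goodSeeds]

/-- The challenge index carries the good length (partial-`getElem` form). [folklore] -/
theorem lens_getElem?_q : (lens E.M)[E.q]? = some E.jj := by
  rw [List.getElem?_eq_getElem E.q_lt_length, E.lens_q]

/-- **From an inversion to an explanation.** If `A` inverts `F` at `x = pre · u · post` then it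
explains the block output `f(u)` in the sense of `VY`. [Goldreich 2001, proof of Prop. 3.3.8] [folklore] -/
theorem VY_of_Inv (pre : List.Vector Bool E.off) (u : List.Vector Bool E.jj) (post : List.Vector Bool E.post)
    (rA : List.Vector Bool E.κ) (h : E.Inv (E.split3.symm (pre, (u, post))) rA) :
    E.VY (P.blockFn u.toList) pre.toList post.toList rA.toList := by
  have hq : E.q < (blocks (pre.toList ++ u.toList ++ post.toList)).length := by
    rw [length_blocks, E.length_three]; exact E.q_lt
  have h' : P.F sf (A.run (boolPair (unaryEncodeNat E.N) (E.Y pre.toList post.toList (P.blockFn u.toList))) rA.toList) =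
      P.Fsplice sf E.q (P.blockFn u.toList) (pre.toList ++ u.toList ++ post.toList) := by
    have h0 : P.F sf (A.run (boolPair (unaryEncodeNat E.N) (P.F sf (E.split3.symm (pre, (u, post))).toList)) rA.toList) =
        P.F sf (E.split3.symm (pre, (u, post))).toList := h
    rw [split3_symm_toList, E.F_eq_Y] at h0
    rw [h0, E.Fsplice_eq_Y]
  set z := A.run (boolPair (unaryEncodeNat E.N) (E.Y pre.toList post.toList (P.blockFn u.toList))) rA.toList with hz
  obtain ⟨hzq, hfz⟩ := P.blockFn_blocks_eq_of_F_eq_Fsplice hq h'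
  have hMz : Mof z.length = E.M := by
    have := (assemble_inj h').1; rwa [E.length_three] at this
  have hget : (blocks z)[E.q]? = some ((z.drop E.off).take E.jj) := by
    rw [blocks_getElem?, hMz, E.lens_getElem?_q, Option.map_some]
    rfl
  have hwin : (blocks z)[E.q] = (z.drop E.off).take E.jj := (List.getElem_eq_iff hzq).2 hget
  change P.blockFn ((z.drop E.off).take E.jj) = P.blockFn u.toList
  rw [← hwin]
  exact hfz

/-- The challenge copy of `pre · u · post` is real iff `f(u) ≠ ⊥`. [folklore] -/
theorem realAt_i₀_iff (pre : List.Vector Bool E.off) (u : List.Vector Bool E.jj) (post : List.Vector Bool E.post) :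
    E.RealAt E.i₀ (E.split3.symm (pre, (u, post))) ↔ P.blockFn u.toList ≠ [] := by
  unfold RealAt
  rw [qi_i₀, split3_symm_toList, E.blocks_three, List.getElem?_append_right (by simp [length_chop])]
  simp [length_chop]

/-- `Vcount` as an iterated sum. [folklore] -/
theorem Vcount_eq_sum (o : List Bool) : E.Vcount o =
    ∑ pre : List.Vector Bool E.off, ∑ post : List.Vector Bool E.post, ∑ rA : List.Vector Bool E.κ,
      (if E.VY o pre.toList post.toList rA.toList then 1 else 0) := by
  unfold Vcount
  rw [card_filter, Fintype.sum_prod_type]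
  simp only [Fintype.sum_prod_type]

/-- **Simulation inequality.** The inversions of `A` with the challenge copy real are at most
`2^{pad}`-times the explanations, summed over the world bit, the seeds of key length `λ` and the
encryption coins, of the corresponding *real block output*: a uniformly random block of the good
length is (bit, seed, coins, junk), and its output is the honest tagged encoded ciphertext vector.
[Goldreich 2001, §3.8 Exercise 11 (guideline) with the proof of Prop. 3.3.8; Goldreich 2004, §5.5
Exercise 2] [cite: Goldreich2004, §5.5 Exercise 2 (guideline)] -/
theorem cntIR_le : E.cntIR E.i₀ ≤
    2 ^ E.pad * ∑ b : Bool, ∑ s ∈ E.goodSeeds, ∑ r : List.Vector Bool E.Tρ, E.Vcount (E.realOut b s r) := by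
  -- Step 1: an inversion with the challenge copy real is an explanation of the block's output
  have h1 : E.cntIR E.i₀ ≤ ∑ u : List.Vector Bool E.jj, (if P.blockFn u.toList ≠ [] then E.Vcount (P.blockFn u.toList) else 0) := by
    have e1 : E.cntIR E.i₀ = ∑ pre : List.Vector Bool E.off, ∑ u : List.Vector Bool E.jj, ∑ post : List.Vector Bool E.post,
        ∑ rA : List.Vector Bool E.κ,
          (if E.Inv (E.split3.symm (pre, (u, post))) rA ∧ E.RealAt E.i₀ (E.split3.symm (pre, (u, post))) then 1 else 0) := by
      unfold cntIR
      rw [card_filter, ← Fintype.sum_equiv (E.split3.symm.prodCongr (Equiv.refl (List.Vector Bool E.κ)))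
        (fun pt => if E.Inv (E.split3.symm pt.1) pt.2 ∧ E.RealAt E.i₀ (E.split3.symm pt.1) then 1 else 0) _ (fun _ => rfl)]
      simp only [Fintype.sum_prod_type]
    rw [e1, sum_comm]
    refine sum_le_sum fun u _ => ?_
    by_cases hu : P.blockFn u.toList = []
    · rw [if_neg (fun h => h hu)]
      refine le_of_eq (sum_eq_zero fun pre _ => sum_eq_zero fun post _ => sum_eq_zero fun rA _ => ?_)
      rw [if_neg]
      rintro ⟨-, hr⟩
      exact (E.realAt_i₀_iff pre u post).1 hr hu
    · rw [if_pos hu, Vcount_eq_sum]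
      refine sum_le_sum fun pre _ => sum_le_sum fun post _ => sum_le_sum fun rA _ => ?_
      by_cases h1 : E.Inv (E.split3.symm (pre, (u, post))) rA ∧ E.RealAt E.i₀ (E.split3.symm (pre, (u, post)))
      · rw [if_pos h1, if_pos (E.VY_of_Inv pre u post rA h1.1)]
      · rw [if_neg h1]; exact Nat.zero_le _
  refine h1.trans (le_of_eq ?_)
  -- Step 2: parse the block
  rw [← Fintype.sum_equiv E.parse.symm (fun t => if P.blockFn (E.parse.symm t).toList ≠ [] then E.Vcount (P.blockFn (E.parse.symm t).toList) else 0)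
    _ (fun _ => rfl)]
  simp only [Fintype.sum_prod_type]
  have hval : ∀ (bv : List.Vector Bool 1) (s : List.Vector Bool E.σ) (r : List.Vector Bool E.Tρ) (u : List.Vector Bool E.pad),
      (if P.blockFn (E.parse.symm (bv, (s, (r, u)))).toList ≠ [] then E.Vcount (P.blockFn (E.parse.symm (bv, (s, (r, u)))).toList) else 0) =
        if (E.key s).length = E.lam then E.Vcount (E.realOut (vec1Equiv bv) s r) else 0 := by
    intro bv s r u
    rw [E.blockFn_parse_symm]
    by_cases hs : (E.key s).length = E.lam
    · rw [if_pos hs, if_pos hs, if_pos (E.realOut_ne_nil _ _ _)]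
    · rw [if_neg hs, if_neg hs, if_neg (by simp)]
  simp only [hval, sum_const, card_univ, card_vector, Fintype.card_bool, smul_eq_mul]
  have hpull : ∀ (b : Bool) (s : List.Vector Bool E.σ),
      (∑ _r : List.Vector Bool E.Tρ, 2 ^ E.pad * if (E.key s).length = E.lam then E.Vcount (E.realOut b s _r) else 0) =
        2 ^ E.pad * if (E.key s).length = E.lam then ∑ r : List.Vector Bool E.Tρ, E.Vcount (E.realOut b s r) else 0 := by
    intro b s
    rw [← mul_sum]
    split_ifs <;> simp
  rw [Fintype.sum_equiv vec1Equiv _ (fun b => ∑ s : List.Vector Bool E.σ,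
      2 ^ E.pad * if (E.key s).length = E.lam then ∑ r : List.Vector Bool E.Tρ, E.Vcount (E.realOut b s r) else 0)
      (fun bv => by simp only [hpull]), mul_sum]
  refine sum_congr rfl fun b _ => ?_
  rw [← mul_sum]
  congr 1
  rw [← sum_filter]
  rfl

/-! ### All copies `⊥`: independent trials -/

/-- Offset of copy `0` of the good block length. [folklore] -/
def O : ℕ := ((lens E.M).take (E.qi 0)).sum

/-- Every copy of the good block length has flat index in range. [folklore] -/
theorem qi_lt {i : ℕ} (hi : i < E.M) : E.qi i < (lens E.M).length := by
  have h1 : E.jj ≤ E.M := E.hjM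
  have h3 := E.one_le_jj
  rw [length_lens]
  unfold qi
  calc (E.jj - 1) * E.M + i < (E.jj - 1) * E.M + E.M := by omega
    _ = E.jj * E.M := by conv_rhs => rw [show E.jj = (E.jj - 1) + 1 by omega]; ring
    _ ≤ E.M * E.M := Nat.mul_le_mul_right _ h1

/-- Every copy of the good block length has length `j*`. [folklore] -/
theorem lens_qi {i : ℕ} (hi : i < E.M) : (lens E.M)[E.qi i]'(E.qi_lt hi) = E.jj := by
  rw [lens_getElem]
  have hM : 0 < E.M := by omega
  have h3 := E.one_le_jj
  unfold qi
  rw [Nat.add_comm ((E.jj - 1) * E.M), Nat.add_mul_div_right _ _ hM, Nat.div_eq_of_lt hi]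
  omega

/-- The same, partial-`getElem` form. [folklore] -/
theorem lens_getElem?_qi {i : ℕ} (hi : i < E.M) : (lens E.M)[E.qi i]? = some E.jj := by
  rw [List.getElem?_eq_getElem (E.qi_lt hi), E.lens_qi hi]

/-- **The copies of the good block length are consecutive**: copy `i` starts at `O + i·j*`. [folklore] -/
theorem sum_take_qi : ∀ i, i ≤ E.M → ((lens E.M).take (E.qi i)).sum = E.O + i * E.jj
  | 0, _ => by simp [O]
  | i + 1, hi => by
    have hi' : i < E.M := hi
    rw [show E.qi (i + 1) = E.qi i + 1 by unfold qi; omega, List.sum_take_succ _ _ (E.qi_lt hi'), sum_take_qi i hi'.le,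
      E.lens_qi hi']
    ring

/-- All copies fit into the input. [folklore] -/
theorem O_add_le : E.O + E.M * E.jj ≤ E.N := by
  have h := E.sum_take_qi E.M le_rfl
  have h1 : ((lens E.M).take (E.qi E.M)).sum ≤ (lens E.M).sum := by
    conv_rhs => rw [← List.take_append_drop (E.qi E.M) (lens E.M)]
    rw [List.sum_append]; exact Nat.le_add_right _ _
  have h2 := sum_lens_le E.M
  have h3 := Mof_pow_le E.N
  unfold M at *
  omega

/-- Input bits after the last copy. [folklore] -/
def restN : ℕ := E.N - (E.O + E.M * E.jj)

/-- Decomposition of the input length around the copies. [folklore] -/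
theorem N_eq3 : E.N = E.O + (E.M * E.jj + E.restN) := by
  have := E.O_add_le; unfold restN; omega

/-- Splitting the input around the segment of copies. [folklore] -/
def splitSeg : List.Vector Bool E.N ≃ List.Vector Bool E.O × (List.Vector Bool (E.M * E.jj) × List.Vector Bool E.restN) :=
  (vecCut E.O (E.M * E.jj + E.restN) _ E.N_eq3).trans ((Equiv.refl _).prodCongr (vecCut _ _ _ rfl))

/-- The three parts, reassembled. [folklore] -/
theorem splitSeg_symm_toList (a : List.Vector Bool E.O) (seg : List.Vector Bool (E.M * E.jj)) (c : List.Vector Bool E.restN) :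
    (E.splitSeg.symm (a, (seg, c))).toList = a.toList ++ (seg.toList ++ c.toList) := rfl

/-- Copy `i` read off the segment. [folklore] -/
theorem realAt_iff_chunk (a : List.Vector Bool E.O) (seg : List.Vector Bool (E.M * E.jj)) (c : List.Vector Bool E.restN)
    {i : ℕ} (hi : i < E.M) :
    E.RealAt i (E.splitSeg.symm (a, (seg, c))) ↔ P.blockFn ((seg.toList.drop (i * E.jj)).take E.jj) ≠ [] := by
  unfold RealAt
  have hlen : (E.splitSeg.symm (a, (seg, c))).toList.length = E.N := by simp
  rw [blocks_getElem?, hlen, show Mof E.N = E.M from rfl, E.lens_getElem?_qi hi, E.sum_take_qi i hi.le, Option.map_some,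
    Option.getD_some, splitSeg_symm_toList, ← List.drop_drop, List.drop_left' (by simp), List.drop_append_of_le_length (by
      simp only [List.Vector.toList_length]; exact Nat.mul_le_mul_right _ hi.le),
    List.take_append_of_le_length (by
      simp only [List.length_drop, List.Vector.toList_length]
      have : (i + 1) * E.jj ≤ E.M * E.jj := Nat.mul_le_mul_right _ hi
      rw [Nat.add_mul, one_mul] at this
      omega)]

/-- **Independent trials**: the number of flat coin segments all of whose `m` consecutive
`ℓ`-chunks satisfy `Q` is the `m`-th power of the number of `ℓ`-strings satisfying `Q`. [folklore] -/
theorem card_chunks (ℓ : ℕ) (Q : List Bool → Prop) [DecidablePred Q] : ∀ m : ℕ,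
    (univ.filter fun seg : List.Vector Bool (m * ℓ) => ∀ i < m, Q ((seg.toList.drop (i * ℓ)).take ℓ)).card =
      (univ.filter fun u : List.Vector Bool ℓ => Q u.toList).card ^ m
  | 0 => by
    rw [pow_zero, card_eq_one]
    refine ⟨⟨[], by simp⟩, ?_⟩
    ext seg
    simp only [mem_filter, mem_univ, true_and, Nat.not_lt_zero, IsEmpty.forall_iff, implies_true, mem_singleton, true_iff]
    exact List.Vector.eq _ _ (List.length_eq_zero_iff.1 (by rw [List.Vector.toList_length, Nat.zero_mul]))
  | m + 1 => by
    rw [pow_succ, ← card_chunks ℓ Q m, ← card_product, ← filter_product, univ_product_univ]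
    refine card_equiv ((vecCut ℓ (m * ℓ) _ (by ring)).trans (Equiv.prodComm _ _)) fun seg => ?_
    simp only [mem_filter, mem_univ, true_and, Equiv.trans_apply, Equiv.prodComm_apply, Prod.fst_swap, Prod.snd_swap]
    have hseg : seg.toList = ((vecCut ℓ (m * ℓ) _ (by ring)) seg).1.toList ++ ((vecCut ℓ (m * ℓ) _ (by ring)) seg).2.toList :=
      (List.take_append_drop ℓ seg.toList).symm
    set u := ((vecCut ℓ (m * ℓ) _ (by ring)) seg).1
    set seg' := ((vecCut ℓ (m * ℓ) _ (by ring)) seg).2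
    have hu : u.toList.length = ℓ := by simp
    rw [hseg]
    constructor
    · intro h
      refine ⟨fun i hi => ?_, by simpa [List.take_left' hu] using h 0 (Nat.succ_pos m)⟩
      have := h (i + 1) (by omega)
      rwa [Nat.succ_mul, Nat.add_comm, ← List.drop_drop, List.drop_left' hu] at this
    · rintro ⟨h, h0⟩ i hi
      rcases i with _ | i
      · simpa [List.take_left' hu] using h0
      · rw [Nat.succ_mul, Nat.add_comm, ← List.drop_drop, List.drop_left' hu]
        exact h i (by omega)

/-- **All copies `⊥`, counted**: `cntAllBot = 2^O · #{u : f(u) = ⊥}^M · 2^{restN}`. [folklore] -/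
theorem cntAllBot_eq : E.cntAllBot =
    2 ^ E.O * (univ.filter fun u : List.Vector Bool E.jj => P.blockFn u.toList = []).card ^ E.M * 2 ^ E.restN := by
  unfold cntAllBot
  have hc := card_chunks E.jj (fun u => P.blockFn u = []) E.M
  rw [← hc, ← Fintype.card_bool, ← card_vector, ← card_vector, ← card_univ, ← card_univ, mul_assoc, ← card_product,
    ← card_product]
  rw [show (univ : Finset (List.Vector Bool E.O)) ×ˢ ((univ.filter fun seg : List.Vector Bool (E.M * E.jj) =>
      ∀ i < E.M, P.blockFn ((seg.toList.drop (i * E.jj)).take E.jj) = []) ×ˢ (univ : Finset (List.Vector Bool E.restN))) =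
      (univ : Finset (List.Vector Bool E.O × (List.Vector Bool (E.M * E.jj) × List.Vector Bool E.restN))).filter
        fun t => ∀ i < E.M, P.blockFn ((t.2.1.toList.drop (i * E.jj)).take E.jj) = [] by
    ext t; simp]
  refine card_equiv E.splitSeg fun x => ?_
  simp only [mem_filter, mem_univ, true_and]
  have hx : x = E.splitSeg.symm (E.splitSeg x) := by simp
  constructor
  · intro h i hi
    have := h i hi
    rw [hx, E.realAt_iff_chunk _ _ _ hi, not_not] at this
    simpa using this
  · intro h i hi
    rw [hx, E.realAt_iff_chunk _ _ _ hi, not_not]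
    simpa using h i hi

/-- **Blocks of the good length that are `⊥`, counted**: `#{u : f(u) = ⊥} = 2^{1+Tρ+pad} · (2^σ - #goodSeeds)`.
[folklore] -/
theorem card_bot_eq : (univ.filter fun u : List.Vector Bool E.jj => P.blockFn u.toList = []).card =
    2 ^ (1 + E.Tρ + E.pad) * (2 ^ E.σ - E.goodSeeds.card) := by
  have hbad : (univ.filter fun s : List.Vector Bool E.σ => ¬ (E.key s).length = E.lam).card = 2 ^ E.σ - E.goodSeeds.card := by
    rw [filter_not, card_univ_sdiff, card_vector, Fintype.card_bool]
    rfl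
  rw [card_filter, ← Fintype.sum_equiv E.parse.symm (fun t => if P.blockFn (E.parse.symm t).toList = [] then 1 else 0) _ (fun _ => rfl)]
  simp only [Fintype.sum_prod_type]
  have hval : ∀ (bv : List.Vector Bool 1) (s : List.Vector Bool E.σ) (r : List.Vector Bool E.Tρ) (u : List.Vector Bool E.pad),
      (if P.blockFn (E.parse.symm (bv, (s, (r, u)))).toList = [] then 1 else 0) = if ¬ (E.key s).length = E.lam then 1 else 0 := by
    intro bv s r u
    rw [E.blockFn_parse_symm]
    by_cases hs : (E.key s).length = E.lam
    · rw [if_pos hs, if_neg (E.realOut_ne_nil _ _ _), if_neg (not_not.2 hs)]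
    · rw [if_neg hs, if_pos rfl, if_pos hs]
  simp only [hval, sum_const, card_univ, card_vector, Fintype.card_bool, smul_eq_mul, ← mul_sum]
  rw [← card_filter, hbad]
  ring

/-- `#goodSeeds ≤ 2^σ`. [folklore] -/
theorem card_goodSeeds_le : E.goodSeeds.card ≤ 2 ^ E.σ := by
  unfold goodSeeds
  refine (card_filter_le _ _).trans ?_
  rw [card_univ, card_vector, Fintype.card_bool]

/-- **Probability that all copies are `⊥`**: `cntAllBot / 2^N = (1 - #goodSeeds / 2^σ)^M`. [folklore] -/
theorem cntAllBot_div : (E.cntAllBot : ℝ) / 2 ^ E.N = (1 - (E.goodSeeds.card : ℝ) / 2 ^ E.σ) ^ E.M := by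
  have hg := E.card_goodSeeds_le
  have hjj : E.jj = 1 + E.σ + E.Tρ + E.pad := E.jj_eq
  rw [E.cntAllBot_eq, E.card_bot_eq]
  push_cast [Nat.cast_sub hg]
  set C : ℝ := 2 ^ (1 + E.Tρ + E.pad) * (2 ^ E.σ - (E.goodSeeds.card : ℝ)) with hC
  rw [show (2 : ℝ) ^ E.N = (2 ^ E.jj) ^ E.M * (2 ^ E.O * 2 ^ E.restN) by
      rw [← pow_mul, ← pow_add, ← pow_add]; congr 1; rw [E.N_eq3]; ring,
    show (2 : ℝ) ^ E.O * C ^ E.M * 2 ^ E.restN = C ^ E.M * (2 ^ E.O * 2 ^ E.restN) by ring,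
    mul_div_mul_right _ _ (by positivity), ← div_pow]
  congr 1
  rw [hC, hjj, show (2 : ℝ) ^ (1 + E.σ + E.Tρ + E.pad) = 2 ^ (1 + E.Tρ + E.pad) * 2 ^ E.σ by ring,
    mul_div_mul_left _ _ (by positivity), sub_div, div_self (by positivity)]

end Setup

end

end SKEOWF

end Literature.Computability.Cryptography


/-!
# Private-key encryption ⇒ one-way functions, V: the advantage at one security parameter

Fifth file of the discharge of `OWFExist_of_secureSKEExist` (Impagliazzo–Luby 1989, Thm. 1); see
`SchemesOWF.lean`, Part I (architecture). At a fixed `Setup` and for any randomized algorithm `D`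
that *behaves like the distinguisher's core on game inputs* (`Setup.DSim`: right coin count, and
`run = Dcore` on every challenge that can occur in the multiple-message game at parameter `n`),
this file integrates the per-challenge bounds of `SchemesOWF.lean`, Part III against the key and
ciphertext distributions and combines them with the simulation inequality of
`SchemesOWF.lean`, Part IV into the advantage bound

`Setup.adv_ge`: `acc(M₁) - acc(M₀) ≥ (Pr[A inverts F on U_N] - (1 - π)^M) / M - 2·2^{-(n+1)}`,

`π = #{s : |G(1ⁿ; s)| = λ} / 2^σ`, provided the challenge copy `i₀` maximises the count of
inversions with a real copy (`hmax`, arranged when the advice is chosen in `SchemesOWF.lean`, Part VI).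

## References

* R. Impagliazzo, M. Luby, *One-way functions are essential for complexity based cryptography*,
  FOCS 1989, Thm. 1.
* O. Goldreich, *Foundations of Cryptography I*, CUP 2001, §3.8 Exercise 11, proof of Prop. 3.3.8;
  *Foundations of Cryptography II*, CUP 2004, §5.5 Exercise 2.
-/

namespace Literature.Computability.Cryptography

open _root_.Computability Complexity Polynomial Finset
open scoped ENNReal Classical

namespace SKEOWF

noncomputable section

/-- Vectors of provably equal lengths. [folklore] -/
def vecCast {a b : ℕ} (h : a = b) : List.Vector Bool a ≃ List.Vector Bool b where
  toFun v := ⟨v.toList, by rw [v.toList_length, h]⟩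
  invFun v := ⟨v.toList, by rw [v.toList_length, h]⟩
  left_inv v := List.Vector.eq _ _ rfl
  right_inv v := List.Vector.eq _ _ rfl

/-- The acceptance mass of a Boolean randomized algorithm as a count of coin strings (with the coin
count named). [Arora–Barak 2009, §7.1] [folklore] -/
theorem outputPMF_true_eq_card (D : RandAlg (List Bool) Bool) (x : List Bool) {cl : ℕ} (hk : D.coinLen (id x).length = cl) :
    D.outputPMF id x true = ((univ.filter fun r : List.Vector Bool cl => D.run x r.toList = true).card : ℝ≥0∞) / 2 ^ cl := by
  subst hk
  unfold RandAlg.outputPMF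
  rw [PMF.map_apply, tsum_fintype, ENNReal.div_eq_inv_mul, card_filter, Nat.cast_sum, Finset.mul_sum]
  refine sum_congr rfl fun r _ => ?_
  rw [PMF.uniformOfFintype_apply, card_vector, Fintype.card_bool]
  by_cases h : D.run x r.toList = true
  · rw [if_pos h.symm, if_pos h]; simp
  · rw [if_neg (Ne.symm h), if_neg h]; simp

/-- Agreement on supports transfers through the key/ciphertext double expectation. [folklore] -/
theorem tsum_keyct_congr (S : SKEScheme) (n : ℕ) (ms : List (List Bool)) (f g : List Bool → List (List Bool) → ℝ≥0∞)
    (h : ∀ k cs, k ∈ (S.keyPMF n).support → cs ∈ (S.ctVecPMF k ms).support → f k cs = g k cs) :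
    ∑' k, S.keyPMF n k * ∑' cs, S.ctVecPMF k ms cs * f k cs = ∑' k, S.keyPMF n k * ∑' cs, S.ctVecPMF k ms cs * g k cs := by
  refine tsum_congr fun k => ?_
  by_cases hk : S.keyPMF n k = 0
  · rw [hk, zero_mul, zero_mul]
  · congr 1
    refine tsum_congr fun cs => ?_
    by_cases hcs : S.ctVecPMF k ms cs = 0
    · rw [hcs, zero_mul, zero_mul]
    · rw [h k cs ((PMF.mem_support_iff _ _).2 hk) ((PMF.mem_support_iff _ _).2 hcs)]

namespace Setup

variable {P : Params} {sf : Polynomial ℕ} {A : RandAlg (List Bool) (List Bool)} (E : Setup P sf A)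

/-- Challenges that occur in the multiple-message game at parameter `n` (either world). [folklore] -/
def InGame (cs : List (List Bool)) : Prop :=
  ∃ (b : Bool) (k : List Bool), k ∈ (P.S.keyPMF E.n).support ∧ cs ∈ (P.S.ctVecPMF k (P.msgs b E.n)).support

/-- **`D` behaves like the core on game inputs**: with `N + κ + (1 + rest)` coins, and `run = Dcore`.
[folklore] -/
structure DSim (D : RandAlg (List Bool) Bool) (rest : ℕ) : Prop where
  /-- the coin count on game inputs [folklore] -/
  hcl : ∀ cs, E.InGame cs → D.coinLen (boolPair (unaryEncodeNat E.n) ((encodingList Bool).listBool.encode cs)).length = E.N + E.κ + (1 + rest)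
  /-- the behaviour on game inputs [folklore] -/
  hrun : ∀ cs r, E.InGame cs → r.length = E.N + E.κ + (1 + rest) →
    D.run (boolPair (unaryEncodeNat E.n) ((encodingList Bool).listBool.encode cs)) r = E.Dcore ((encodingList Bool).listBool.encode cs) r

variable {E} in
/-- On game inputs, `D` accepts with the core's probability `Dacc`. [folklore] -/
theorem DSim.outputPMF_true {D : RandAlg (List Bool) Bool} {rest : ℕ} (hD : E.DSim D rest) {cs : List (List Bool)} (hcs : E.InGame cs) :
    D.outputPMF id (boolPair (unaryEncodeNat E.n) ((encodingList Bool).listBool.encode cs)) true =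
      E.Dacc rest ((encodingList Bool).listBool.encode cs) := by
  rw [outputPMF_true_eq_card D (boolPair (unaryEncodeNat E.n) ((encodingList Bool).listBool.encode cs)) (by exact hD.hcl cs hcs)]
  unfold Dacc Dnum
  congr 3
  refine filter_congr fun r _ => ?_
  rw [hD.hrun cs r.toList hcs (by simp)]

/-! ### The three averaged quantities -/

/-- The acceptance probability of `D` in world `b`. [Goldreich 2004, Def. 5.2.9] [cite: Goldreich2004, Def. 5.2.9] -/
def Acc (D : RandAlg (List Bool) Bool) (b : Bool) : ℝ≥0∞ := acceptPMF D E.n (P.S.encVecPMF E.n (P.msgs b E.n)) true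

/-- The averaged half explanation fraction `E[½·#{V}/2^{N+κ}]` in world `b`. [folklore] -/
def EVh (rest : ℕ) (b : Bool) : ℝ≥0∞ :=
  ∑' k, P.S.keyPMF E.n k * ∑' cs, P.S.ctVecPMF k (P.msgs b E.n) cs * E.Vh rest ((encodingList Bool).listBool.encode cs)

/-- The probability of a bad challenge in world `b`. [folklore] -/
def PBad (b : Bool) : ℝ≥0∞ := ∑' k, P.S.keyPMF E.n k * (P.S.ctVecPMF k (P.msgs b E.n)).toOuterMeasure (E.Bad b)

/-- `PBad` as a double expectation of the indicator. [folklore] -/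
theorem PBad_eq (b : Bool) : E.PBad b =
    ∑' k, P.S.keyPMF E.n k * ∑' cs, P.S.ctVecPMF k (P.msgs b E.n) cs * (E.Bad b).indicator 1 cs := by
  unfold PBad
  refine tsum_congr fun k => ?_
  rw [PMF.toOuterMeasure_apply]
  refine congrArg (P.S.keyPMF E.n k * ·) ?_
  exact tsum_congr fun cs => by by_cases h : cs ∈ E.Bad b <;> simp [h]

/-- **Bad challenges are rare, on average.** [folklore] -/
theorem PBad_le (b : Bool) : E.PBad b ≤ 2⁻¹ ^ (E.n + 1) := by
  unfold PBad
  calc _ ≤ ∑' k, P.S.keyPMF E.n k * 2⁻¹ ^ (E.n + 1) :=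
        ENNReal.tsum_le_tsum fun k => mul_le_mul' le_rfl (E.toOuterMeasure_Bad_le k b)
    _ = 2⁻¹ ^ (E.n + 1) := by rw [ENNReal.tsum_mul_right, PMF.tsum_coe, one_mul]

variable {E} in
/-- `Acc` through `Dacc`. [folklore] -/
theorem DSim.Acc_eq {D : RandAlg (List Bool) Bool} {rest : ℕ} (hD : E.DSim D rest) (b : Bool) :
    E.Acc D b = ∑' k, P.S.keyPMF E.n k * ∑' cs, P.S.ctVecPMF k (P.msgs b E.n) cs * E.Dacc rest ((encodingList Bool).listBool.encode cs) := by
  unfold Acc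
  rw [acceptPMF_encVecPMF_apply]
  exact tsum_keyct_congr P.S E.n _ _ _ fun k cs hk hcs => hD.outputPMF_true ⟨b, k, hk, hcs⟩

/-- A constant integrates to itself against the ciphertext distribution. [folklore] -/
theorem tsum_ctVec_const (k : List Bool) (b : Bool) (c : ℝ≥0∞) : ∑' cs, P.S.ctVecPMF k (P.msgs b E.n) cs * c = c := by
  rw [ENNReal.tsum_mul_right, PMF.tsum_coe, one_mul]

/-- A constant integrates to itself against the key distribution. [folklore] -/
theorem tsum_key_const (c : ℝ≥0∞) : ∑' k, P.S.keyPMF E.n k * c = c := by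
  rw [ENNReal.tsum_mul_right, PMF.tsum_coe, one_mul]

variable {E} in
/-- **World `1`, averaged**: `½ + EVh₁ ≤ Acc₁ + PBad₁`. [Goldreich 2001, proof of Prop. 3.3.8] [folklore] -/
theorem DSim.true_ge (hC : P.S.IsCorrect) {D : RandAlg (List Bool) Bool} {rest : ℕ} (hD : E.DSim D rest) :
    2⁻¹ + E.EVh rest true ≤ E.Acc D true + E.PBad true := by
  rw [hD.Acc_eq, PBad_eq, EVh, ← ENNReal.tsum_add]
  calc 2⁻¹ + ∑' k, P.S.keyPMF E.n k * ∑' cs, P.S.ctVecPMF k (P.msgs true E.n) cs * E.Vh rest ((encodingList Bool).listBool.encode cs)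
      = ∑' k, P.S.keyPMF E.n k * ∑' cs, P.S.ctVecPMF k (P.msgs true E.n) cs *
          (2⁻¹ + E.Vh rest ((encodingList Bool).listBool.encode cs)) := by
        conv_lhs => rw [← E.tsum_key_const 2⁻¹, ← ENNReal.tsum_add]
        refine tsum_congr fun k => ?_
        rw [← mul_add]
        congr 1
        conv_lhs => rw [← E.tsum_ctVec_const k true 2⁻¹, ← ENNReal.tsum_add]
        refine tsum_congr fun cs => ?_
        rw [mul_add]
    _ ≤ ∑' k, P.S.keyPMF E.n k * ∑' cs, P.S.ctVecPMF k (P.msgs true E.n) cs *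
          (E.Dacc rest ((encodingList Bool).listBool.encode cs) + (E.Bad true).indicator 1 cs) :=
        ENNReal.tsum_le_tsum fun k => mul_le_mul' le_rfl (ENNReal.tsum_le_tsum fun cs =>
          mul_le_mul' le_rfl (E.Dacc_true_ge hC rest cs))
    _ = _ := by
        refine tsum_congr fun k => ?_
        rw [← mul_add, ← ENNReal.tsum_add]
        congr 1
        refine tsum_congr fun cs => ?_
        rw [mul_add]

variable {E} in
/-- **World `0`, averaged**: `Acc₀ + EVh₀ ≤ ½ + PBad₀`. [Goldreich 2001, proof of Prop. 3.3.8] [folklore] -/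
theorem DSim.false_le (hC : P.S.IsCorrect) {D : RandAlg (List Bool) Bool} {rest : ℕ} (hD : E.DSim D rest) :
    E.Acc D false + E.EVh rest false ≤ 2⁻¹ + E.PBad false := by
  rw [hD.Acc_eq, PBad_eq, EVh, ← ENNReal.tsum_add]
  calc ∑' k, (P.S.keyPMF E.n k * ∑' cs, P.S.ctVecPMF k (P.msgs false E.n) cs * E.Dacc rest ((encodingList Bool).listBool.encode cs) +
        P.S.keyPMF E.n k * ∑' cs, P.S.ctVecPMF k (P.msgs false E.n) cs * E.Vh rest ((encodingList Bool).listBool.encode cs))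
      = ∑' k, P.S.keyPMF E.n k * ∑' cs, P.S.ctVecPMF k (P.msgs false E.n) cs *
          (E.Dacc rest ((encodingList Bool).listBool.encode cs) + E.Vh rest ((encodingList Bool).listBool.encode cs)) := by
        refine tsum_congr fun k => ?_
        rw [← mul_add, ← ENNReal.tsum_add]
        congr 1
        refine tsum_congr fun cs => ?_
        rw [mul_add]
    _ ≤ ∑' k, P.S.keyPMF E.n k * ∑' cs, P.S.ctVecPMF k (P.msgs false E.n) cs * (2⁻¹ + (E.Bad false).indicator 1 cs) :=
        ENNReal.tsum_le_tsum fun k => mul_le_mul' le_rfl (ENNReal.tsum_le_tsum fun cs =>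
          mul_le_mul' le_rfl (E.Dacc_false_le hC rest cs))
    _ = 2⁻¹ + ∑' k, P.S.keyPMF E.n k * ∑' cs, P.S.ctVecPMF k (P.msgs false E.n) cs * (E.Bad false).indicator 1 cs := by
        conv_rhs => rw [← E.tsum_key_const 2⁻¹, ← ENNReal.tsum_add]
        refine tsum_congr fun k => ?_
        rw [← mul_add]
        congr 1
        conv_rhs => rw [← E.tsum_ctVec_const k false 2⁻¹, ← ENNReal.tsum_add]
        refine tsum_congr fun cs => ?_
        rw [mul_add]

/-! ### The averaged explanation fraction dominates the simulated quantity -/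

/-- The scheme's coin count on `⟨key, message⟩` for a good seed. [folklore] -/
theorem coinLen_good {s : List.Vector Bool E.σ} (hs : s ∈ E.goodSeeds) {b : Bool} (m : List Bool) (hm : m ∈ P.msgs b E.n) :
    P.S.enc.coinLen (boolPair (P.S.keyGen.run E.n s.toList) m).length = E.ρ := by
  rw [length_boolPair, P.length_of_mem_msgs hm, show (P.S.keyGen.run E.n s.toList).length = E.lam from (E.mem_goodSeeds).1 hs, E.hρ]

/-- The sum of explanation counts over good seeds and encryption coins, in world `b`. [folklore] -/
def Sgood (b : Bool) : ℕ := ∑ s ∈ E.goodSeeds, ∑ r : List.Vector Bool E.Tρ, E.Vcount (E.realOut b s r)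

/-- **Lower bound for the averaged explanation fraction**:
`EVh_b ≥ 2^{rest+j*} · Sgood_b / (2^σ · 2^{Tρ} · 2^{N+κ+1+rest})` (keep only keys grown from good
seeds; under such a key the ciphertext vector is `encVec` of uniform coins, and
`#{V} = 2^{j*} · Vcount`). [folklore] -/
theorem EVh_ge (rest : ℕ) (b : Bool) :
    ((2 ^ (rest + E.jj) * E.Sgood b : ℕ) : ℝ≥0∞) / (2 ^ E.σ * 2 ^ E.Tρ * 2 ^ (E.N + E.κ + (1 + rest))) ≤ E.EVh rest b := by
  unfold EVh
  rw [P.S.keyPMF_eq_map E.hσ, pmf_tsum_map_mul, tsum_uniformVector_mul]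
  -- keep the good seeds
  have hsub : ∑ s ∈ E.goodSeeds, ∑' cs, P.S.ctVecPMF (P.S.keyGen.run E.n (List.Vector.toList s)) (P.msgs b E.n) cs * E.Vh rest ((encodingList Bool).listBool.encode cs) ≤
      ∑ s, ∑' cs, P.S.ctVecPMF (P.S.keyGen.run E.n (List.Vector.toList s)) (P.msgs b E.n) cs * E.Vh rest ((encodingList Bool).listBool.encode cs) :=
    sum_le_sum_of_subset (subset_univ _)
  refine le_trans ?_ (ENNReal.div_le_div_right hsub _)
  -- evaluate the good terms
  have hgood : ∀ s : List.Vector Bool E.σ, s ∈ E.goodSeeds → ∑' cs, P.S.ctVecPMF (P.S.keyGen.run E.n (List.Vector.toList s)) (P.msgs b E.n) cs * E.Vh rest ((encodingList Bool).listBool.encode cs) =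
      (∑ r : List.Vector Bool E.Tρ, (((2 ^ rest * (2 ^ E.jj * E.Vcount (E.realOut b s r)) : ℕ) : ℝ≥0∞) / 2 ^ (E.N + E.κ + (1 + rest)))) / 2 ^ E.Tρ := by
    intro s hs
    rw [P.S.tsum_ctVecPMF_mul _ E.ρ _ (fun m hm => E.coinLen_good hs m hm), P.length_msgs,
      ← Fintype.sum_equiv (vecCast (show E.Tρ = P.T E.n * E.ρ from rfl)) _ _ (fun _ => rfl)]
    simp only [Vh, E.cntV_eq]
    rfl
  rw [sum_congr rfl hgood]
  -- algebra: everything is a constant multiple of `Sgood`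
  refine le_of_eq ?_
  rw [Sgood]
  simp only [ENNReal.div_eq_inv_mul, Nat.cast_mul, Nat.cast_sum, Nat.cast_pow, Nat.cast_ofNat, Finset.mul_sum]
  refine sum_congr rfl fun s _ => sum_congr rfl fun r _ => ?_
  rw [ENNReal.mul_inv (Or.inr (by simp)) (Or.inr (by simp)), ENNReal.mul_inv (Or.inr (by simp)) (Or.inr (by simp)), pow_add]
  ring

/-! ### The advantage bound -/

/-- `EVh ≤ 1`. [folklore] -/
theorem EVh_le_one (rest : ℕ) (b : Bool) : E.EVh rest b ≤ 1 := by
  have hVh : ∀ v, E.Vh rest v ≤ 1 := by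
    intro v
    unfold Vh
    rw [ENNReal.div_le_iff (by simp) (by simp), one_mul]
    have h1 := E.cntV_le v
    have : 2 ^ rest * E.cntV v ≤ 2 ^ (E.N + E.κ + (1 + rest)) := by
      calc 2 ^ rest * E.cntV v ≤ 2 ^ rest * 2 ^ (E.N + E.κ) := Nat.mul_le_mul_left _ h1
        _ ≤ 2 ^ rest * 2 ^ (E.N + E.κ) * 2 := Nat.le_mul_of_pos_right _ (by norm_num)
        _ = 2 ^ (E.N + E.κ + (1 + rest)) := by ring
    exact_mod_cast this
  unfold EVh
  calc _ ≤ ∑' k, P.S.keyPMF E.n k * ∑' cs, P.S.ctVecPMF k (P.msgs b E.n) cs * 1 :=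
        ENNReal.tsum_le_tsum fun k => mul_le_mul' le_rfl (ENNReal.tsum_le_tsum fun cs => mul_le_mul' le_rfl (hVh _))
    _ = 1 := by simp only [E.tsum_ctVec_const, E.tsum_key_const]

/-- `Acc ≤ 1`. [folklore] -/
theorem Acc_le_one (D : RandAlg (List Bool) Bool) (b : Bool) : E.Acc D b ≤ 1 := PMF.coe_le_one _ _

/-- `PBad ≤ 1`. [folklore] -/
theorem PBad_le_one (b : Bool) : E.PBad b ≤ 1 :=
  (E.PBad_le b).trans (pow_le_one' (by norm_num) _)

/-- The `F`-side count in real form: `Pr[A inverts] ≤ M · cntIR(i₀)/2^{N+κ} + (1 - π)^M`. [folklore] -/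
theorem invertProb_le (hsf : ∀ u, (P.blockFn u).length ≤ sf.eval u.length) (hmax : ∀ i < E.M, E.cntIR i ≤ E.cntIR E.i₀) :
    invertProb (P.F sf) A E.N ≤ E.M * ((E.cntIR E.i₀ : ℝ) / 2 ^ (E.N + E.κ)) + (1 - (E.goodSeeds.card : ℝ) / 2 ^ E.σ) ^ E.M := by
  rw [E.invertProb_eq hsf, ← E.cntAllBot_div]
  have h1 := E.cntInv_le
  have h2 : ∑ i ∈ range E.M, E.cntIR i ≤ E.M * E.cntIR E.i₀ :=
    (sum_le_sum fun i hi => hmax i (mem_range.1 hi)).trans (by rw [sum_const, card_range, smul_eq_mul])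
  have h3 : (E.cntInv : ℝ) ≤ E.M * E.cntIR E.i₀ + 2 ^ E.κ * E.cntAllBot := by exact_mod_cast h1.trans (Nat.add_le_add_right h2 _)
  calc (E.cntInv : ℝ) / 2 ^ (E.N + E.κ) ≤ (E.M * E.cntIR E.i₀ + 2 ^ E.κ * E.cntAllBot) / 2 ^ (E.N + E.κ) :=
        div_le_div_of_nonneg_right h3 (by positivity)
    _ = _ := by rw [pow_add]; field_simp

/-- The `D`-side bound in real form: `M·cntIR(i₀)/2^{N+κ} ≤ M·(EVh₀ + EVh₁)` via the simulation
inequality and `EVh_ge` (`2^{rest+j*}/(2^σ 2^{Tρ} 2^{cl}) = 2^{pad}/2^{N+κ}`). [folklore] -/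
theorem cntIR_div_le (rest : ℕ) :
    (E.cntIR E.i₀ : ℝ) / 2 ^ (E.N + E.κ) ≤ (E.EVh rest false).toReal + (E.EVh rest true).toReal := by
  have hS := E.cntIR_le
  have hfin : ∀ b, E.EVh rest b ≠ ⊤ := fun b => ne_top_of_le_ne_top ENNReal.one_ne_top (E.EVh_le_one rest b)
  have hge : ∀ b : Bool, (2 : ℝ) ^ E.pad * E.Sgood b / 2 ^ (E.N + E.κ) ≤ (E.EVh rest b).toReal := by
    intro b
    have h := E.EVh_ge rest b
    have h' := (ENNReal.toReal_le_toReal (ENNReal.div_ne_top (ENNReal.natCast_ne_top _) (by simp)) (hfin b)).2 h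
    refine le_trans (le_of_eq ?_) h'
    rw [ENNReal.toReal_div]
    simp only [ENNReal.toReal_mul, ENNReal.toReal_pow, ENNReal.toReal_ofNat, ENNReal.toReal_natCast, Nat.cast_mul, Nat.cast_pow,
      Nat.cast_ofNat]
    rw [E.jj_eq, Tρ]
    field_simp
    ring
  have hsum : E.Sgood false + E.Sgood true = ∑ b : Bool, E.Sgood b := by rw [Fintype.sum_bool, add_comm]
  calc (E.cntIR E.i₀ : ℝ) / 2 ^ (E.N + E.κ) ≤ (2 ^ E.pad * (E.Sgood false + E.Sgood true) : ℕ) / 2 ^ (E.N + E.κ) := by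
        refine div_le_div_of_nonneg_right ?_ (by positivity)
        rw [hsum]; exact_mod_cast hS
    _ = 2 ^ E.pad * E.Sgood false / 2 ^ (E.N + E.κ) + 2 ^ E.pad * E.Sgood true / 2 ^ (E.N + E.κ) := by
        push_cast; ring
    _ ≤ _ := add_le_add (hge false) (hge true)

/-- **The advantage bound at one security parameter.** If `D` behaves like the core on game inputs
and the challenge copy maximises the real-copy inversion count, then
`acc(M₁) - acc(M₀) ≥ (Pr[A inverts F on U_N] - (1 - π)^M)/M - 2·2^{-(n+1)}`.
[Goldreich 2001, §3.8 Exercise 11 with the proof of Prop. 3.3.8; Goldreich 2004, §5.5 Exercise 2]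
[cite: Goldreich2004, §5.5 Exercise 2 (guideline)] -/
theorem adv_ge (hC : P.S.IsCorrect) (hsf : ∀ u, (P.blockFn u).length ≤ sf.eval u.length)
    (hmax : ∀ i < E.M, E.cntIR i ≤ E.cntIR E.i₀) {D : RandAlg (List Bool) Bool} {rest : ℕ} (hD : E.DSim D rest) :
    (invertProb (P.F sf) A E.N - (1 - (E.goodSeeds.card : ℝ) / 2 ^ E.σ) ^ E.M) / E.M - 2 * (2⁻¹ : ℝ) ^ (E.n + 1) ≤
      (E.Acc D true).toReal - (E.Acc D false).toReal := by
  have hM : (0 : ℝ) < E.M := by have := E.hi₀; unfold M; exact_mod_cast (show 0 < Mof E.N by omega)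
  have hI := E.invertProb_le hsf hmax
  have hV := E.cntIR_div_le rest
  have hEfin : ∀ b, E.EVh rest b ≠ ⊤ := fun b => ne_top_of_le_ne_top ENNReal.one_ne_top (E.EVh_le_one rest b)
  have hAfin : ∀ b, E.Acc D b ≠ ⊤ := fun b => ne_top_of_le_ne_top ENNReal.one_ne_top (E.Acc_le_one D b)
  have hPfin : ∀ b, E.PBad b ≠ ⊤ := fun b => ne_top_of_le_ne_top ENNReal.one_ne_top (E.PBad_le_one b)
  -- the two averaged world bounds, in `ℝ`
  have h1 : (2⁻¹ : ℝ) + (E.EVh rest true).toReal ≤ (E.Acc D true).toReal + (E.PBad true).toReal := by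
    have := (ENNReal.toReal_le_toReal (by simp [hEfin]) (by simp [hAfin, hPfin])).2 (hD.true_ge hC)
    simpa [ENNReal.toReal_add, hEfin, hAfin, hPfin] using this
  have h0 : (E.Acc D false).toReal + (E.EVh rest false).toReal ≤ 2⁻¹ + (E.PBad false).toReal := by
    have := (ENNReal.toReal_le_toReal (by simp [hEfin, hAfin]) (by simp [hPfin])).2 (hD.false_le hC)
    simpa [ENNReal.toReal_add, hEfin, hAfin, hPfin] using this
  have hP : ∀ b, (E.PBad b).toReal ≤ (2⁻¹ : ℝ) ^ (E.n + 1) := fun b => by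
    have := (ENNReal.toReal_le_toReal (hPfin b) (by simp)).2 (E.PBad_le b)
    simpa using this
  have hP0 := hP false
  have hP1 := hP true
  -- `EVh₀ + EVh₁ ≥ (ε - (1 - π)^M)/M`
  have hE : (invertProb (P.F sf) A E.N - (1 - (E.goodSeeds.card : ℝ) / 2 ^ E.σ) ^ E.M) / E.M ≤
      (E.EVh rest false).toReal + (E.EVh rest true).toReal := by
    rw [div_le_iff₀ hM]
    nlinarith
  linarith

end Setup

end

end SKEOWF

end Literature.Computability.Cryptography


/-!
# Private-key encryption ⇒ one-way functions, VI: the candidate is one-way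

Sixth file of the discharge of `OWFExist_of_secureSKEExist` (Impagliazzo–Luby 1989, Thm. 1); see
`SchemesOWF.lean`, Part I (architecture). Here the per-parameter advantage bound `Setup.adv_ge`
(`SchemesOWF.lean`, Part V) is turned into the theorem `isOneWay_F`: if the scheme is correct and
has indistinguishable multiple encryptions, then the candidate `F` of `SchemesOWF.lean`, Part II is a
(strong) one-way function — *given* the two machine facts that `F` is polynomial-time and that the
distinguisher's run function `Drun` is polynomial-time (discharged with the `FP` toolkit in
`SchemesOWFProgram.lean`, Part VII, `SchemesOWFProgram.lean`, Part IX).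

The bookkeeping is the tree's standard "contrapositive along a sparse set of security parameters"
(cf. `EncryptionSchemesProofs.lean`, `YaoAmplification.lean`): a PPT inverter `A` with
`Pr[A inverts F on U_N] ≥ 1/N^c` for infinitely many `N` yields infinitely many analysis
parameters `n = nOfN N`; along a sparse infinite set `T` of them the distinguisher
`D = ⟨Drun, cl⟩` carries the advice `(N, q, off, j*, κ)` in its (non-computable, polynomially
bounded) coin count `cl` (`adviceCode`, `Drun_boolPair`), behaves like the core on game inputs
(`DSim`), and therefore has advantage `≥ (1/N^c - e^{-n})/M - 2^{-n} ≥ 1/n^k` at every `n ∈ T`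
(`Setup.adv_ge`, `(1 - π)^M ≤ e^{-n}` by the most likely key length, polynomial size of `N`, `M`
in `n`), contradicting `HasIndMultipleEncryptions` for the plaintext vectors `M₀ = msgs 0`,
`M₁ = msgs 1` (`isPolyLengthVec_msgs`).

## References

* R. Impagliazzo, M. Luby, *One-way functions are essential for complexity based cryptography*,
  FOCS 1989, Thm. 1.
* O. Goldreich, *Foundations of Cryptography I*, CUP 2001, §3.8 Exercise 11, Prop. 3.3.8, §2.3.1;
  *Foundations of Cryptography II*, CUP 2004, §5.5 Exercise 2, Def. 5.2.9.
-/

namespace Literature.Computability.Cryptography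

open Filter Asymptotics _root_.Computability Complexity Polynomial Finset
open scoped ENNReal Classical

namespace SKEOWF

noncomputable section

/-! ### Advice decoding and the run function of the distinguisher -/

/-- The advice `(N, q, off, j*, κ)` packed in base `b`. [folklore] -/
def adviceCode (b N q off jj κ : ℕ) : ℕ := N + b * q + b ^ 2 * off + b ^ 3 * jj + b ^ 4 * κ

section Digits

variable {b N q off jj κ : ℕ}

/-- The advice code has five digits. [folklore] -/
theorem adviceCode_lt (hN : N < b) (hq : q < b) (hoff : off < b) (hjj : jj < b) (hκ : κ < b) :
    adviceCode b N q off jj κ < b ^ 5 := by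
  have hb : 1 ≤ b := by omega
  unfold adviceCode
  have h1 : b * q ≤ b * (b - 1) := Nat.mul_le_mul_left _ (by omega)
  have h2 : b ^ 2 * off ≤ b ^ 2 * (b - 1) := Nat.mul_le_mul_left _ (by omega)
  have h3 : b ^ 3 * jj ≤ b ^ 3 * (b - 1) := Nat.mul_le_mul_left _ (by omega)
  have h4 : b ^ 4 * κ ≤ b ^ 4 * (b - 1) := Nat.mul_le_mul_left _ (by omega)
  have e : b ^ 5 = b ^ 4 * (b - 1) + b ^ 3 * (b - 1) + b ^ 2 * (b - 1) + b * (b - 1) + (b - 1) + 1 := by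
    cases hb' : b with
    | zero => omega
    | succ d => simp [pow_succ]; ring
  omega

/-- Nested form of the code. [folklore] -/
theorem adviceCode_eq : adviceCode b N q off jj κ = N + b * (q + b * (off + b * (jj + b * κ))) := by
  unfold adviceCode; ring

/-- Digit `0`. [folklore] -/
theorem adviceCode_d0 (hN : N < b) : adviceCode b N q off jj κ % b = N := by
  rw [adviceCode_eq, Nat.add_mul_mod_self_left, Nat.mod_eq_of_lt hN]

/-- Digit `1`. [folklore] -/
theorem adviceCode_d1 (hN : N < b) (hq : q < b) : adviceCode b N q off jj κ / b % b = q := by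
  rw [adviceCode_eq, Nat.add_mul_div_left _ _ (by omega), Nat.div_eq_of_lt hN, zero_add,
    Nat.add_mul_mod_self_left, Nat.mod_eq_of_lt hq]

/-- Digit `2`. [folklore] -/
theorem adviceCode_d2 (hN : N < b) (hq : q < b) (hoff : off < b) : adviceCode b N q off jj κ / b ^ 2 % b = off := by
  rw [pow_two, ← Nat.div_div_eq_div_mul, adviceCode_eq, Nat.add_mul_div_left _ _ (by omega),
    Nat.div_eq_of_lt hN, zero_add, Nat.add_mul_div_left _ _ (by omega), Nat.div_eq_of_lt hq, zero_add,
    Nat.add_mul_mod_self_left, Nat.mod_eq_of_lt hoff]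

/-- Digit `3`. [folklore] -/
theorem adviceCode_d3 (hN : N < b) (hq : q < b) (hoff : off < b) (hjj : jj < b) : adviceCode b N q off jj κ / b ^ 3 % b = jj := by
  rw [show b ^ 3 = b * b * b by ring, ← Nat.div_div_eq_div_mul, ← Nat.div_div_eq_div_mul, adviceCode_eq,
    Nat.add_mul_div_left _ _ (by omega), Nat.div_eq_of_lt hN, zero_add, Nat.add_mul_div_left _ _ (by omega),
    Nat.div_eq_of_lt hq, zero_add, Nat.add_mul_div_left _ _ (by omega), Nat.div_eq_of_lt hoff, zero_add,
    Nat.add_mul_mod_self_left, Nat.mod_eq_of_lt hjj]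

/-- Digit `4` (the leading one). [folklore] -/
theorem adviceCode_d4 (hN : N < b) (hq : q < b) (hoff : off < b) (hjj : jj < b) : adviceCode b N q off jj κ / b ^ 4 = κ := by
  rw [show b ^ 4 = b * b * b * b by ring, ← Nat.div_div_eq_div_mul, ← Nat.div_div_eq_div_mul, ← Nat.div_div_eq_div_mul,
    adviceCode_eq,
    Nat.add_mul_div_left _ _ (by omega), Nat.div_eq_of_lt hN, zero_add, Nat.add_mul_div_left _ _ (by omega),
    Nat.div_eq_of_lt hq, zero_add, Nat.add_mul_div_left _ _ (by omega), Nat.div_eq_of_lt hoff, zero_add,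
    Nat.add_mul_div_left _ _ (by omega), Nat.div_eq_of_lt hjj, zero_add]

end Digits

/-- **The distinguisher's run function**: read `n = |u|` off the input `⟨u, v⟩`, decode the advice
from the coin count `|r| = Bd(n)^6 + code`, and run the core (`DcoreRaw`) with it.
[Goldreich 2001, §3.8 Exercise 11 (the distinguisher); Yao-style advice in the coin budget as in
`YaoAmplification.lean`] [folklore] -/
def Drun (P : Params) (sf : Polynomial ℕ) (A : RandAlg (List Bool) (List Bool)) (Bd : Polynomial ℕ) (x r : List Bool) : Bool :=
  DcoreRaw P sf A
    ((r.length - Bd.eval (boolUnpair x).1.length ^ 6) % Bd.eval (boolUnpair x).1.length)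
    ((r.length - Bd.eval (boolUnpair x).1.length ^ 6) / Bd.eval (boolUnpair x).1.length % Bd.eval (boolUnpair x).1.length)
    ((r.length - Bd.eval (boolUnpair x).1.length ^ 6) / Bd.eval (boolUnpair x).1.length ^ 2 % Bd.eval (boolUnpair x).1.length)
    ((r.length - Bd.eval (boolUnpair x).1.length ^ 6) / Bd.eval (boolUnpair x).1.length ^ 3 % Bd.eval (boolUnpair x).1.length)
    ((r.length - Bd.eval (boolUnpair x).1.length ^ 6) / Bd.eval (boolUnpair x).1.length ^ 4)
    (boolUnpair x).2 r

/-- **With the right number of coins, `Drun` is the core at the advised numbers.** [folklore] -/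
theorem Drun_boolPair {P : Params} {sf : Polynomial ℕ} {A : RandAlg (List Bool) (List Bool)} (E : Setup P sf A)
    {Bd : Polynomial ℕ} (hN : E.N < Bd.eval E.n) (hq : E.q < Bd.eval E.n) (hoff : E.off < Bd.eval E.n)
    (hjj : E.jj < Bd.eval E.n) (v r : List Bool)
    (hr : r.length = Bd.eval E.n ^ 6 + adviceCode (Bd.eval E.n) E.N E.q E.off E.jj E.κ) :
    Drun P sf A Bd (boolPair (unaryEncodeNat E.n) v) r = E.Dcore v r := by
  unfold Drun
  rw [boolUnpair_boolPair]
  simp only [SKEScheme.length_unaryEncodeNat, hr, Nat.add_sub_cancel_left, adviceCode_d0 hN,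
    adviceCode_d1 hN hq, adviceCode_d2 hN hq hoff, adviceCode_d3 hN hq hoff hjj, adviceCode_d4 hN hq hoff hjj]
  rfl

/-! ### The analysis parameter of an input length -/

namespace Params

variable (P : Params)

/-- `Mof N` is maximal: `N < (Mof N + 1)^3`. [folklore] -/
theorem lt_Mof_succ_pow (N : ℕ) : N < (Mof N + 1) ^ 3 := by
  by_contra h
  have := le_Mof (not_lt.1 h)
  omega

/-- The analysis parameter of the input length `N`: the largest `n ≤ Mof N` with
`B(n)^6 + B(n)^3 ≤ Mof N` (so that every good block length of parameter `n` is present). [folklore] -/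
def nOfN (N : ℕ) : ℕ := Nat.findGreatest (fun n => P.B n ^ 6 + P.B n ^ 3 ≤ Mof N) (Mof N)

/-- A nonzero analysis parameter has its block lengths present. [folklore] -/
theorem nOfN_spec {N n : ℕ} (h : P.nOfN N = n) (hn : n ≠ 0) : P.B n ^ 6 + P.B n ^ 3 ≤ Mof N :=
  ((Nat.findGreatest_eq_iff.1 h).2.1 hn)

/-- Anything whose block lengths are present is below the analysis parameter. [folklore] -/
theorem le_nOfN {N a : ℕ} (h : P.B a ^ 6 + P.B a ^ 3 ≤ Mof N) : a ≤ P.nOfN N := by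
  refine Nat.le_findGreatest ?_ h
  have := P.le_B a
  calc a ≤ P.B a := by omega
    _ ≤ P.B a ^ 6 := Nat.le_self_pow (by norm_num) _
    _ ≤ Mof N := le_trans (Nat.le_add_right _ _) h

/-- The threshold `Ψ(a) = (B(a)^6 + B(a)^3)^3`: input lengths `N ≥ Ψ(a)` have analysis parameter
`≥ a`. [folklore] -/
def Ψ (a : ℕ) : ℕ := (P.B a ^ 6 + P.B a ^ 3) ^ 3

/-- `nOfN N ≥ a` once `N ≥ Ψ a`. [folklore] -/
theorem le_nOfN_of_Ψ_le {N a : ℕ} (h : P.Ψ a ≤ N) : a ≤ P.nOfN N :=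
  P.le_nOfN (le_Mof h)

/-- The polynomial bound on the input lengths of a given analysis parameter. [folklore] -/
def Nmaxpoly : Polynomial ℕ := ((P.Bpoly.comp (X + 1)) ^ 6 + (P.Bpoly.comp (X + 1)) ^ 3 + 1) ^ 3

/-- Value of `Nmaxpoly`. [folklore] -/
theorem Nmaxpoly_eval (n : ℕ) : P.Nmaxpoly.eval n = (P.B (n + 1) ^ 6 + P.B (n + 1) ^ 3 + 1) ^ 3 := by
  simp [Nmaxpoly, Params.B]

/-- **Input lengths are polynomial in their analysis parameter**: `N < Nmax(nOfN N)`. [folklore] -/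
theorem lt_Nmax {N n : ℕ} (h : P.nOfN N = n) : N < P.Nmaxpoly.eval n := by
  rw [Nmaxpoly_eval]
  have h1 : ¬ (P.B (n + 1) ^ 6 + P.B (n + 1) ^ 3 ≤ Mof N) := fun hc => by
    have := P.le_nOfN hc; omega
  have h2 := lt_Mof_succ_pow N
  calc N < (Mof N + 1) ^ 3 := h2
    _ ≤ _ := Nat.pow_le_pow_left (by omega) 3

end Params

/-! ### The challenges of the game at parameter `n` are finitely many -/

/-- Challenges that occur in the multiple-message game at parameter `n`. [folklore] -/
def InGameAt (P : Params) (n : ℕ) (cs : List (List Bool)) : Prop :=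
  ∃ (b : Bool) (k : List Bool), k ∈ (P.S.keyPMF n).support ∧ cs ∈ (P.S.ctVecPMF k (P.msgs b n)).support

/-- Ciphertext-vector laws have finite support. [Arora–Barak 2009, §7.1] [folklore] -/
theorem support_ctVecPMF_finite (S : SKEScheme) (k : List Bool) : ∀ ms : List (List Bool), (S.ctVecPMF k ms).support.Finite
  | [] => by simp [SKEScheme.ctVecPMF]
  | m :: ms => by
    rw [SKEScheme.ctVecPMF, PMF.support_bind]
    refine (randAlg_support_outputPMF_finite _ _ _).biUnion fun c _ => ?_
    rw [PMF.support_map]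
    exact (support_ctVecPMF_finite S k ms).image _

/-- The in-game challenges form a finite set. [folklore] -/
theorem finite_inGameAt (P : Params) (n : ℕ) : {cs | InGameAt P n cs}.Finite := by
  have h : {cs | InGameAt P n cs} = ⋃ b : Bool, ⋃ k ∈ (P.S.keyPMF n).support, (P.S.ctVecPMF k (P.msgs b n)).support := by
    ext cs; simp [InGameAt]
  rw [h]
  exact Set.finite_iUnion fun b => (randAlg_support_outputPMF_finite _ _ _).biUnion fun k _ => support_ctVecPMF_finite _ _ _

/-- A bound on the length of the encoded in-game challenges at parameter `n`. [folklore] -/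
theorem exists_Cbound (P : Params) (n : ℕ) : ∃ C : ℕ, ∀ cs, InGameAt P n cs → ((encodingList Bool).listBool.encode cs).length ≤ C := by
  obtain ⟨C, hC⟩ := ((finite_inGameAt P n).image fun cs => ((encodingList Bool).listBool.encode cs).length).bddAbove
  exact ⟨C, fun cs hcs => hC ⟨cs, hcs, rfl⟩⟩

/-- The chosen length bound `C(n)`. [folklore] -/
def Cof (P : Params) (n : ℕ) : ℕ := Classical.choose (exists_Cbound P n)

/-- `C(n)` bounds the encoded in-game challenges. [folklore] -/
theorem Cof_spec (P : Params) {n : ℕ} {cs : List (List Bool)} (h : InGameAt P n cs) :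
    ((encodingList Bool).listBool.encode cs).length ≤ Cof P n :=
  Classical.choose_spec (exists_Cbound P n) cs h

/-! ### The plaintext vectors are admissible -/

/-- **`M_b` has polynomial total size.** [Goldreich 2004, Def. 5.2.9 (`t, ℓ` polynomials)] [folklore] -/
theorem isPolyLengthVec_msgs (P : Params) (b : Bool) : IsPolyLengthVec fun n => P.msgs b n := by
  refine ⟨2 * (2 * P.Lpoly) + 2 + 2 * P.Lpoly * (2 * P.Lpoly + 2), fun n => le_of_eq ?_⟩
  show ((encodingList Bool).listBool.encode (P.msgs b n)).length = _
  have hmap : List.map (encodingList Bool).encode (P.msgs b n) = P.msgs b n := List.map_id _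
  rw [listBool_encode_eq, List.length_append, List.length_append, Com.length_repBits, SKEScheme.length_unaryEncodeNat, P.length_msgs,
    hmap, Yao.length_frames_of_forall (L := P.L n) (fun m hm => P.length_of_mem_msgs hm), P.length_msgs]
  simp [Params.T, Params.L]

/-! ### The setup of a good pair `(n, N)` -/

namespace Params

variable (P : Params) {sf : Polynomial ℕ}

/-- A good pair has copies at all: `0 < Mof N`. [folklore] -/
theorem Mof_pos_of_good {n N : ℕ} (h : n ≠ 0 ∧ P.nOfN N = n) : 0 < Mof N := by
  have hs := P.nOfN_spec h.2 h.1
  have := P.le_B n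
  have : 1 ≤ P.B n ^ 6 := Nat.one_le_pow _ _ (by omega)
  omega

section KeyLen

variable (hK : ∀ (n : ℕ) (s : List Bool), s.length = P.S.keyGen.coinLen (unaryEncodeNat n).length → (P.S.keyGen.run n s).length ≤ P.pK.eval n)
include hK

/-- A most likely key length at parameter `n` (pigeonhole over lengths `≤ pK(n)`). [folklore] -/
def lamOf (n : ℕ) : ℕ :=
  Classical.choose (P.S.exists_likely_keyLen (n := n) (σ := P.S.keyGen.coinLen (unaryEncodeNat n).length)
    (Kmax := P.pK.eval n) fun s => hK n s.toList (by simp))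

/-- The likely key length is a possible key length. [folklore] -/
theorem lamOf_le (n : ℕ) : P.lamOf hK n ≤ P.pK.eval n :=
  (Classical.choose_spec (P.S.exists_likely_keyLen (n := n) (σ := P.S.keyGen.coinLen (unaryEncodeNat n).length)
    (Kmax := P.pK.eval n) fun s => hK n s.toList (by simp))).1

/-- The likely key length is attained by a `1/(pK(n)+1)` fraction of the seeds. [folklore] -/
theorem lamOf_count (n : ℕ) : 2 ^ P.S.keyGen.coinLen (unaryEncodeNat n).length ≤ (P.pK.eval n + 1) *
    (univ.filter fun s : List.Vector Bool (P.S.keyGen.coinLen (unaryEncodeNat n).length) =>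
      (P.S.keyGen.run n s.toList).length = P.lamOf hK n).card :=
  (Classical.choose_spec (P.S.exists_likely_keyLen (n := n) (σ := P.S.keyGen.coinLen (unaryEncodeNat n).length)
    (Kmax := P.pK.eval n) fun s => hK n s.toList (by simp))).2

variable (hσ : ∀ n, P.S.keyGen.coinLen (unaryEncodeNat n).length ≤ P.pG.eval n) (hE : ∀ ℓ, P.S.enc.coinLen ℓ ≤ P.pE.eval ℓ)
include hσ hE

/-- **The setup of a good pair** `(n, N)` (`n ≠ 0`, `nOfN N = n`) with copy `i`. [folklore] -/
def mkSetup (sf : Polynomial ℕ) (A : RandAlg (List Bool) (List Bool)) {n N : ℕ} (h : n ≠ 0 ∧ P.nOfN N = n) (i : ℕ) (hi : i < Mof N) :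
    Setup P sf A where
  n := n
  N := N
  σ := P.S.keyGen.coinLen (unaryEncodeNat n).length
  lam := P.lamOf hK n
  ρ := P.S.enc.coinLen (2 * P.lamOf hK n + 2 + P.L n)
  i₀ := i
  κ := A.coinLen (2 * N + 2 + (Λof sf N + 1))
  hσ := rfl
  hσG := hσ n
  hρ := rfl
  hσB := by have := hσ n; rw [P.B_eq]; omega
  hlamB := by have := P.lamOf_le hK n; rw [P.B_eq]; omega
  hρB := by
    have h1 := hE (2 * P.lamOf hK n + 2 + P.L n)
    have h2 : P.pE.eval (2 * P.lamOf hK n + 2 + P.L n) ≤ P.Ppoly.eval n := by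
      rw [P.Ppoly_eval]
      exact natPoly_eval_mono _ (by have := P.lamOf_le hK n; omega)
    rw [P.B_eq]; omega
  hjM := by
    have hs := P.nOfN_spec h.2 h.1
    have hd := Params.jStar_digits_lt (P := P) (n := n) (σ := P.S.keyGen.coinLen (unaryEncodeNat n).length) (lam := P.lamOf hK n)
      (ρ := P.S.enc.coinLen (2 * P.lamOf hK n + 2 + P.L n)) (by have := hσ n; rw [P.B_eq]; omega)
      (by have := P.lamOf_le hK n; rw [P.B_eq]; omega) (by
        have h1 := hE (2 * P.lamOf hK n + 2 + P.L n)
        have h2 : P.pE.eval (2 * P.lamOf hK n + 2 + P.L n) ≤ P.Ppoly.eval n := by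
          rw [P.Ppoly_eval]; exact natPoly_eval_mono _ (by have := P.lamOf_le hK n; omega)
        rw [P.B_eq]; omega)
    unfold Params.jStar
    omega
  hi₀ := hi
  hκ := rfl

/-- The real-copy inversion counts do not depend on the copy index of the setup. [folklore] -/
theorem cntIR_mkSetup (sf : Polynomial ℕ) (A : RandAlg (List Bool) (List Bool)) {n N : ℕ} (h : n ≠ 0 ∧ P.nOfN N = n)
    (i : ℕ) (hi : i < Mof N) (j : ℕ) :
    (P.mkSetup hK hσ hE sf A h i hi).cntIR j = (P.mkSetup hK hσ hE sf A h 0 (P.Mof_pos_of_good h)).cntIR j := rfl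

/-- **The best copy**: a copy index maximising the real-copy inversion count. [folklore] -/
def bestCopy (sf : Polynomial ℕ) (A : RandAlg (List Bool) (List Bool)) {n N : ℕ} (h : n ≠ 0 ∧ P.nOfN N = n) : ℕ :=
  Classical.choose (exists_max_image (range (Mof N)) (P.mkSetup hK hσ hE sf A h 0 (P.Mof_pos_of_good h)).cntIR
    ⟨0, mem_range.2 (P.Mof_pos_of_good h)⟩)

/-- The best copy is a copy. [folklore] -/
theorem bestCopy_lt (sf : Polynomial ℕ) (A : RandAlg (List Bool) (List Bool)) {n N : ℕ} (h : n ≠ 0 ∧ P.nOfN N = n) :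
    P.bestCopy hK hσ hE sf A h < Mof N :=
  mem_range.1 (Classical.choose_spec (exists_max_image (range (Mof N)) (P.mkSetup hK hσ hE sf A h 0 (P.Mof_pos_of_good h)).cntIR
    ⟨0, mem_range.2 (P.Mof_pos_of_good h)⟩)).1

/-- **The setup used by the distinguisher** at a good pair. [folklore] -/
def theSetup (sf : Polynomial ℕ) (A : RandAlg (List Bool) (List Bool)) {n N : ℕ} (h : n ≠ 0 ∧ P.nOfN N = n) : Setup P sf A :=
  P.mkSetup hK hσ hE sf A h (P.bestCopy hK hσ hE sf A h) (P.bestCopy_lt hK hσ hE sf A h)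

/-- The chosen copy maximises the real-copy inversion count. [folklore] -/
theorem theSetup_max (sf : Polynomial ℕ) (A : RandAlg (List Bool) (List Bool)) {n N : ℕ} (h : n ≠ 0 ∧ P.nOfN N = n) :
    ∀ i < (P.theSetup hK hσ hE sf A h).M, (P.theSetup hK hσ hE sf A h).cntIR i ≤ (P.theSetup hK hσ hE sf A h).cntIR (P.theSetup hK hσ hE sf A h).i₀ := by
  intro i hi
  have hspec := (Classical.choose_spec (exists_max_image (range (Mof N)) (P.mkSetup hK hσ hE sf A h 0 (P.Mof_pos_of_good h)).cntIR
    ⟨0, mem_range.2 (P.Mof_pos_of_good h)⟩)).2 i (mem_range.2 hi)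
  unfold theSetup
  rw [P.cntIR_mkSetup, P.cntIR_mkSetup]
  exact hspec

end KeyLen

end Params

/-! ### Size estimates at a good pair -/

namespace Params

variable (P : Params) {sf : Polynomial ℕ}
variable (hK : ∀ (n : ℕ) (s : List Bool), s.length = P.S.keyGen.coinLen (unaryEncodeNat n).length → (P.S.keyGen.run n s).length ≤ P.pK.eval n)
variable (hσ : ∀ n, P.S.keyGen.coinLen (unaryEncodeNat n).length ≤ P.pG.eval n) (hE : ∀ ℓ, P.S.enc.coinLen ℓ ≤ P.pE.eval ℓ)
include hK hσ hE

/-- **All copies `⊥` is exponentially unlikely**: `(1 - π)^M ≤ e^{-n}` at a good pair, because the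
likely key length has `π ≥ 1/(pK(n)+1)` and `M ≥ B(n)^6 ≥ n·(pK(n)+1)`. [Goldreich 2001, §2.3.1,
Claim 2.3.2.1 (the same estimate)] [folklore] -/
theorem pow_M_le_exp (A : RandAlg (List Bool) (List Bool)) {n N : ℕ} (h : n ≠ 0 ∧ P.nOfN N = n) (i : ℕ) (hi : i < Mof N) :
    (1 - ((P.mkSetup hK hσ hE sf A h i hi).goodSeeds.card : ℝ) / 2 ^ (P.mkSetup hK hσ hE sf A h i hi).σ) ^ (P.mkSetup hK hσ hE sf A h i hi).M ≤
      Real.exp (-(n : ℝ)) := by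
  set E := P.mkSetup hK hσ hE sf A h i hi with hEdef
  set K := P.pK.eval n with hKdef
  have hcount : 2 ^ E.σ ≤ (K + 1) * E.goodSeeds.card := P.lamOf_count hK n
  have hgle : E.goodSeeds.card ≤ 2 ^ E.σ := E.card_goodSeeds_le
  have hK1 : (1 : ℝ) ≤ (K + 1 : ℕ) := by exact_mod_cast Nat.succ_le_succ (Nat.zero_le _)
  have hπ : 1 / ((K + 1 : ℕ) : ℝ) ≤ (E.goodSeeds.card : ℝ) / 2 ^ E.σ := by
    rw [div_le_div_iff₀ (by positivity) (by positivity), one_mul, mul_comm]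
    exact_mod_cast hcount
  have h0 : 0 ≤ 1 - (E.goodSeeds.card : ℝ) / 2 ^ E.σ := by
    rw [sub_nonneg, div_le_one (by positivity)]; exact_mod_cast hgle
  have hM : n * (K + 1) ≤ E.M := by
    have hs := P.nOfN_spec h.2 h.1
    have hB := P.le_B n
    have hBK : K + 2 ≤ P.B n := by rw [P.B_eq]; omega
    have h2 : n * (K + 1) ≤ P.B n * P.B n := Nat.mul_le_mul (by omega) (by omega)
    have h3 : P.B n * P.B n ≤ P.B n ^ 6 := by
      calc P.B n * P.B n = P.B n ^ 2 := (sq _).symm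
        _ ≤ P.B n ^ 6 := Nat.pow_le_pow_right (by omega) (by norm_num)
    change n * (K + 1) ≤ Mof N
    omega
  calc (1 - (E.goodSeeds.card : ℝ) / 2 ^ E.σ) ^ E.M ≤ (1 - 1 / ((K + 1 : ℕ) : ℝ)) ^ E.M :=
        pow_le_pow_left₀ h0 (by linarith) _
    _ ≤ (1 - 1 / ((K + 1 : ℕ) : ℝ)) ^ (n * (K + 1)) := by
        refine pow_le_pow_of_le_one ?_ ?_ hM
        · rw [sub_nonneg, div_le_one (by positivity)]; exact hK1
        · rw [sub_le_self_iff]; positivity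
    _ ≤ Real.exp (-(n : ℝ)) := Yao.one_sub_div_pow_mul_le (Nat.succ_le_succ (Nat.zero_le _))

/-- **The advantage at a good pair** with a bad input length: if `Pr[A inverts] ≥ 1/N^c`,
`2 N^c e^{-n} ≤ 1` and `4 N^c M 2^{-n} ≤ 1`, then `acc(M₁) - acc(M₀) ≥ 1/(4 N^c M)`. [folklore] -/
theorem adv_lower (hC : P.S.IsCorrect) (hsf : ∀ u, (P.blockFn u).length ≤ sf.eval u.length)
    (A : RandAlg (List Bool) (List Bool)) {n N : ℕ} (h : n ≠ 0 ∧ P.nOfN N = n) {c : ℕ}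
    (hbad : 1 / (N : ℝ) ^ c ≤ invertProb (P.F sf) A N)
    (hsize1 : 2 * (N : ℝ) ^ c * Real.exp (-(n : ℝ)) ≤ 1)
    (hsize2 : 4 * (N : ℝ) ^ c * Mof N * (2⁻¹ : ℝ) ^ n ≤ 1)
    {D : RandAlg (List Bool) Bool} {rest : ℕ} (hD : (P.theSetup hK hσ hE sf A h).DSim D rest) :
    1 / (4 * (N : ℝ) ^ c * Mof N) ≤ ((P.theSetup hK hσ hE sf A h).Acc D true).toReal - ((P.theSetup hK hσ hE sf A h).Acc D false).toReal := by
  set E := P.theSetup hK hσ hE sf A h with hEdef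
  have hadv := E.adv_ge hC hsf (P.theSetup_max hK hσ hE sf A h) hD
  have hexp := P.pow_M_le_exp hK hσ hE (sf := sf) A h (P.bestCopy hK hσ hE sf A h) (P.bestCopy_lt hK hσ hE sf A h)
  have hMpos : 0 < Mof N := P.Mof_pos_of_good h
  have hM : (1 : ℝ) ≤ Mof N := by exact_mod_cast hMpos
  have hN : (1 : ℝ) ≤ N := by
    have := Mof_pow_le N
    have : 1 ≤ Mof N ^ 3 := Nat.one_le_pow _ _ hMpos
    exact_mod_cast (show 1 ≤ N by omega)
  have hNc : (0 : ℝ) < (N : ℝ) ^ c := by positivity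
  -- unfold the setup's numbers
  have hEN : E.N = N := rfl
  have hEn : E.n = n := rfl
  have hEM : (E.M : ℝ) = Mof N := rfl
  rw [hEN, hEM, hEn] at hadv
  change (1 - (E.goodSeeds.card : ℝ) / 2 ^ E.σ) ^ E.M ≤ Real.exp (-(n : ℝ)) at hexp
  -- real arithmetic
  have ht : (1 - (E.goodSeeds.card : ℝ) / 2 ^ E.σ) ^ E.M ≤ 1 / (2 * (N : ℝ) ^ c) := by
    refine hexp.trans ?_
    rw [le_div_iff₀ (by positivity)]
    nlinarith [Real.exp_nonneg (-(n : ℝ))]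
  have hs : 2 * (2⁻¹ : ℝ) ^ (n + 1) ≤ 1 / (4 * (N : ℝ) ^ c * Mof N) := by
    rw [pow_succ, show (2 : ℝ) * ((2⁻¹) ^ n * 2⁻¹) = (2⁻¹) ^ n by ring, le_div_iff₀ (by positivity)]
    nlinarith [pow_nonneg (show (0:ℝ) ≤ 2⁻¹ by norm_num) n]
  have hkey : 1 / (4 * (N : ℝ) ^ c * Mof N) + 1 / (4 * (N : ℝ) ^ c * Mof N) ≤
      (invertProb (P.F sf) A N - (1 - (E.goodSeeds.card : ℝ) / 2 ^ E.σ) ^ E.M) / Mof N := by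
    rw [show 1 / (4 * (N : ℝ) ^ c * Mof N) + 1 / (4 * (N : ℝ) ^ c * Mof N) = (1 / (2 * (N : ℝ) ^ c)) / Mof N by
      field_simp; ring]
    refine div_le_div_of_nonneg_right ?_ (by positivity)
    have : 1 / (2 * (N : ℝ) ^ c) = 1 / (N : ℝ) ^ c - 1 / (2 * (N : ℝ) ^ c) := by field_simp; ring
    linarith
  linarith

omit hK hσ hE in
/-- Monotonicity of `Λ`. [folklore] -/
theorem Λof_mono (sf : Polynomial ℕ) {a b : ℕ} (hab : a ≤ b) : Λof sf a ≤ Λof sf b := by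
  unfold Λof
  have := natPoly_eval_mono sf hab
  have : a * (2 * sf.eval a + 2) ≤ b * (2 * sf.eval b + 2) := Nat.mul_le_mul hab (by omega)
  omega

omit hK hσ hE in
/-- `Λ` as a polynomial. [folklore] -/
theorem Λof_eq_eval (sf : Polynomial ℕ) (N : ℕ) : Λof sf N = (2 * X + 2 + X * (2 * sf + 2) : Polynomial ℕ).eval N := by
  simp [Λof]

/-- **The base polynomial of the advice**: exceeds `N`, `q`, `off`, `j*`, `κ` at every good pair
(`pA` bounds `A`'s coins). [folklore] -/
def Bd (sf pA : Polynomial ℕ) : Polynomial ℕ :=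
  P.Nmaxpoly + pA.comp (2 * P.Nmaxpoly + 3 + (2 * X + 2 + X * (2 * sf + 2)).comp P.Nmaxpoly) + 1

omit hK hσ hE in
/-- Value of `Bd`. [folklore] -/
theorem Bd_eval (sf pA : Polynomial ℕ) (n : ℕ) :
    (P.Bd sf pA).eval n = P.Nmaxpoly.eval n + pA.eval (2 * P.Nmaxpoly.eval n + 3 + Λof sf (P.Nmaxpoly.eval n)) + 1 := by
  simp [Bd, Λof_eq_eval]

/-- **The advised numbers are digits** in base `Bd(n)`, and the budget affords the coins. [folklore] -/
theorem digits_lt (A : RandAlg (List Bool) (List Bool)) {pA : Polynomial ℕ} (hpA : ∀ ℓ, A.coinLen ℓ ≤ pA.eval ℓ)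
    {n N : ℕ} (h : n ≠ 0 ∧ P.nOfN N = n) :
    (P.theSetup hK hσ hE sf A h).N < (P.Bd sf pA).eval n ∧ (P.theSetup hK hσ hE sf A h).q < (P.Bd sf pA).eval n ∧
      (P.theSetup hK hσ hE sf A h).off < (P.Bd sf pA).eval n ∧ (P.theSetup hK hσ hE sf A h).jj < (P.Bd sf pA).eval n ∧
      (P.theSetup hK hσ hE sf A h).κ < (P.Bd sf pA).eval n ∧
      (P.theSetup hK hσ hE sf A h).N + (P.theSetup hK hσ hE sf A h).κ + 1 ≤ (P.Bd sf pA).eval n ^ 6 := by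
  set E := P.theSetup hK hσ hE sf A h with hEdef
  have hNmax : N < P.Nmaxpoly.eval n := P.lt_Nmax h.2
  have hq : E.q < E.M * E.M := E.q_lt
  have hMM : E.M * E.M ≤ N := by
    have h3 := Mof_pow_le N
    have hMpos : 0 < Mof N := P.Mof_pos_of_good h
    calc E.M * E.M ≤ E.M * E.M * E.M := Nat.le_mul_of_pos_right _ hMpos
      _ = Mof N ^ 3 := by change Mof N * Mof N * Mof N = _; ring
      _ ≤ N := h3
  have hoff : E.off + E.jj ≤ N := E.off_add_jj_le
  have hκ : E.κ ≤ pA.eval (2 * P.Nmaxpoly.eval n + 3 + Λof sf (P.Nmaxpoly.eval n)) := by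
    change A.coinLen (2 * N + 2 + (Λof sf N + 1)) ≤ _
    refine (hpA _).trans (natPoly_eval_mono _ ?_)
    have := Λof_mono sf hNmax.le
    omega
  have hBd := P.Bd_eval sf pA n
  have hpow : (P.Bd sf pA).eval n ≤ (P.Bd sf pA).eval n ^ 6 := Nat.le_self_pow (by norm_num) _
  have hEN : E.N = N := rfl
  have hEM : E.M = Mof N := rfl
  refine ⟨by omega, by omega, by omega, by omega, by omega, by omega⟩

end Params

/-! ### The coin budget along a sparse set of parameters -/

/-- Input lengths `|⟨1ⁿ, v⟩|` of game inputs at parameter `n` lie in the window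
`[2n+2, 2n+2+C(n)]`. [folklore] -/
def InWindow (P : Params) (n ℓ : ℕ) : Prop := 2 * n + 2 ≤ ℓ ∧ ℓ ≤ 2 * n + 2 + Cof P n

/-- **The advice-carrying coin budget**: on the window of a parameter `n ∈ T` the per-parameter
budget `bud n`, elsewhere `0`. [folklore] -/
def clFn (P : Params) (T : Set ℕ) (bud : ℕ → ℕ) (ℓ : ℕ) : ℕ :=
  if h : ∃ n, n ∈ T ∧ InWindow P n ℓ then bud h.choose else 0

/-- On a sparse `T` the windows are disjoint, so the budget of a window is its parameter's. [folklore] -/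
theorem clFn_eq (P : Params) {T : Set ℕ} (hsep : ∀ n ∈ T, ∀ n' ∈ T, n < n' → 2 * n + Cof P n < 2 * n') (bud : ℕ → ℕ)
    {n ℓ : ℕ} (hn : n ∈ T) (hℓ : InWindow P n ℓ) : clFn P T bud ℓ = bud n := by
  have hex : ∃ n, n ∈ T ∧ InWindow P n ℓ := ⟨n, hn, hℓ⟩
  unfold clFn
  rw [dif_pos hex]
  obtain ⟨hn', hℓ'⟩ := hex.choose_spec
  set n' := hex.choose
  rcases lt_trichotomy n n' with hlt | heq | hgt
  · have := hsep n hn n' hn' hlt; unfold InWindow at hℓ hℓ'; omega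
  · rw [← heq]
  · have := hsep n' hn' n hn hgt; unfold InWindow at hℓ hℓ'; omega

/-- The budget is polynomially bounded when the per-parameter budgets are. [folklore] -/
theorem clFn_le (P : Params) (T : Set ℕ) {bud : ℕ → ℕ} {g : Polynomial ℕ} (hbud : ∀ n, bud n ≤ g.eval n) (ℓ : ℕ) :
    clFn P T bud ℓ ≤ g.eval ℓ := by
  unfold clFn
  split_ifs with h
  · set m := h.choose with hm
    have hw : InWindow P m ℓ := h.choose_spec.2
    unfold InWindow at hw
    exact (hbud m).trans (natPoly_eval_mono _ (by omega))
  · exact Nat.zero_le _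

namespace Params

variable (P : Params) {sf : Polynomial ℕ}
variable (hK : ∀ (n : ℕ) (s : List Bool), s.length = P.S.keyGen.coinLen (unaryEncodeNat n).length → (P.S.keyGen.run n s).length ≤ P.pK.eval n)
variable (hσ : ∀ n, P.S.keyGen.coinLen (unaryEncodeNat n).length ≤ P.pG.eval n) (hE : ∀ ℓ, P.S.enc.coinLen ℓ ≤ P.pE.eval ℓ)
include hK hσ hE

/-- **The per-parameter budget**: at a good pair `(n, Nof n)`, `Bd(n)^6 +` the advice code of its
setup; `0` otherwise. [folklore] -/
def budAt (sf : Polynomial ℕ) (A : RandAlg (List Bool) (List Bool)) (pA : Polynomial ℕ) (Nof : ℕ → ℕ) (n : ℕ) : ℕ :=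
  if h : n ≠ 0 ∧ P.nOfN (Nof n) = n then
    (P.Bd sf pA).eval n ^ 6 + adviceCode ((P.Bd sf pA).eval n) (P.theSetup hK hσ hE sf A h).N (P.theSetup hK hσ hE sf A h).q
      (P.theSetup hK hσ hE sf A h).off (P.theSetup hK hσ hE sf A h).jj (P.theSetup hK hσ hE sf A h).κ
  else 0

/-- The per-parameter budget is polynomially bounded: `≤ Bd^6 + Bd^5`. [folklore] -/
theorem budAt_le (sf : Polynomial ℕ) (A : RandAlg (List Bool) (List Bool)) {pA : Polynomial ℕ} (hpA : ∀ ℓ, A.coinLen ℓ ≤ pA.eval ℓ)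
    (Nof : ℕ → ℕ) (n : ℕ) : P.budAt hK hσ hE sf A pA Nof n ≤ ((P.Bd sf pA) ^ 6 + (P.Bd sf pA) ^ 5).eval n := by
  unfold budAt
  rw [eval_add, eval_pow, eval_pow]
  split_ifs with h
  · obtain ⟨h1, h2, h3, h4, h5, -⟩ := P.digits_lt hK hσ hE (sf := sf) A hpA h
    have := adviceCode_lt h1 h2 h3 h4 h5
    omega
  · exact Nat.zero_le _

/-- **The distinguisher**: `Drun` with the advice-carrying budget. [Goldreich 2001, §3.8 Exercise 11] [folklore] -/
def theD (sf : Polynomial ℕ) (A : RandAlg (List Bool) (List Bool)) (pA : Polynomial ℕ) (Nof : ℕ → ℕ) (T : Set ℕ) :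
    RandAlg (List Bool) Bool where
  run := Drun P sf A (P.Bd sf pA)
  coinLen := clFn P T (P.budAt hK hσ hE sf A pA Nof)

/-- **The distinguisher is PPT** (given the machine fact for `Drun`). [folklore] -/
theorem theD_isPPT (sf : Polynomial ℕ) (A : RandAlg (List Bool) (List Bool)) {pA : Polynomial ℕ} (hpA : ∀ ℓ, A.coinLen ℓ ≤ pA.eval ℓ)
    (Nof : ℕ → ℕ) (T : Set ℕ)
    (hD : PolyTimeComputable (fun p : List Bool × List Bool => boolPair p.1 p.2) encodeBool (Function.uncurry (Drun P sf A (P.Bd sf pA)))) :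
    IsPPT (P.theD hK hσ hE sf A pA Nof T) encodeBool :=
  ⟨hD, ⟨(P.Bd sf pA) ^ 6 + (P.Bd sf pA) ^ 5, fun ℓ => clFn_le P T (P.budAt_le hK hσ hE sf A hpA Nof) ℓ⟩⟩

/-- **On a sparse `T` the distinguisher behaves like the core** at every good parameter `n ∈ T`.
[folklore] -/
theorem theD_DSim (sf : Polynomial ℕ) (A : RandAlg (List Bool) (List Bool)) {pA : Polynomial ℕ} (hpA : ∀ ℓ, A.coinLen ℓ ≤ pA.eval ℓ)
    (Nof : ℕ → ℕ) {T : Set ℕ} (hsep : ∀ n ∈ T, ∀ n' ∈ T, n < n' → 2 * n + Cof P n < 2 * n')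
    {n : ℕ} (hn : n ∈ T) (h : n ≠ 0 ∧ P.nOfN (Nof n) = n) :
    (P.theSetup hK hσ hE sf A h).DSim (P.theD hK hσ hE sf A pA Nof T)
      (P.budAt hK hσ hE sf A pA Nof n - ((P.theSetup hK hσ hE sf A h).N + (P.theSetup hK hσ hE sf A h).κ + 1)) := by
  obtain ⟨h1, h2, h3, h4, h5, h6⟩ := P.digits_lt hK hσ hE (sf := sf) A hpA h
  set E := P.theSetup hK hσ hE sf A h with hEdef
  have hbud : P.budAt hK hσ hE sf A pA Nof n = (P.Bd sf pA).eval n ^ 6 + adviceCode ((P.Bd sf pA).eval n) E.N E.q E.off E.jj E.κ := by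
    unfold budAt; rw [dif_pos h]
  have hcl : ∀ cs, E.InGame cs → (P.theD hK hσ hE sf A pA Nof T).coinLen (boolPair (unaryEncodeNat E.n) ((encodingList Bool).listBool.encode cs)).length =
      P.budAt hK hσ hE sf A pA Nof n := by
    intro cs hcs
    change clFn P T _ _ = _
    refine clFn_eq P hsep _ hn ⟨?_, ?_⟩
    · rw [length_boolPair, SKEScheme.length_unaryEncodeNat]; change 2 * n + 2 ≤ 2 * n + 2 + _; omega
    · rw [length_boolPair, SKEScheme.length_unaryEncodeNat]
      have := Cof_spec P (n := n) (cs := cs) hcs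
      change 2 * n + 2 + _ ≤ 2 * n + 2 + Cof P n; omega
  refine ⟨fun cs hcs => ?_, fun cs r hcs hr => ?_⟩
  · rw [hcl cs hcs]; omega
  · change Drun P sf A (P.Bd sf pA) _ r = _
    refine Drun_boolPair E h1 h2 h3 h4 _ r ?_
    change r.length = (P.Bd sf pA).eval n ^ 6 + adviceCode ((P.Bd sf pA).eval n) E.N E.q E.off E.jj E.κ
    rw [hr, ← hbud]; omega

end Params

/-! ### The candidate is one-way -/

/-- `Q(n) ≤ Q(1) · n^{deg Q}` for `n ≥ 1` (private twin of the same estimate in `YaoAmplification.lean`). [folklore] -/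
private theorem natPoly_eval_le_mul_pow (Q : Polynomial ℕ) {n : ℕ} (hn : 1 ≤ n) : Q.eval n ≤ Q.eval 1 * n ^ Q.natDegree := by
  rw [Polynomial.eval_eq_sum_range, Polynomial.eval_eq_sum_range, Finset.sum_mul]
  refine Finset.sum_le_sum fun i hi => ?_
  rw [one_pow, mul_one]
  rw [Finset.mem_range] at hi
  exact Nat.mul_le_mul_left _ (Nat.pow_le_pow_right hn (by omega))

namespace Params

variable (P : Params) {sf : Polynomial ℕ}

/-- The analysis parameter tends to infinity with the input length. [folklore] -/
theorem tendsto_nOfN : Tendsto P.nOfN atTop atTop :=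
  tendsto_atTop_atTop.2 fun a => ⟨P.Ψ a, fun _ hN => P.le_nOfN_of_Ψ_le hN⟩

variable (hK : ∀ (n : ℕ) (s : List Bool), s.length = P.S.keyGen.coinLen (unaryEncodeNat n).length → (P.S.keyGen.run n s).length ≤ P.pK.eval n)
variable (hσ : ∀ n, P.S.keyGen.coinLen (unaryEncodeNat n).length ≤ P.pG.eval n) (hE : ∀ ℓ, P.S.enc.coinLen ℓ ≤ P.pE.eval ℓ)
include hK hσ hE

/-- **The candidate is one-way** (Impagliazzo–Luby 1989, Thm. 1 for private-key encryption, in the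
tree's machine model, modulo the two machine facts `hF`, `hD`): for a correct scheme with
indistinguishable multiple encryptions whose coin budgets and key lengths obey the polynomial
bounds of `P`, the direct product `F` over all block lengths of the block function is a strong
one-way function. [Impagliazzo–Luby 1989, Thm. 1; Goldreich 2004, §5.5 Exercise 2; Goldreich 2001,
§3.8 Exercise 11] [cite: Goldreich2004, §5.5 Exercise 2 (guideline)] -/
theorem isOneWay_F (hC : P.S.IsCorrect) (hsec : P.S.HasIndMultipleEncryptions)
    (hsf : ∀ u, (P.blockFn u).length ≤ sf.eval u.length) (hF : PolyTimeComputable id id (P.F sf))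
    (hD : ∀ A : RandAlg (List Bool) (List Bool), IsPPT A id → ∀ Bd : Polynomial ℕ,
      PolyTimeComputable (fun p : List Bool × List Bool => boolPair p.1 p.2) encodeBool (Function.uncurry (Drun P sf A Bd))) :
    IsOneWay (P.F sf) := by
  refine ⟨hF, fun A hA => ?_⟩
  by_contra hns
  -- (1) a non-negligible inversion probability
  obtain ⟨c, hfreq⟩ : ∃ c : ℕ, ∃ᶠ N : ℕ in atTop, 1 / (N : ℝ) ^ c ≤ invertProb (P.F sf) A N := by
    have h' := (isNegligible_iff_eventually_lt_of_nonneg fun N => invertProb_nonneg (P.F sf) A N).not.1 hns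
    push Not at h'
    obtain ⟨c, hc⟩ := h'
    exact ⟨c, by simpa [Filter.not_eventually, not_lt] using hc⟩
  obtain ⟨pA, hpA⟩ := hA.2
  -- (2) bad analysis parameters satisfying the size conditions are frequent
  set bad : ℕ → Prop := fun N => 1 / (N : ℝ) ^ c ≤ invertProb (P.F sf) A N with hbad
  set Q : Polynomial ℕ := 4 * P.Nmaxpoly ^ (c + 1) with hQ
  set k : ℕ := Q.natDegree + 1 with hk
  set cond : ℕ → Prop := fun n => 1 ≤ n ∧ 2 * ((P.Nmaxpoly.eval n : ℕ) : ℝ) ^ c * Real.exp (-(n : ℝ)) ≤ 1 ∧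
      4 * ((P.Nmaxpoly.eval n : ℕ) : ℝ) ^ (c + 1) * Real.exp (-((n : ℝ) / 2)) ≤ 1 ∧ Q.eval 1 ≤ n with hcond
  have hEv : ∀ᶠ n in atTop, cond n := by
    have h1 := Yao.eventually_natPoly_mul_exp_lt (C 2 * P.Nmaxpoly ^ c) (c := 1) one_pos
    have h2 := Yao.eventually_natPoly_mul_exp_lt (C 4 * P.Nmaxpoly ^ (c + 1)) (c := 1 / 2) (by norm_num)
    filter_upwards [h1, h2, eventually_ge_atTop 1, eventually_ge_atTop (Q.eval 1)] with n hn1 hn2 hn3 hn4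
    refine ⟨hn3, ?_, ?_, hn4⟩
    · have e : ((eval n (C 2 * P.Nmaxpoly ^ c) : ℕ) : ℝ) = 2 * ((P.Nmaxpoly.eval n : ℕ) : ℝ) ^ c := by simp
      rw [e, show -(1 * (n : ℝ)) = -(n : ℝ) by ring] at hn1
      exact hn1.le
    · have e : ((eval n (C 4 * P.Nmaxpoly ^ (c + 1)) : ℕ) : ℝ) = 4 * ((P.Nmaxpoly.eval n : ℕ) : ℝ) ^ (c + 1) := by simp
      rw [e, show -(1 / 2 * (n : ℝ)) = -((n : ℝ) / 2) by ring] at hn2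
      exact hn2.le
  set G : ℕ → Prop := fun n => (∃ N, P.nOfN N = n ∧ bad N) ∧ cond n with hG
  have hGfreq : ∃ᶠ n in atTop, G n := by
    have h1 : ∃ᶠ n in atTop, ∃ N, P.nOfN N = n ∧ bad N :=
      (P.tendsto_nOfN).frequently (hfreq.mono fun N hN => ⟨N, rfl, hN⟩)
    exact h1.and_eventually hEv
  have hG' : ∀ a, ∃ b, a ≤ b ∧ G b := fun a => by
    obtain ⟨b, hb, hGb⟩ := frequently_atTop.1 hGfreq a
    exact ⟨b, hb, hGb⟩
  choose g hg_ge hg_G using hG'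
  -- (3) the chosen bad input length, the sparse set of parameters, the distinguisher
  set Nof : ℕ → ℕ := fun n => if h : ∃ N, P.nOfN N = n ∧ bad N then h.choose else 0 with hNof
  have hNofspec : ∀ n, G n → P.nOfN (Nof n) = n ∧ bad (Nof n) := fun n hn => by
    simp only [hNof, dif_pos hn.1]; exact hn.1.choose_spec
  set φ := sparseSeq g (fun n => n + Cof P n) with hφ
  have hmono : StrictMono φ := sparseSeq_strictMono hg_ge
  set T : Set ℕ := Set.range φ with hT
  have hsep : ∀ n ∈ T, ∀ n' ∈ T, n < n' → 2 * n + Cof P n < 2 * n' := by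
    intro n hn n' hn' hlt
    have := sparseSeq_range_sep (L := fun n => n + Cof P n) hg_ge n hn n' hn' hlt
    omega
  have hTG : ∀ n ∈ T, G n := by rintro _ ⟨i, rfl⟩; exact sparseSeq_forall (P := G) hg_G i
  set D := P.theD hK hσ hE sf A pA Nof T with hDdef
  have hDppt : IsPPT D encodeBool := P.theD_isPPT hK hσ hE sf A hpA Nof T (hD A hA _)
  -- (4) the security of the scheme along `T`
  have hdecay := hsec (fun n => P.msgs false n) (fun n => P.msgs true n) (isPolyLengthVec_msgs P false)
    (fun n => P.map_length_msgs n) D hDppt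
  have hev : ∀ᶠ n : ℕ in atTop, (n : ℝ) ^ k * multEavAdvantage P.S D (fun n => P.msgs false n) (fun n => P.msgs true n) n < 1 :=
    (hdecay k).eventually (gt_mem_nhds one_pos)
  have hfreqT : ∃ᶠ n in atTop, n ∈ T := frequently_atTop.2 fun a => ⟨φ a, hmono.id_le a, a, rfl⟩
  obtain ⟨n, hn_lt, hn_T⟩ := (hev.and_frequently hfreqT).exists
  -- (5) at this `n` the advantage is at least `1/n^k`
  have hGn := hTG n hn_T
  obtain ⟨-, hn1, hs1, hs2, hnQ⟩ := hTG n hn_T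
  have hgood : n ≠ 0 ∧ P.nOfN (Nof n) = n := ⟨by omega, (hNofspec n hGn).1⟩
  have hbadN : bad (Nof n) := (hNofspec n hGn).2
  have hNmax : Nof n < P.Nmaxpoly.eval n := P.lt_Nmax hgood.2
  have hNmax' : ((Nof n : ℕ) : ℝ) ≤ ((P.Nmaxpoly.eval n : ℕ) : ℝ) := by exact_mod_cast hNmax.le
  have hMN : Mof (Nof n) ≤ Nof n := le_trans (Nat.le_self_pow (by norm_num) _) (Mof_pow_le _)
  have hsize1 : 2 * ((Nof n : ℕ) : ℝ) ^ c * Real.exp (-(n : ℝ)) ≤ 1 := by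
    refine le_trans ?_ hs1
    gcongr
  have hsize2 : 4 * ((Nof n : ℕ) : ℝ) ^ c * Mof (Nof n) * (2⁻¹ : ℝ) ^ n ≤ 1 := by
    refine le_trans ?_ hs2
    have h2 : (2⁻¹ : ℝ) ^ n ≤ Real.exp (-((n : ℝ) / 2)) := by
      have h := Real.add_one_le_exp (-(2⁻¹ : ℝ))
      rw [show -((n : ℝ) / 2) = (n : ℕ) * (-(2⁻¹ : ℝ)) by ring, Real.exp_nat_mul]
      exact pow_le_pow_left₀ (by norm_num) (by linarith) n
    have h3 : ((Nof n : ℕ) : ℝ) ^ c * Mof (Nof n) ≤ ((P.Nmaxpoly.eval n : ℕ) : ℝ) ^ (c + 1) := by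
      rw [pow_succ]
      have : ((Mof (Nof n) : ℕ) : ℝ) ≤ ((P.Nmaxpoly.eval n : ℕ) : ℝ) := by exact_mod_cast hMN.trans hNmax.le
      gcongr
    calc 4 * ((Nof n : ℕ) : ℝ) ^ c * Mof (Nof n) * (2⁻¹ : ℝ) ^ n = 4 * (((Nof n : ℕ) : ℝ) ^ c * Mof (Nof n)) * (2⁻¹ : ℝ) ^ n := by ring
      _ ≤ 4 * ((P.Nmaxpoly.eval n : ℕ) : ℝ) ^ (c + 1) * Real.exp (-((n : ℝ) / 2)) := by gcongr
  have hDsim := P.theD_DSim hK hσ hE sf A hpA Nof hsep hn_T hgood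
  have hadv := P.adv_lower hK hσ hE hC hsf A hgood hbadN hsize1 hsize2 hDsim
  have hmult : multEavAdvantage P.S D (fun n => P.msgs false n) (fun n => P.msgs true n) n =
      |((P.theSetup hK hσ hE sf A hgood).Acc D false).toReal - ((P.theSetup hK hσ hE sf A hgood).Acc D true).toReal| := rfl
  have hge : 1 / (4 * ((Nof n : ℕ) : ℝ) ^ c * Mof (Nof n)) ≤ multEavAdvantage P.S D (fun n => P.msgs false n) (fun n => P.msgs true n) n := by
    rw [hmult, abs_sub_comm]
    exact hadv.trans (le_abs_self _)
  -- `4 N^c M ≤ Q(n) ≤ n^k`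
  have hMpos : (0 : ℝ) < Mof (Nof n) := by exact_mod_cast P.Mof_pos_of_good hgood
  have hNpos : (0 : ℝ) < Nof n := lt_of_lt_of_le hMpos (by exact_mod_cast hMN)
  have hQn : 4 * ((Nof n : ℕ) : ℝ) ^ c * Mof (Nof n) ≤ (n : ℝ) ^ k := by
    have h1 : 4 * ((Nof n : ℕ) : ℝ) ^ c * Mof (Nof n) ≤ ((Q.eval n : ℕ) : ℝ) := by
      have e : ((Q.eval n : ℕ) : ℝ) = 4 * (((P.Nmaxpoly.eval n : ℕ) : ℝ) ^ c * ((P.Nmaxpoly.eval n : ℕ) : ℝ)) := by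
        simp [hQ, pow_succ]
      rw [e, mul_assoc]
      have : ((Mof (Nof n) : ℕ) : ℝ) ≤ ((P.Nmaxpoly.eval n : ℕ) : ℝ) := by exact_mod_cast hMN.trans hNmax.le
      gcongr
    have h2 : Q.eval n ≤ n ^ k := by
      calc Q.eval n ≤ Q.eval 1 * n ^ Q.natDegree := natPoly_eval_le_mul_pow Q hn1
        _ ≤ n * n ^ Q.natDegree := Nat.mul_le_mul_right _ hnQ
        _ = n ^ k := by rw [hk, pow_succ, mul_comm]
    exact h1.trans (by exact_mod_cast h2)
  have hone : (1 : ℝ) ≤ (n : ℝ) ^ k * multEavAdvantage P.S D (fun n => P.msgs false n) (fun n => P.msgs true n) n := by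
    have hpos : (0 : ℝ) < 4 * ((Nof n : ℕ) : ℝ) ^ c * Mof (Nof n) := by positivity
    calc (1 : ℝ) = (4 * ((Nof n : ℕ) : ℝ) ^ c * Mof (Nof n)) * (1 / (4 * ((Nof n : ℕ) : ℝ) ^ c * Mof (Nof n))) := by
          field_simp
      _ ≤ (n : ℝ) ^ k * multEavAdvantage P.S D (fun n => P.msgs false n) (fun n => P.msgs true n) n :=
          mul_le_mul hQn hge (by positivity) (by positivity)
  linarith

end Params

end

end SKEOWF

end Literature.Computability.Cryptography
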